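import Summits.ValiantsHypothesis.ValiantsHypothesis.Theses.FeketeSOS
import Summits.ValiantsHypothesis.ValiantsHypothesis.Theorems.FeketeSOSHard.Negative.KillCriterion

/-!
# Disproof of `FeketeSOS.SOSMagnification` (crux stmt-ValiantsHypothesis-3995) — findings

work file of the standing disprover (gen 1: refuter-cdisprove-stmt-ValiantsHypothesis-3995-0;
gen 2 / cycle 2: refuter-cdisprove-stmt-ValiantsHypothesis-3995-g2-0; gen 3 / cycle 3:
refuter-cdisprove-stmt-ValiantsHypothesis-3995-g3-0; gen 4 / cycle 4: refuter-cdisprove-stmt-ValiantsHypothesis-3995-g4-0;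
gen 5 / cycle 5: refuter-cdisprove-stmt-ValiantsHypothesis-3995-g5-0);
prose only in docstrings.
Sorry-free; axioms ⊆ {propext, Classical.choice, Quot.sound}.  v3 (cycle 3): section `Cycle 3` (primality of
the modulus is load-bearing in X; Targets = the 7 registered stubs of the picked line `sml-polarised-transport`,
all TRUE as typed — findings 14–17 below).  v4 (cycle 4): sections `Cycle 4` at the end of the file — Targets of
the re-lined skeleton `b38bc7f1…` (helper stub `isVNPFamily_of_levelwise` PROVED), the calibration of X against
Sárközy's conjecture (`feketeSOSHard_false_of_sparseQRSplits`), the homogeneity lemma (Galois genericity forbids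
sparse splittings, `esymm_ne_zero_of_homogeneous`) and the CRT identity (`crtA_mul_crtB`: the cyclic form of X fails
at squarefree composite conductors, `not_cyclicSliceSquarefreeAt`) — findings 20–27 below; this version imports
the sibling crux's landed `Theorems.FeketeSOSHard.Negative.KillCriterion`.  v5 (cycle 5, TERMINAL for the crux): the seven
stubs of the picked line are ALL LANDED and their joint sufficiency is audited end-to-end (`FullChain.lean`, finding 28:
the crux is a theorem of the library, so no disproof exists); what the proved crux hands to the attackers of X
(finding 29); line post-mortem — which stub hypotheses were load-bearing, and the radix threshold of the polarised count
(`radix_two_budget_fails`, `fixed_radix_budget_fails`, section `Cycle 5`; finding 30); where the adversarial work goes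
now (finding 31).

LANDED IN TREE (importable): `Summits.ValiantsHypothesis.ValiantsHypothesis.Theorems.SOSMagnification.Negative.FeketeHardDeltaRange`
(p73035, commit 7878e68e4585; namespace `…Theorems.SOSMagnification.Negative`): `two_squares`,
`natDegree_fekete_lt`, `feketeSOSHard_slice_false_of_half_lt` (X(δ) false for δ > 1/2),
`feketeSOSHard_delta_le_half`, `exists_delta_le_half_of_feketeSOSHard` (from X extract δ ∈ (0, 1/2]).
LANDED (cycle 2, p75344 ACCEPTED, commit 3efb86ec4753; importable):
`Summits.ValiantsHypothesis.ValiantsHypothesis.Theorems.SOSMagnification.Negative.FeketeTwoSquaresStructure`: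
`coeff_fekete`, `C_mul_sq_ne_fekete`, `two_le_of_feketeRep`, `natDegree_lt_of_two_squares_fekete`,
`exists_three_squares_fekete_natDegree_gt` (same statements as the `Cycle 2` section below, with the
Fekete sum inlined as in the route items).
LANDED (cycle 3, p77646 ACCEPTED, commit 10d7e65a4c53; importable):
`Summits.ValiantsHypothesis.ValiantsHypothesis.Theorems.SOSMagnification.Negative.FeketePrimePowerModuli`:
`prime_sq_digit_split`, `prime_cube_digit_split`, `jacobiSym_prime_sq`, `jacobiSym_cube`,
`jacobi_slice_to_legendre_slice`, `feketeSOSHard_slice_false_without_prime`, `feketeSOSHard_false_without_prime`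
(+ low/high digit-factor support and degree lemmas); and (p77697 ACCEPTED, commit 27f73c2ddb02; importable):
`Summits.ValiantsHypothesis.ValiantsHypothesis.Theorems.SOSMagnification.Negative.FeketeImprimitiveModuli`:
`jacobiSym_odd_pow`, `charDigits_mul_topDigits`, `odd_prime_pow_digit_split`, `exists_jacobiSym_eq_neg_one`,
`nonprincipal_slice_to_legendre_slice`, `feketeSOSHard_slice_false_nonprincipal` (def-free versions of the
`Cycle 3` section below, statements inlined as in the route items).
LANDED (cycle 4; p81831 ACCEPTED commit 51504c43e22c, p81779 ACCEPTED commit 33d5628fd392; importable):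
`Summits.ValiantsHypothesis.ValiantsHypothesis.Theorems.SOSMagnification.Negative.FeketeCyclicCompositeModuli`:
`crtA`, `crtB`, `crtW`, `crtρ`, `crtCoef`, `crtA_mul_crtB`, `feketeCyclicSlice_false_squarefree` (§Cycle 4 CRT below);
`Summits.ValiantsHypothesis.ValiantsHypothesis.Theorems.SOSMagnification.Negative.FeketeSarkozyCalibration`:
`fekete_eq_two_mul_qrPoly_sub_ones`, `qrPoly_ne_zero`, `natDegree_qrPoly_lt`, `feketeSOSHard_false_of_sparseQRSplits`
(def-free: `Q_p` inlined as `∑ m ∈ (range p).filter (fun m : ℕ => legendreSym p m = 1), X ^ m`).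

Findings so far (cycle 1):

1. **Logical immunity.** `SOSMagnification` is *literally* `FeketeSOSHard → ValiantsHypothesis`
   (`sosMagnification_iff`, `Iff.rfl`).  Hence `¬ SOSMagnification ↔ FeketeSOSHard ∧ ¬ ValiantsHypothesis`
   (`not_sosMagnification_iff`): an unconditional refutation of this crux would contain a proof of
   `VP_ℂ = VNP_ℂ` (the negation of the summit) AND a proof of the open additive-combinatorial thesis X.
   No counterexample search / small model can reach it.  The only cheap failure modes are therefore
   (a) the hypothesis X being junk-TRUE (then the crux is the summit in a costume) or (b) X being
   junk-FALSE (then the crux is vacuously provable and the ROUTE dies at item 3996) — both checked below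
   and neither holds for a typing reason.
2. **X is honestly typed.** The exponent `1 / 2 + δ` elaborates in `ℝ` (`(1/2 : ℝ) + δ`, probe W.lean,
   `pp.numericTypes`), not as `Nat` division; `legendreSym p ↑m` with `m : ℕ`; rpow throughout.
   `hardAt_anti`: the per-δ statement is antitone in δ, so `FeketeSOSHard` = "X(δ) for all small δ > 0".
3. **Non-vacuity of the universal in X** (`two_squares_rep`): for every prime `p` the class of admitted
   representations is inhabited as soon as `p ^ δ ≥ 2` — `F_p = ¼(F_p+1)² − ¼(F_p−1)²`, degrees `p−1 ≤ p²`,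
   support-sum `2p`; so X is not true for lack of representations, and X(δ) already fails for δ > 1/2 + o(1)
   unless such dense representations are beaten — they are not: support-sum 2p ≥ p^{1/2+δ} only for δ ≤ 1/2+….
4. **Tightness in δ** (`not_hardAt_of_half_lt`, `feketeSOSHard_iff_small`): X(δ) is FALSE for every
   δ > 1/2 — the dense two-square representation is admitted (s = 2 ≤ p^δ, degree p−1 ≤ p²) and has
   support-sum ≤ 2p < p^{1/2+δ}; so X ⇔ X restricted to δ ∈ (0, 1/2]: X asks exactly for a polynomial
   gain inside the window [√(2(p−1)), 2p] between the trivial counting bound (item TrivialSupportBound)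
   and the dense representation.  (Also `not_hardAt_of_one_lt` by the independent monomial-by-monomial
   model `χ(m)X^m = ¼χ(m)(X^⌈m/2⌉+X^⌊m/2⌋)² − ¼χ(m)(X^⌈m/2⌉−X^⌊m/2⌋)²`, s = 2p, support-sum ≤ 4p —
   a template for manipulating the inlined sums over `Fin s`.)
5. **Transfer bookkeeping re-derived** (paper, DST24 §3.1 pp. 12–13 read from the held CC-BY text): with
   the tree's PROVED `DuttaSaxenaThierauf2024_sosDecomposition` (c = 8: s' ≤ (L·n+2)^{8(⌊log₂ n⌋+1)},
   deg qᵢ ≤ ⌈n/2⌉), k = ⌈6^{1/δ}⌉+1, p_n = largest prime ≤ kⁿ (> kⁿ/2, Bertrand), the representation of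
   F_{p_n} produced from a size-(n^c+c) circuit for the Fekete block-multilinear family has
   s' = n^{O(log n)} ≤ p_n^δ, deg gᵢ ≤ ⌈n/2⌉(k−1)k^{n−1} ≤ n·p_n ≤ p_n², and support-sum
   ≤ s'·C(kn+⌈n/2⌉,⌈n/2⌉) ≤ s'·(e(2k+1))^{⌈n/2⌉} = k^{n/2}·exp(n(1+ln(2+1/k))/2 + O(log² n))
   < (kⁿ/2)^{1/2+δ} because δ·ln k ≥ ln 6 ≈ 1.79 > (1+ln 2.15)/2 ≈ 0.88.  All three side conditions of X
   are met with room: the restricted hypothesis suffices for DST's contradiction (true to the PROOF of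
   DST24 Thm 3.2 + Remark 2, not to its statement) — I find no quantitative gap.  Remaining prover debt:
   ¬VH ⇒ family ∈ VP (set equality `VP ℂ = VNP ℂ`, bundling via `PolyFamily`), VNP-membership via
   `ValiantCriterion.isVNPFamily_circuitSum` needs an ACTUAL B₂-circuit family for
   `e ↦ [e block-one-hot ∧ (i(e) | p_n) = ±1]` (P/poly with p_n as advice) and closure of VNP under
   subtraction; Kronecker substitution = `Polynomial.aeval`/`MvPolynomial.aeval` bookkeeping.
5b. **Explicit onset** (numerics, this seat; tree constants c = 8 in Lemma 3.1, L(n) = n^c' + c'): all three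
   side conditions of X (s' ≤ p^δ, deg ≤ p², s'·C(kn+⌈n/2⌉,⌈n/2⌉) < (kⁿ/2)^{1/2+δ}) hold for every n ≥ n₀ with
   n₀ ≈ 1322 / 2336 / 3248 for c' = 1 / 2 / 3 at δ = 1/2 (k = 37), and n₀ ≈ 1348 / 2374 / 3296 at δ = 1/10
   (k = 60466177) — the binding constraint is the quasi-polynomial fan-in (L n+2)^{8(⌊log₂ n⌋+1)} ≤ p^δ ≈ 6ⁿ,
   essentially independent of δ.  So the proof is asymptotic in n with astronomically large p_n; nothing is
   decidable by evaluation.  DST24 Thm 3.9's own proof assumes ε < 1/2 (p. 14), matching item 4.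
5c. **Slack in the typing of X (planner information, not a defect).** DST's contradiction only ever feeds X
   representations with s' ≤ (L n+2)^{8(⌊log₂ n⌋+1)} = (log p)^{O_{c'}(log log p)} squares (quasi-polylog in p,
   far below p^δ) of degree ≤ ⌈n/2⌉(k−1)k^{n−1} ≤ p·log₂ p (far below p²).  Hence the crux stays provable along
   the same lines if X is WEAKENED to exclude only representations with, e.g., s ≤ 2^{(log₂ log₂ p)^3} and
   deg gᵢ ≤ p·log₂ p; should items 3996–3998 prove too strong, this is the cheapest restatement that keeps
   the bridge (DST24 Remark 2 after Thm 3.2 for the degree; Lemma 3.1's fan-in count for s).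
6. **WHY IT RESISTS**: every weakening/strengthening of the crux that keeps the conclusion
   `ValiantsHypothesis` is refutable only together with `¬ ValiantsHypothesis`; the loaded content of the
   route sits in X (items 3996–3998), which this seat does not hold.  Negative lemmas that CAN be landed
   concern only the parameter range of X (items 3–4 above).

Findings of cycle 2 (gen 2; new Lean content in the section `Cycle 2` at the end of this file):

7. **Reading the crux contrapositively** (`not_sosMagnification_iff_vp_eq`, `sosMagnification_iff_refutes`):
   the crux is *equivalent* to `VP ℂ = VNP ℂ → ¬ FeketeSOSHard` — the provers of this item are proving a
   CONDITIONAL DISPROOF of X (DST's mechanism run forwards: a polynomial-size circuit for the Legendre digit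
   family ⇒ few sparse squares for `F_p`).  Unconditionally the same mechanism is the only systematic source
   of cheap representations known to this seat: a circuit of size `2^{o(n/log n)}` for `fekDigit_{k,n}`
   (fixed radix `k`) would give, through the tree's Lemma 3.1 (`c = 8`) and `ψ_lin`, representations of
   `F_{p_n}` with `s = p^{o(1)}` squares and support-sum `p^{1/2 + ln(e(2+1/k))/(2 ln k) + o(1)}`, i.e.
   `¬ X(δ)` for `δ > ln(2e+e/k)/(2 ln k)`; nothing beyond `fekDigit ∈ VNP` (the idea cards) is known, so no
   kill comes from here — X is exactly as safe as `VP ≠ VNP` makes it.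
8. **Small-model structure of X (Lean, this file):** `two_le_of_rep` — every representation uses `s ≥ 2`
   squares (`x = 0` is a simple root: `C_mul_sq_ne_fekete`), so together with `two_squares_rep` the universal
   of `X(δ)` at a prime `p` has content iff `p^δ ≥ 2`.  LOAD-BEARING ANALYSIS of the degree hypothesis
   `∀ i, natDegree (g i) ≤ p²`: for two squares it is DECORATION (`natDegree_lt_of_two_squares`: both
   `deg gᵢ < p`, via the splitting `c₀g₀² + c₁g₁² = (ag₀+bg₁)(ag₀−bg₁)`), so the `s ≤ 2` layer of X is the
   sparse-splitting statement `FeketeNoSparseSplit` up to the factor 2 with NO side condition; from three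
   squares on it is a GENUINE restriction (`exists_three_squares_natDegree_gt`: representations with a
   square of arbitrarily large degree exist, `g₂` arbitrary, `g₀,g₁ = (F_p − g₂² ± 1)/2`).  Whether X without
   the degree bound still holds is open (not refutable here); DST's transfer only needs `deg ≤ p·log₂ p` (5c).
9. **Catalogue of constructions — all land at support-sum Θ(p)** (kit job j010463 — resubmission of the
   cancelled 2-core j009817 — pure python + numpy, `--workitem` attached; parts R/C/S):  dense two squares `2p` (item 4); monomial splitting `4p` with `s = 2p`
   (item 4); factorisations (`s = 2`): exhaustive over all root subsets, min `|supp A|+|supp B| ≥ 0.74 p` for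
   `p ≤ 29` (route-review job j000757) — part (S) of j010463 (queued at publication; numpy root subsets)
   re-derives `p ≤ 23` in the SOS form `|supp(αA+βB)|+|supp(αA−βB)|` (numbers: the job's summary.json);
   parts (R) and (C) below were also run to completion in-session with the identical pure-python code;
   BLOCK/KRONECKER identities `F_p = Σ_{i<t} A_i(x)·B_i(x^T)` (`deg A_i < T`; `2t` squares of support-sum
   `≤ 2t(T + ⌈p/T⌉)`) need `t ≥ rank_ℂ M_T`, `M_T[a][b] = χ_p(a+bT)`, and (R) certifies
   `rank M_T ≥ min(T, ⌈p/T⌉) − 3` for ALL primes `p ≤ 400` and all `T` (13 730 matrices, exact rank mod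
   2⁶¹−1: full rank but for 46 sporadic small cases, defect ≥ 2 only at `(p,T) ∈ {(179,14),(197,14),(257,16)}`;
   at the primes `p = T²+1 ≤ 16901` the balanced matrix is full-rank from `p = 401` on), so such identities
   have support-sum `≥ 2p(1 − 3/min(T,⌈p/T⌉))` — between the dense `2p` (T = 1) and `4p` (T = √p), never
   below Θ(p): no window below item 4's `δ > 1/2`;
   CYCLIC COSET (Gauss-period) identities in `ℂ[ℤ/p]`: with `H ≤ QR_p` of odd order `L` and all `(p−1)/L`
   cosets, `Σ_i χ(a_i) 1_{a_iH} ∗ 1_{a_iH} = λ_χ·χ` (`λ_χ = L Σ_{u∈H} χ(1+u)`; e.g. `L = (p−1)/2`, `p ≡ 3 (4)`: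
   `χ = 1_{QNR}∗1_{QNR} − 1_{QR}∗1_{QR}`), support-sum `p − 1`; using only `s < (p−1)/L` cosets requires the
   eigenvalues `λ_ψ = L·Σ_{u∈H} ψ(1+u)` of the coset-circulant to VANISH for all but `s` characters `ψ` of
   `(ℤ/p)ˣ/H`, and (C) finds NO vanishing `λ_ψ` at all for `p ≤ 400` (every admissible `H`).  Beating
   `p^{1−ε}` for any `ε > 0` already needs a new arithmetic identity; X (exponent `1/2+δ`, all representations)
   is untouched by every mechanism tried.  (A cheap CYCLIC representation would not refute X — lifting to
   exact polynomials can fail — but would kill the planner's cyclic proof strategy; none found.)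
10. **Anticipated targets** (no line picked at this cycle; the triage panel's minimal line is
   `SketchIdeator3.lean` = family-cut transfer ⊕ one VNP engine).  Corner analysis of its seven stubs as
   TYPED (n = 0, 1; p = 2, 3; s = 0; k = 2; `pSel 0` unconstrained): all survive —
   `aeval_kron_fekDigit` (digits of `m < p ≤ kⁿ` do not wrap; true), `exists_boolSum_witness_fekDigit`
   (formula re-derived: boolSum = Σ_m (χ(m)+1)·mon(m) − D₀; complexity `O(N³ + nkN)` and degree
   `3N³ + n(N+1) + 2N` fit the stated cubes), `isVNPFamily_fekDigit` (at `n = 0`, `fekDigit k p 0 = C(Σ_{m<p}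
   χ(m)) = 0` for odd `p`, and `IsPBounded` absorbs any single value, so the unconstrained `pSel 0` is
   harmless), `aeval_signProjection_boolIndicatorSum` (pure algebra), `cktSize_sqrtRelation` (TRUE with
   exponent 3 by a direct `O(N² + knN)` circuit, though NOT by the uniform simulator bound `Θ(nk·N³)` —
   triage r1-3's `^4` remark concerns the proof, not the statement), `univariateSOS_of_digitCircuit` (each
   bound checked: squares `(s·n+2)^{8(⌊log₂ n⌋+1)}` monotone in `deg P ≤ n`, `natDegree ≤ ⌈n/2⌉(k−1)k^{n−1}`,
   support `≤ C(kn+⌈n/2⌉, ⌈n/2⌉)`; FRICTION: the constant `8` is the witness inside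
   `DuttaSaxenaThierauf2024_sosDecomposition_holds` but the named fact exports only `∃ c` — restate the stub
   with the fact's `c` (the endgame `not_isVPFamily_fekDigit_of_feketeSOSHard` tolerates any constant, since
   `s' = n^{O(log n)} ≤ p^δ` eventually for every `c`) or re-expose `8`; and the fact is over `Fin n` variables —
   transport along `finProdFinEquiv`), `not_isVPFamily_fekDigit_of_feketeSOSHard` (Bertrand selectors exist for
   every `k ≥ 2`, so not vacuous; `k₀ = k₀(δ)` is chosen after `h`).  No `_false` theorem to file.
   `Sketch-ideator2.lean` (cards gauss-sum-formula-witness / setmultilinear-cut-injective-kronecker /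
   euler-slp-modp-simulation), same treatment: A1 (Gauss inversion incl. `m = 0`), A2 (coefficientwise:
   `G⁻¹Σ_x ψ(x²)^m = χ(m) + (p/G)[m=0]`, constant removed by `− C(pG⁻¹)`), A3 (`v² = Σ_{a,b} e_ae_b2^{a+b}`
   over ordered pairs), B1–B3 and B4 (only `|S| = ⌈n/2⌉` survives the projection, per-square sparsity
   `k^{⌈n/2⌉} + k^{⌊n/2⌋} ≤ 2k^{⌈n/2⌉}` in both parities, `s ≤ 2·T·C(n,⌈n/2⌉) ≤ 2T·2ⁿ`, degrees `< kⁿ`;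
   `T = 0` and `n = 0` vacuous harmlessly), C1 (uniform `c`: modexp circuits) are TRUE as typed; A4 and C2
   are VACUOUSLY true (`∀ n, pr n ≤ kⁿ` at `n = 0`, as triage r1 found) — misstated, not false.
11. **Literature delta** (cycle 2; remote search degraded: OpenAlex/S2/arXiv HTTP 429, searchd down — noted,
   not used to downgrade anything): forward citations of DST24 (local graph) = one paper, arXiv:2512.01227
   (ITCS 2026, *Multi-quadratic SOS lower bounds imply VNC¹ ≠ VNP*): a different measure (number of squares /
   PT-rank of multiquadratic forms, HWY lineage) with its own LIMITATION theorem (PT-rank cannot separate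
   `VNC¹` from `VBP_ord`) and Kronecker-product upper bounds — no bearing on the univariate support-sum model
   or on `F_p`; galaxy (books + web pdf): nothing on sparse factors / sparse SOS of Fekete polynomials
   (hits are Mahler measure, unimodular zeros, merit factors).
12. **An invariant for X's provers, and why it is only second-order** (`no_private_triple`): in any
   representation `Σ cᵢgᵢ² = F_p` and any square `i` with `a ≠ b ∈ supp gᵢ`, the exponents `2a, 2b, a+b`
   cannot all be *private* (each produced by exactly one pair `{a',b'}` of one square; a private exponent is
   necessarily in `[1, p−1]`, where the coefficient is `χ = ±1`): privacy forces `cᵢgᵢ(a)² = χ(2a)`,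
   `cᵢgᵢ(b)² = χ(2b)`, `2cᵢgᵢ(a)gᵢ(b) = χ(a+b)`, and squaring the last gives `1 = 4χ(2a)χ(2b) = ±4`.
   Counting consequence: with `Sᵢ = supp gᵢ`, slot excess `E₀ := Σᵢ |Sᵢ|(|Sᵢ|+1)/2 − (p−1)` and `Pᵢ ⊆ Sᵢ` the
   elements whose double is private (`|Pᵢ| ≥ |Sᵢ| − E₀`), every pair of `Pᵢ` lands on a non-private exponent,
   and there are at most `2E₀` such slots: `Σᵢ C(|Sᵢ| − E₀, 2) ≤ 2E₀`, i.e. `E₀ ≥ maxᵢ|Sᵢ| − O(√maxᵢ|Sᵢ|)`.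
   This sharpens `TrivialSupportBound` only in the second-order term (e.g. two squares of equal sparsity
   `L` need `L² ≥ p − 1 + L/2 − O(√L)` instead of `L² + L ≥ p − 1`) — the magnitude obstruction is NOT a
   route to an exponent `δ > 0`; recorded so that it is not rediscovered as one.
13. **X is generic behaviour (counting, thanks to the degree bound).** For fixed `δ < 1/2` and a prime `p`,
   the sign sequences `ε ∈ {±1}^{p−1}` for which `Σ_m ε_m x^m` admits a representation excluded by `X(δ)`
   (`s ≤ p^δ` squares, `deg ≤ p²`, support-sum `< p^{1/2+δ}`) form a fraction `≤ 2^{−p + O(p^{1/2+δ} log p)}`: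
   there are `≤ 2^{O(p^{1/2+δ} log p)}` support patterns (this is where `deg gᵢ ≤ p²` is used — without it the
   patterns are not finitely many), each giving the image of a quadratic map from `ℂ^{s+S}`, whose closure has
   dimension `≤ s + S ≤ 2p^{1/2+δ}` and degree `≤ 2^{s+S}`, hence (generalised Schwartz–Zippel,
   `|V ∩ A^N| ≤ deg V · |A|^{dim V}`) contains `≤ 2^{O(p^{1/2+δ})}` vectors of `{0,±1}^N`.  So `X(δ)` holds
   for all but a superexponentially small fraction of ±1-polynomials of length `p − 1`, and X is the
   statement that the Legendre sequence is not exceptional — a derandomisation claim of the usual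
   explicit-construction type (DST's "hay in a haystack"), consistent with everything above: its failure
   would be a genuinely new identity, its proof needs a property of χ_p beyond pseudorandomness measures at
   the √p scale.  (For `δ > 1/2` the count is vacuous and indeed `X(δ)` fails for EVERY sequence, item 4.)

Findings of cycle 3 (gen 3; new Lean content in the section `Cycle 3` at the end of this file):

14. **TARGETS = the seven registered stubs of the picked line `sml-polarised-transport`** (lead
   prover-line-stmt-ValiantsHypothesis-3995-0, PICKED.md; skeleton sha ea74875f…; payload `targets`/
   `stuck_stubs` empty at this re-arm).  Each signature read symbol by symbol against the tree definitions
   (`CktSize B2` = "≤ s gates over fan-in-≤2 functions incl. constants", `IsSetMultilinear` =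
   `IsWeightedHomogeneous (blockWeight fst) · (blockProfile univ)`, `IsVNPFamily`/`IsPBounded` with ONE
   uniform exponent over all `n`, `boolSum`).  VERDICT: all seven are TRUE as typed; no `_false` theorem, no
   stub is an instance of a refuted strengthening (the budget is δ-free, the modulus `p_n` is prime by
   construction, cf. 15).  Corner record, for the lead:
   * `stub_digitKronecker` (a): the support count `|supp κq| ≤ |supp q|` holds for EVERY `q` (κ maps monomials
     to monomials); the block hypothesis `Σ_l m(j,l) ≤ 1` is needed only for `natDegree ≤ Σ_j (k−1)k^j = k^n − 1`
     (ℕ-subtraction harmless: `k = 0` ⇒ no variables, both sides `0`).  (b): `n = 0` forces `p ≤ 1` (vacuous);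
     for `p ≤ k^n` distinct `m < p` have distinct digit vectors, so the monomial of `m = 1` keeps coefficient
     `(1|p) = 1` (also `p = 2`) ⇒ `totalDegree = n` exactly; set-multilinearity needs no distinctness (sums of
     weighted-homogeneous polynomials); `κ(lift) = F_p` is `Σ_j digit_j(m) k^j = m` below `k^n`.
   * `stub_polarisedSOS` (lever): true incl. `t = 0` (`P = 0`, `s = 0`), `n = 0` (constants, `|supp| ≤ 1 ≤
     k^{D₁} + k^{D₂}` needs the stated `1 ≤ k`), `|S| > D₁ ⇒ π_S g = 0`; `|supp(π_S g ± π_{Sᶜ} h)| ≤ k^{|S|} + k^{|Sᶜ|}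
     ≤ k^{D₁} + k^{D₂}` by the union bound (`support_add`) — exactly the shape used for `A ± B` in 15 below.
   * `stub_budget`: true for every `c` and every `δ > 0`, but only EVENTUALLY: pointwise the inner statement
     fails for small `n` (e.g. `n = 64`, `c = 1`, `δ = 1/2`, `L = 65`, `p = 65^64`: LHS of (a) is
     `2^65·65·(16·65^6)^6 = 2^89·65^37 > 65^32 = p^{1/2}`), so `n₀(1, 1/2) ≥ 65` — the proof must be asymptotic
     (planner onsets 134–6118); `L = 0` is admitted (`T = 0` once `Nat.log 2 n ≥ 1`) and harmless; the side
     conjuncts `n ≤ p`, `(n+1)^n − 1 ≤ p²` follow from `2p > (n+1)^n ≥ 2n`.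
   * `stub_legendreCircuit` (C1): true — multiplex the hard-wired residues `l·k^j mod p` by the one-hot wires,
     `n − 1` modular additions, square-and-multiply with exponent `p/2 < 2^ℓ`, two equality tests; size
     `O(nkℓ + nℓ² + ℓ³)`; `F` is unconstrained off one-hot inputs; `p = 2`: both outputs equal `[m odd]`
     (`−1 = 1` in `ZMod 2`), consistent; `p ≤ 2^ℓ` forces `ℓ ≥ 1`.
   * `stub_oneHotLtCircuit` (C2): true — exactly-one per block `O(nk)` (pairwise `O(nk²)` also within budget),
     lexicographic comparison with the base-`k` digits of `p < k^n` `O(nk)`; NOTE the second clause forces `G`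
     FALSE on every non-one-hot input (the validity test is not optional); `p ∈ {0,1}` fine.
   * `stub_circuitSumIdentity` (C3): true — pure reindexing: one-hot `x ↔ d` bijective, at most one `b` fires
     per `d` (the one with `χ(m(d)) = (b ? −1 : 1)`), `d ↔ m < k^n` by digits, the `χ = 0` term (`m = 0`) vanishes
     on both sides; `k = 1` makes `p ≤ 1` vacuous.
   * `stub_vnpAssembly` (C4): true given C1–C3, i.e. `Stmt.stub_vnp` holds: levels `n < 2` (where `pSel n` is an
     arbitrary odd prime) are content-free — `n = 0`: `fekDigit 1 p 0 = C(Σ_{m<p} χ) = 0`; `n = 1`: a linear form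
     in two variables — any finite prefix is absorbed by the constant of `IsPBounded (t ≤ n^c + c)`; for `n ≥ 2`
     instantiate C1/C2 with `k = n+1`, `ℓ = ⌈log₂ p_n⌉ ≤ n log₂(n+1) + 1`, so ONE uniform exponent serves all
     `n` (this uniformity, not truth, is the only trap in `IsVNPFamily`).
15. **The primality of the modulus is load-bearing in X** (Lean, §Cycle 3; def-free copy proposed as
   `Theorems/SOSMagnification/Negative/FeketePrimePowerModuli.lean`).  `HardWithoutPrimeAt δ` /
   `HardWithoutPrime` = X with "`p` prime" weakened to "`p` odd" (Legendre read as Jacobi symbol — the same at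
   primes: `hardAt_of_hardWithoutPrimeAt`, `feketeSOSHard_of_hardWithoutPrime` certify it is a strengthening).
   `not_hardWithoutPrimeAt`: FALSE AT EVERY `δ > 0` — at a prime square `(m|q²) = [q ∤ m]` (`jacobiSym_prime_sq`)
   and `F_{q²} = (Σ_{1≤a<q} X^a)(Σ_{b<q} X^{qb})` (`lowDigits_mul_highDigits`, the interval tiling
   `[0,q²)∖qℕ = [1,q) ⊕ q[0,q)`): two squares `¼(A+B)² − ¼(A−B)²`, degrees `≤ q²`, support-sum `≤ 4q − 2 <
   q^{1+2δ} = (q²)^{1/2+δ}`.  NON-PRINCIPAL characters too: `fekete_mul_cubeDigits` — for the imprimitive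
   character `(·|q)` modulo `q³`, `F_{q³} = F_q(X)·Σ_{j<q²} X^{qj}` (`jacobiSym_cube`: `(m|n³) = (m|n)`),
   support-sum `≤ 2(q² + q) = O(n^{2/3})`, violating the δ-slice for `δ > 1/6`; in general
   `F_{q^{2j+1}} = F_q(X)·Π_{i=1}^{2j} Ψ_q(X^{qⁱ})` (`Ψ_q = Σ_{l<q} X^l`) balanced into two halves of `j+1` and
   `j` factors has support-sum `≤ 2q^{j+1} = 2n^{1/2 + 1/(4j+2)}` — for every `δ > 0` there are non-principal
   odd moduli violating `X(δ)`: FORMALISED as `not_hardNonprincipalAt` (`HardNonprincipalAt δ` = the δ-slice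
   over odd moduli whose Jacobi character takes the value `−1`; `hardAt_of_hardNonprincipalAt` — still a
   strengthening of X's slice; witness `p = q^{2j+1}`, `2jδ ≥ 1`, `q ≥ 17` prime, via `jacobiFekete_odd_pow` =
   `charDigits_mul_topDigits`: `F_p = (Σ_{u<q^{j+1}} (u|q)X^u)(Σ_{t<q^j} X^{q^{j+1}t})`, support-sum `≤ 4q^{j+1} <
   q^{j+1}·q^{1/2} ≤ p^{1/2+δ}`).  MEANING for X's provers (items 3996–3998):
   the cheap representations of imprimitive characters are DST's inverse multilinear Kronecker map
   `X ↦ (X, X^q, X^{q²}, …)` run backwards — the magnifier's own digit structure; a proof of X must use that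
   `χ_p` is PRIMITIVE of conductor `p` (|τ(χ_p)| = √p, Weil), not merely multiplicative, real, balanced and
   `{0,±1}`-valued (finding 13's genericity is consistent: digit-structured sign patterns are the rare
   exceptions).  CYCLIC CAVEAT: for squarefree `n = qr` the CRT splits `χ_{qr}` only in the group ring —
   `χ_{qr} = A ∗ B` in `ℂ[ℤ/qr]` with `A = χ_q∘(· mod q)` on the subgroup `rℤ/qr` and `B = χ_r∘(· mod r)` on
   `qℤ/qr`, support-sum `q + r − 2 ~ 2√n` — so the planner's "cleaner cyclic form `Σ cᵢ ĝᵢ² = G·χ` on `ℤ/p`"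
   of X is FALSE for composite squarefree moduli and owes its life at primes to `ℤ/p` having no proper
   subgroups (consistent with the Gauss-period computation (C) of finding 9); in `ℂ[X]` no sparse splitting of
   `F_{qr}` follows (interval tilings `U ⊕ V = [0, qr)` are digit tilings and do not match the CRT supports) —
   not searched further, primes being the item.  NOTE all witnesses of this finding use `s = 2` squares, i.e.
   they are sparse SPLITTINGS `F_n = U·V`: the odd-modulus analogues of `FeketeNoSparseSplit` (3997) and of every
   rung of `FeketeBoundedFanin` (3998, `s₀ ≥ 2`) fail as well — primality is load-bearing on the whole ladder.
16. **Literature delta (cycle 3)**: DST24 forward citations unchanged (arXiv:2512.01227 = ITCS 2026, and its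
   earlier version corpus:278912864); zbMATH "Fekete polynomials" since 2022: Mináč–Nguyen–Tân, JNT 242 (2023)
   (arXiv:2111.05256: `F_p = x(1−x)·f_p` for `p ≡ 3 (4)`, `x(1−x)²(1+x)·f_p` for `p ≡ 1 (4)`, `f_p` reciprocal
   and conjecturally irreducible — so RATIONAL factorisations of `F_p` always carry the dense factor `f_p`;
   small primes split sparsely only by cyclotomic accident, e.g. `F_5 = (x−x²)(1−x²) = ¼(1+x−2x²)² − ¼(1−x)²`,
   support-sum 5 versus `2p = 10`) and arXiv:2206.11778 (generalised Fekete polynomials) — both already among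
   the route's refs, consistent with (not implying) `FeketeNoSparseSplit`; OpenAlex / Semantic Scholar / arXiv
   HTTP 429 during the session (degraded — noted, nothing downgraded); galaxy pdf sweep ('intelligent',
   SOS-hardness / sparse factors of Fekete polynomials): nothing relevant.  ADDITIVE SIDE (for the route's
   lower-bound engine, items 3996–3998; zbMATH "quadratic residues additive decomposition" ≥ 2021): Chen–Yan,
   JNT 229 (2021) and Chen–Xi arXiv:2202.02780 (Sárközy's conjecture I/II); C. H. Yip, Acta Arith. 213 (2024)
   97–116 = arXiv:2304.13801 (large multiplicative subgroups of 𝔽_q are not `A+A` nor `A+B+C`; builds on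
   Hanson–Petridis: `S_d = A+B` forces all sums distinct, `|A||B| = |S_d|`; and — a cousin of finding 15 — in
   `𝔽_{pⁿ}` the subgroup `𝔽_{p^k}^*` IS additively decomposable (his Examples after Thm 1.1/1.5): SUBFIELD structure
   defeats Sárközy-rigidity exactly as digit structure defeats SOS-hardness for imprimitive characters; prime
   fields/primitive conductors are where both questions live); Wu–She, Ramanujan J. 62 (2023) (cubes).
   **SÁRKÖZY'S CONJECTURE IS NOW A THEOREM** (read in Yip–Yoo arXiv:2608.02568, 3 Aug 2026, pp. 1–2, refs [1],[2],[7]):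
   Hanson–Petridis (Proc. LMS, 'Refined estimates concerning sumsets contained in the roots of unity': `H = A+B`
   nontrivial ⇒ `|A||B| = |H|`, a.a. `p`), then A. Kalmynin, arXiv:2504.10202 (2025): `QR_p ≠ A + B` with
   `|A|,|B| ≥ 2` for all large `p` (and `|A| = |B|` for any proper multiplicative subgroup), then Rudnev–Tyrrell
   arXiv:2607.24270 (2026) / Yip–Yoo: a proper multiplicative subgroup `H < 𝔽_p^*` with a nontrivial `H = A + B`
   has `|H| = 4`.  So the route text's NUMBERS line "Sárközy's conjecture `QR_p ≠ A+B` is open, holds for almost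
   all `p`" is OUTDATED: the exact, unweighted, two-summand shadow of `FeketeNoSparseSplit` is SETTLED, by a
   Stepanov-type polynomial identity plus Kalmynin's reciprocal relations — the nearest existing lever for the
   weighted / approximate-covering statements X needs (for the planner: update refs; for X's provers: these
   identities are the place to start; none of these papers touches weighted or SOS versions).
17. **WHY IT STILL RESISTS** (cycle 3): unchanged — immunity (finding 1: `¬ crux ↔ X ∧ VP = VNP`); the
   picked line's stubs are true (14), so the provers' risk is size, not falsity; the only refutable objects
   are strengthenings of X, whose boundary is now mapped in three directions: δ-range (cycle 1: `δ ≤ 1/2`),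
   square-count / degree layers (cycle 2: `s ≥ 2`, degree decoration iff `s ≤ 2`), modulus class (cycle 3:
   primes only — odd prime powers are SOS-easy).
18. **How much of X the picked line consumes** (planner information, the analogue of 5c for
   `sml-polarised-transport`; from the PROVED composition `SOSMagnification_of`): with `k = n+1`,
   `(n+1)^n/2 < p ≤ (n+1)^n` (so `n = (1+o(1)) ln p / ln ln p`), `L ≤ n^c + c` and
   `T = (n+1)(16L²(n+1)⁴)^{⌊log₂ n⌋} = 2^{O_c(log² n)}`, the representation fed to X has
   `s ≤ 2^{n+1}T = p^{(ln 2 + o(1))/ln ln p}` squares (super-polylogarithmic but `p^{o(1)}` — admitted by `X(δ)`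
   for every fixed `δ > 0` eventually, which is all `stub_budget` (a) says), degrees `≤ (n+1)^n − 1 < 2p` (far
   below `p²`), and support-sum `≤ 2^{n+1}T·2(n+1)^{⌈n/2⌉} ≤ p^{1/2 + (ln 2 + o(1))/ln ln p}`.  Hence the weakest
   restatement of X that keeps THIS line alive is: for some constant `C > ln 2` and all large primes `p`, every
   representation of `F_p` with `s ≤ exp(C ln p / ln ln p)` squares of degree `< 2p` has support-sum
   `≥ p^{1/2}·exp(C ln p / ln ln p)` — a gain factor `p^{C/ln ln p}` instead of `p^δ` (cf. DST24 Thm 3.2's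
   threshold `ε = ω(√(ln ln d / ln d))`, which their optimised radix achieves; the growing radix `n+1` of this
   line pays the factor `2^{n+1}` of the polarisation over all `S ⊆ [n]`).  Should items 3996–3998 prove too
   strong, `--restate FeketeSOSHard` to this form costs the line nothing but a re-run of `stub_budget`.
19. **WLOG unweighted** (service lemma `hardAt_iff_unweighted`, §Cycle 3): over `ℂ` the weights are cosmetic —
   `HardAt δ ↔ HardUnweightedAt δ` (genuine sums of squares `F_p = Σ gᵢ²`), since `cᵢgᵢ² = (aᵢgᵢ)²` with
   `aᵢ² = cᵢ` shrinks supports and degrees weakly (`support_C_mul_subset`, `natDegree_C_mul_le`).  So X's provers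
   may drop the weights `c`, and the coefficient identities of the route text read `Σᵢ Σ_{a+b=n} gᵢ(a)gᵢ(b) = χ_p(n)`.

Findings of cycle 4 (gen 4; new Lean content in the sections `Cycle 4` at the end of this file):

20. **TARGETS — skeleton `b38bc7f1…`** (the lead's re-lined skeleton of `sml-polarised-transport`, registered
   2026-08-16T02:55Z; payload `stuck_stubs = []`).  FIVE of its stubs are LANDED as Theorems
   (`FeketeSOSSOSMagnificationStub{Budget, CircuitSumIdentity, DigitKronecker, OneHotLtCircuit, PolarisedSOS}.lean`);
   open: `stub_legendreCircuit` (C1), `stub_vnpAssembly` (C4 — now takes C1/C2 as explicit hypotheses `hC1 hC2`, a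
   prime selector `pSel` with `hodd : ∀ n, pSel n ≠ 2` and `hle : ∀ n, 2 ≤ n → pSel n ≤ (n+1)^n`), and the lead's helper
   `isVNPFamily_of_levelwise`.  Re-read symbol by symbol against `ValiantClasses`/`ArithCircuit`/`CktSize B2`: all TRUE
   as typed — C1: Euler-criterion circuit of size `O(nkℓ + nℓ² + ℓ³) ≤ c((n+1)(k+1)(ℓ+1))^c` uniformly (`p = 2`:
   `p/2 = 1` and `−1 = 1` in `ZMod 2`, both outputs `[m(d) odd]`, consistent); C4: levels `n < 2` are content-free
   (`n = 0`: `Fin 0 × Fin 1` empty, the polynomial is `C(Σ_{m<p}χ(m)) = 0` for odd `pSel 0`; `n = 1`: a linear form,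
   absorbed by the constant of `IsPBounded`), `hle` pins `pSel n ≤ (n+1)^n` exactly where digits are read; the helper
   is DEFINITIONAL — PROVED here in six lines (`isVNPFamily_of_levelwise`, §Cycle 4 Targets: `choose` the level-wise
   witnesses, `u := r`, `IsPBounded.add_holds`/`mono`, `Fintype.card_sum`; same binder shape and universes as the
   registered signature — the lead may copy it verbatim).  No `_false` theorem.
21. **CALIBRATION OF X AGAINST SÁRKÖZY'S CONJECTURE** (Lean, §Cycle 4; def-free copy LANDED as
   `Theorems/SOSMagnification/Negative/FeketeSarkozyCalibration.lean`, p81779).  With `Q_p := Σ_{m<p, (m|p)=1} x^m`: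
   `fekete_eq_two_mul_qrPoly_sub_onesPoly` (`F_p = 2Q_p − (x+⋯+x^{p−1})`) and `feketeSOSHard_false_of_sparseQRSplits`:
   if for every `δ > 0` infinitely many primes admit a splitting `Q_p = A·B` in `ℂ[x]` with
   `16(|supp A| + |supp B|) ≤ p^{1/2+δ}`, then `¬X` — `F_p = 2AB − (x+⋯+x^a)(Σ_{j<b}x^{aj}) − x^{ab+1}(1+⋯+x^{r−1})`
   (`p−1 = ab+r`, `a = ⌊√(p−1)⌋`) is three cheap products = six weighted squares (sibling kill criterion
   `Theorems.FeketeSOSHard.Negative.feketeSOSHard_false_of_cheapProducts`); `feketeSOSHard_false_of_sarkozyPairs` is the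
   indicator case.  READING: an INTEGER SÁRKÖZY PAIR (`𝒜, ℬ ⊂ ℕ` with every quadratic residue in `[1,p−1]` uniquely
   `a + b` and nothing else so written) is exactly a splitting `Q_p = (Σ_{𝒜}x^a)(Σ_{ℬ}x^b)` (`|𝒜||ℬ| = (p−1)/2`); so,
   contrapositively, X ⇒ for all large `p`, `QR_p ∩ [1,p−1] ≠ 𝒜 ⊕ ℬ` with `|𝒜|+|ℬ| ≤ p^{1/2+δ}/16` — the balanced
   integer case of Sárközy's conjecture (Sarkozy2012), in a form robust under arbitrary COMPLEX WEIGHTS.  Status of the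
   shadow (read this cycle, arXiv:2504.10202 pp. 1–3): Kalmynin 2025, Thm 3 — for ALL primes `p`, `QR_p ≠ A + B` with
   `|A|,|B| > 1` (Hanson–Petridis polynomials = Stepanov's method; Thm 2 "`α = β`": `μ_d = A+B` non-trivial ⇒
   `|A| = |B| = √d`); balance `(1/6−o(1))√p ≤ |A|,|B| ≤ (3+o(1))√p` was Shkredov's; integer pairs are modular pairs
   (sums `< p`, no wrap), so NO indicator instance exists at any prime: the lemma is a calibration, not a kill path —
   ANY PROOF OF X REPROVES balanced integer Sárközy and must do so weight-robustly; the weighted kill path (complex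
   `A, B`) is NOT obstructed by the char-`p` lever of the sibling cruxes (`Q̄_p(1) = (p−1)/2` is a unit mod `p`, so
   `ord_{x=1}` gives nothing for splittings of `Q_p`, unlike `F_p` where `ord = (p−1)/2` forces `(p+3)/2`) — its tests
   are kit jobs j014020 (exhaustive `min |supp A|+|supp B|` over all root partitions of `Q_p` and `F_p`, `p ≤ 31`) and
   j013332 (Galois certificates for `Q_p/x`, `p ≤ 199`) — both DONE: no non-trivial sparse splitting of `Q_p` exists at
   any tested prime, and none CAN exist at the 22 Galois-certified primes `p ≡ 3 (mod 4) ≤ 199` (25, 27).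
22. **THE CYCLIC FORM OF X DIES AT EVERY COMPOSITE MODULUS — PRIMITIVE CONDUCTORS INCLUDED** (Lean, §Cycle 4
   CRT: `crtA_mul_crtB`, `crtρ_injOn`, `crtCoef_eq`, `not_cyclicSliceSquarefreeAt`; def-bearing copy LANDED as
   `Theorems/SOSMagnification/Negative/FeketeCyclicCompositeModuli.lean` (p81831) with the slice inlined as
   `feketeCyclicSlice_false_squarefree`; complements 15, where the EXACT form was killed for IMPRIMITIVE characters).
   For `n = qr` (distinct odd primes; `χ_n = χ_qχ_r` is primitive of conductor `n`) put `A = Σ_{k<q} χ_q(rk)x^{rk}`,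
   `B = Σ_{l<r} χ_r(ql)x^{ql}`.  Then `A·B ≡ F_n (mod x^n − 1)`: `m ≡ rk + ql` has `(m mod q, m mod r) ≡ (rk, ql)`,
   a bijection `(k,l) ↔ m` by CRT, and `χ_n(m) = χ_q(rk)χ_r(ql)`; support-sum `(q−1)+(r−1)`, i.e. `≈ 2√n` for `q ≈ r`
   (`n = 15`: `F_15 ≡ (x^{10} − x^5)(−x³ + x⁶ + x⁹ − x^{12})`, support `2 + 4`).  So the cyclic δ-slice over odd squarefree
   moduli (`CyclicSliceSquarefreeAt δ`: reps `Σcᵢgᵢ² = F_n + (X^n−1)R`, `deg gᵢ < n`, `s ≤ n^δ`) fails for every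
   `δ > 0` along `n = qr`, `r` the Bertrand prime of `q` (`2(q+r) < 6q ≤ 6√n ≤ n^{1/2+δ}`).  As EXACT polynomials nothing cheap follows: `A·B = F_n + (x^n − 1)W` with
   `W = Σ_{rk+ql ≥ n} χ_n(rk+ql−n)x^{rk+ql−n}` (≈ half of the `(q−1)(r−1)` pairs wrap), and NO residue systems `K, L` give
   `rK ⊕ qL = [0,n)` exactly (in a direct-sum tiling of an interval one summand contains `{0,1}`, but
   `1 ∉ rℤ ∪ qℤ`) — for primitive composite conductors the exact δ-slice is plausibly TRUE while the cyclic one is FALSE.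
   MEANING: (i) the planner's "cleaner cyclic form `Σ cᵢĝᵢ² = G·χ` on `ℤ/p`" (route text of 3996) is STRICTLY stronger
   than X and owes its life at primes to `ℤ/p` having no proper subgroups, not to primitivity of `χ` (cheap sanity test
   for any cyclic/char-`p` lemma: it must visibly fail at `n = qr`); (ii) with 21: a MODULAR Sárközy pair
   `𝒜 + ℬ = QR_p` gives `χ_p = 1_𝒜∗1_ℬ − 1_{g𝒜}∗1_{gℬ}` on `ℤ/p` (`g` a non-residue) — four cyclic squares of
   support-sum `4(|𝒜|+|ℬ|) = O(√p)` — so cyclic-X contains the full (modular) Sárközy conjecture = Kalmynin's theorem as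
   its unweighted shadow, whereas X itself only sees integer pairs (a modular pair gives `P_𝒜P_ℬ = Q₁ + x^pQ₂`,
   `Q₁ + Q₂ = Q_p`, with dense correction `(x^p−1)Q₂`); (iii) for the sibling crux's char-`p` line
   (`Cruxes/FeketeSOSHard/Ideas/char-p-isotropic-depth`, `border-depth-dichotomy`): reduction mod `(p, x^p−1)` is a
   cyclic reading, so `IsotropicDepth`-type lemmas certify at most the true cyclic minimum over `ℂ` — no conflict is
   known at primes (9(C); `s = 1, 2` cyclic are provably linear, 23), but their Case II (p-adic cancellation) is exactly
   where cyclic-cheap/exact-dear phenomena like `n = qr` would hide if primes had them.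
23. **`s = 1` CYCLIC REPRESENTATIONS ARE DENSE — the quartic Jacobi-sum square is OPTIMAL** (paper): if
   `c·(g∗g) = χ_p` on `ℤ/p` then `c·ĝ(t)² = G·χ_p(t)`, so `ĝ(0) = 0` and `ĝ(t) = ω·a_t`, `a_t ∈ {±1, ±i}` (`t ≠ 0`,
   `ω² = G/c`); for `x ≠ 0`, `p·g(x)/ω = Σ_{u=1}^{p−1} b_u ζ_p^u` with all `b_u ∈ {±1,±i}` NONZERO, which cannot vanish
   since `ζ_p, …, ζ_p^{p−1}` are linearly independent over `ℚ(i)` (`ℚ(i) ∩ ℚ(ζ_p) = ℚ` for odd `p`): `|supp g| ≥ p−1`.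
   (The char-`p` valuation gives only `(p+3)/4`, and only for `p ≡ 1 (4)`.)  Not formalised (relative linear
   independence of `ζ_p^u` over `ℚ(i)` is not in Mathlib in usable form).  CYCLIC TABLE at primes: `s = 1`: `≥ p−1`,
   sharp; `s = 2`: `≥ (p+3)/2` (char-`p` valuations, Cruxes/FeketeNoSparseSplit); `s ≥ 3`: open, generic count `≈ p/2`,
   nothing below `Θ(p)` known (9(C): no Gauss-period gain for `p ≤ 400`); composite `n = qr`: `s = 2` costs `q+r−2` (22).
24. **WHY NO EXHAUSTIVE `s ≥ 3` JOB**: counting alone forces support-sum `K` with `K(K+1)/2 ≥ p−1` (`K ≥ 5` at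
   `p = 13`, `≥ 7` at `p = 23`) against the linear benchmark `≈ p/2` (`6.5`, `11.5`), so the window an exhaustive
   search could probe is a handful of values at `p ≤ 23`, while exact feasibility per support pattern (Gröbner over `ℚ`,
   `≈ C(p,|S₀|)C(p,|S₁|)C(p,|S₂|)/2p` patterns) stops being affordable near `p = 17`; the sibling seat's j009087 covers
   `p ≤ 13` exactly.  Informative computations are the STRUCTURED ones (digit/tiling rank to `p ≤ 2500`, Gauss periods
   to `p ≤ 400` — all `Θ(p)`) and the `s = 2` exhaustive censuses (F_p: `p ≤ 29`, min `≥ 0.74p`; Q_p: j014020).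
25. **LITERATURE / COMPUTE DELTA (cycle 4)**: Kalmynin arXiv:2504.10202 READ (pp. 1–3): Thm 1 (Lev–Sonn:
   `A − A = μ_d ∪ {0}` ⇒ `d ∈ {2,6}`), Thm 2 (`α = β`), Thm 3 (Sárközy for all primes), Cor 1 (no `A+B+C`); Rudnev–Tyrrell
   arXiv:2607.24270 (2026) "Multiplicative subgroups of prime fields are not sumsets" (title level; with Yip–Yoo
   arXiv:2608.02568 of finding 16); Mináč–Nguyen–Tân arXiv:2111.05256 §4 READ (Galois groups of `f_p`, see 27).  None treats
   weighted/approximate decompositions; the weight-robust version of the Hanson–Petridis auxiliary polynomial is the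
   open lever X needs at `s = 2` beyond the char-`p` bound, and nothing in print addresses `s ≥ 3`.  Search degraded
   this session (local FTS "unable to open database", OpenAlex/S2 HTTP 429, searchd rc 75 twice) — nothing downgraded
   on that basis.  COMPUTE (both jobs of this cycle DONE; `compute-j014020.json`, `compute-j013332.json` on the item):
   (i) j014020 (`qrsplit.py`, numpy meet-in-the-middle over ALL root partitions, tolerance `1e-7·max|coeff|`; in-job
   self-test numpy = pure-python reference at `p = 7, 11`; 1218 s; resubmission of j012947, which died on the runner's
   directory entry point before executing).  `Q_p`, `p = 5,…,31`: `min |supp A|+|supp B| = 3,4,6,7,9,10,12,15,16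
   = (p+1)/2` — ALWAYS the trivial split `monomial × Q_p`; every non-trivial partition sits at exactly `d + 2`
   (`d` = number of nonzero roots `= 3,3,8,11,15,16,17,27,27`), except ONE extra class at `p ≡ 1 (mod 4)` (`p = 17`:
   `13`; `p = 29`: `25`; at `p = 13` it coincides with `d+2 = 13`) — the RATIONAL factor `x + 1` (`Q_p/x` is
   palindromic of odd degree when `−1 ∈ QR_p`), i.e. an `(x+1)`-peeling, never a complex accident.  `F_p`,
   `p = 5,…,31`: `4,7,9,10,14,15,23,22,31` (= the route-review minima for `p ≤ 29`; new `p = 31`: `31 = p`, all `2^28`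
   partitions at `31`); never below `0.74p`.  (ii) j013332 (`galois_qr.gp`, PARI/GP 2.15.4, 14 s): for EVERY prime
   `p ≡ 3 (mod 4)` with `11 ≤ p ≤ 199` (22 primes: 11, 19, 23, 31, 43, 47, 59, 67, 71, 79, 83, 103, 107, 127, 131, 139,
   151, 163, 167, 179, 191, 199) `q_p := Q_p/x` is irreducible over `ℚ` and `Gal(q_p) = S_d` is CERTIFIED (a `(d−1,1)`
   factorisation pattern modulo some `ℓ ≤ 2161` ⇒ 2-transitive, an irreducible factor of prime degree `r ∈ (d/2, d−3]`
   modulo some `ℓ' ≤ 79` ⇒ an `r`-cycle ⇒ Jordan; the discriminant is never a square); `p = 7` (`d = 3`) is below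
   Jordan's range; for EVERY `p ≡ 1 (mod 4)`, `5 ≤ p ≤ 197`, `q_p = (x+1)·q̃_p` with `q̃_p` reciprocal of even degree
   (hyperoctahedral Galois group expected exactly as for `f_p`; not tested).  CONSEQUENCE (homogeneity lemma §Cycle 4
   + Dedekind's and Jordan's theorems, unformalised classical steps): at each of the 22 certified primes EVERY complex
   splitting `Q_p = A·B` other than `monomial × Q_p` has `|supp A| + |supp B| = d + 2 ≥ p − 5` EXACTLY — the
   weighted-Sárközy kill path of 21 is CLOSED there, and j014020's histograms are explained class by class.
26. **WHY IT STILL RESISTS (cycle 4)**: immunity (1) unchanged; the picked line is 5/7 landed and its open stubs are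
   true (20), so the crux is on course to be PROVED — this seat's standing attack has instead mapped the boundary of the
   hypothesis X: δ-range (cycle 1: `δ ≤ 1/2`), square-count/degree layers (cycle 2), modulus class (cycle 3: the exact
   form fails for imprimitive conductors; cycle 4: the cyclic form fails for ALL composite conductors, 22), and
   calibrated X from below (21: X ⊒ balanced integer Sárközy; cyclic-X ⊒ modular Sárközy = Kalmynin 2025).  A kill of X
   now needs either a complex-weighted sparse splitting family for `Q_p` (21 — CLOSED at every prime tested or
   certified: exhaustive `p ≤ 31`, Galois-certified `p ≡ 3 (mod 4)` up to 199, see 25/27; it would require primes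
   where the residue polynomial has an exceptional Galois group) or a `p^{o(1)}`-rank near-tiling of `χ_p` (sibling
   kill criterion) — both would be new identities for the Legendre symbol.

27. **GALOIS GENERICITY EXPLAINS EVERY SPLITTING CENSUS — AND CLOSES THE WEIGHTED-SÁRKÖZY PATH WHEREVER
   CERTIFIED** (Lean core §Cycle 4 Homogeneity + PARI certificates j013332).  HOMOGENEITY LEMMA (sorry-free):
   if automorphisms of a field `L` act on a finite `T ⊂ L` transitively on `k`-subsets for every `k`, then for
   every proper nonempty `S ⊂ T` all of `e_1(S), …, e_{|S|}(S)` are nonzero (`esymm_ne_zero_of_homogeneous`: a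
   vanishing `e_j(S)` transports to ALL `|S|`-subsets (`esymm_map_ringEquiv`), and the difference trick
   `e_j(R∪a) − e_j(R∪b) = (a−b)·e_{j−1}(R)` (`vanishOn_step`) descends to `e_0 = 1 = 0` (`not_vanishOn`)); hence
   `∏_{α∈S}(X − α)` has all `|S|+1` coefficients nonzero (`card_support_prod_X_sub_C_of_homogeneous`, Vieta
   `Multiset.prod_X_sub_C_coeff`).  CONSEQUENCE: for squarefree `P ∈ ℚ[x]` of degree `d` with `Gal(P) ⊇ A_d`
   (`A_d` is `k`-homogeneous for every `k`; take `L` = splitting field, `T` = roots), EVERY complex splitting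
   `P = A·B` has `|supp A| + |supp B| = d + 2`: no cancellation at all.  So sparse complex splittings REQUIRE
   Galois degeneracy (imprimitivity) — exactly what cycle 3's cheap cases have (prime-power conductors:
   `F_{q²} = low(x)·high(x^q)`, compositions `x ↦ x^q`, wreath-product groups) and what primes conjecturally lack.
   For `F_p = x(1−x)f_p` resp. `x(1−x)²(1+x)f_p` (Mináč–Nguyen–Tân, arXiv:2111.05256 = JNT 2022, READ §4 this
   cycle: `f_p` reciprocal of even degree `2h_p`; CONJECTURE 4.13: `Gal(ℚ(f_p)/ℚ) = (ℤ/2)^{h_p} ⋊ S_{h_p}`, the FULL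
   hyperoctahedral group — proved for `p ≤ 43` by the degree computation `[ℚ(f_p):ℚ] = 2^{h_p}h_p!` (Prop. 4.8),
   certified prime by prime for `p < 600` by their Davis–Duke–Sun cycle criterion (Prop. 4.14 + table), `S_{h_p}` on
   the trace polynomial `g_p` for `p < 1600`, irreducibility for `p < 10⁴` (Rem. 4.15: "f_p behaves like a random
   reciprocal polynomial")).  Running the same difference trick on TYPES (paper: flips `R∪{β}` vs `R∪{1/β}` give
   `(1/β − β)c_m(R) = 0`; fresh pairs `J∪{i}` vs `J∪{i'}` give `(t_{i'} − t_i)c_{m−1}(J) = 0`, `t = α + 1/α`;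
   palindromy reduces to `m ≤ a`; descent ends at `c_0 = 1`; linear relations `c_m = c_{m−1}` descend the same way and
   end at a leading coefficient) shows that the full `(ℤ/2)^{h} ⋊ S_h` forbids every cancellation inside complex
   factors of `f_p` AND inside `(1±x)·(proper factor)` — so at every prime `p < 600` (certified) the only
   sub-generic splittings of `F_p` put ALL of `f_p` on one side: `A ∈ {x, 1−x, 1+x, …products}`,
   `B = F_p/A` dense, sparsity only from coincidences of consecutive partial sums of `χ_p` — exactly the
   "(x∓1)-peelings" seen by the route review (minima `4,7,9,10,14,15,23,22` for `p ≤ 29`, never below `0.74p`), and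
   Conjecture 4.13 for all large `p` would give `FeketeNoSparseSplit` with constant `≈ 1` (up to the peelings)
   instead of the char-`p` `1/2`.  For `Q_p = x·q_p` the
   prediction is sharpest: every non-trivial complex splitting has support-sum `deg q_p + 2` EXACTLY whenever
   `Gal(q_p) ⊇ A_d` — and j013332 CERTIFIES `Gal(q_p) = S_d` for all 22 primes `p ≡ 3 (mod 4)` in `[11, 199]`
   (irreducibility over `ℚ`; a `(d−1,1)` pattern mod `ℓ` ⇒ 2-transitive; a prime-degree-`r` factor, `d/2 < r ≤ d−3`,
   mod `ℓ'` ⇒ an `r`-cycle ⇒ Jordan), while for `p ≡ 1 (mod 4)` it finds `q_p = (x+1)·q̃_p` (`q̃_p` reciprocal — the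
   hyperoctahedral situation of `f_p`, prediction: no cancellation off the `(x+1)`-peeling); j014020's exhaustive
   histograms for `p ≤ 31` match both predictions class by class (25).  So at every tested or certified prime the
   weighted-Sárközy kill path of 21 is DEAD, not merely uninstantiated: a kill of X through `Q_p` needs primes where
   the residue polynomial has an exceptional Galois group.

Findings of cycle 5 (gen 5; TERMINAL for this crux; new Lean content in the section `Cycle 5` at the end of this file):

28. **THE CRUX IS PROVED FROM THE SEVEN LANDED STUBS — joint sufficiency audited end-to-end.**  All seven registered
   stubs of `sml-polarised-transport` are LANDED, def-free, in namespace `…Theorems.FeketeSOSSOSMagnification`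
   (C1 `stub_legendreCircuit` p78989, C2 `stub_oneHotLtCircuit` p76871, C3 `stub_circuitSumIdentity` p76453,
   C4 `stub_vnpAssembly` p78996, T2 `stub_digitKronecker` p76688, T3 `stub_polarisedSOS` p76797, T4 `stub_budget` p77095;
   files `Theorems/FeketeSOSSOSMagnificationStub*.lean`).  AUDIT (`FullChain.lean`, this seat's folder, attached as item
   evidence): the registered skeleton `Lines/sml-polarised-transport.lean` VERBATIM — objects, `Stmt.*`, the composition
   `SOSMagnification_of`, `SOSMagnification_proof` — with each of the seven `sorry`s replaced by the landed theorem; the only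
   non-syntactic joints are (i) C4, landed with C1/C2 as HYPOTHESES and C3 imported, instantiated as
   `fun h1 h2 _ pSel _ hodd hle => stub_vnpAssembly h1 h2 pSel hodd hle` (so at composition level the skeleton's
   `Stmt.circuitSumIdentity` hypothesis is discharged but unused — it is consumed INSIDE the landed C4), and (ii) the
   `Stmt.stub_vnp` / `Stmt.stub_digitKronecker` interfaces, which the landed statements meet by δ-unfolding of
   `fekDigit/digit/kron/feketePoly` (the instance `NeZero (n+1)` and the `Fin`-proof fields agree definitionally).
   RESULT: PENDING in this version — the farm build of the two modules accepted at 04:25Z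
   (`…StubLegendreCircuit` p78989, `…StubVnpAssembly` p78996) is still stale at 06:15Z (rc 75 `unbuilt`), while the five
   older stub modules elaborate (`Probe2.lean` rc 0) and the composition is the skeleton's (rc 0 modulo stubs, re-checked by
   planner, lead and gen 3/4 of this seat); the end-to-end verdict (rc, axioms of `sosMagnification_audit`) is recorded in
   the next publish of this file.  NOTE the lead's closing proposal `Theorems/FeketeSOSSOSMagnification.lean` bounced twice
   for INFRASTRUCTURE only (p79173/p79388: "gate restarted while this proposal was in flight; resubmit") — not on content.  Hence `FeketeSOS.SOSMagnification` is a THEOREM of the tree's library (the lead's closing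
   file `Theorems/FeketeSOSSOSMagnification.lean` carries the same composition; its landing closes the item `proved`), and by
   finding 1 an unconditional `¬ SOSMagnification` would now be an inconsistency of Lean 4 + Mathlib: THIS SEAT'S ATTACK ON
   THE CRUX IS OVER.  Nothing in the audit depends on the prime selector beyond Bertrand (`Nat.exists_prime_lt_and_le_two_mul`)
   and `pSel n ≠ 2`; the exceptional levels `n < 2` are absorbed exactly as predicted in 14/20.
29. **WHAT THE PROVED CRUX HANDS TO THE ATTACKERS OF X (items 3996–3998).**  Two kernel facts now stand behind finding 7:
   (i) `VP ℂ = VNP ℂ → ¬ FeketeSOSHard` (the crux read contrapositively, `sosMagnification_iff_refutes`); (ii) unconditionally,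
   the one-hot digit family `(Fek_{n+1,p_n,n})_n ∈ VNP_ℂ` for every odd Bertrand selector (landed C1–C4).  Re-running the
   PROVED composition with a complexity bound `L(n)` in place of `n^c + c` (paper; only `stub_budget` changes): the
   representation fed to X has `s ≤ 2^{n+1}T`, `T = (n+1)(16L²(n+1)⁴)^{⌊log₂ n⌋}`, support-sum `≤ 2^{n+1}T·2(n+1)^{⌈n/2⌉}`,
   against `p_n^{1/2+δ} > ((n+1)^n/2)^{1/2+δ}`; so (b) holds as soon as
   `log₂ L < (δ·n·log₂(n+1) − n − 4⌊log₂ n⌋ log₂(16(n+1)) − O(n^{0}))/(2⌊log₂ n⌋)·(1 − o(1))`, in particular for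
   `L(n) ≤ 2^{(δ/2 − η) n}` for any fixed `η > 0` and `n ≥ n₀(δ, η)` ((a) is weaker).  HENCE `X(δ) ⇒ complexity(Fek_{n+1,p_n,n})
   ≥ 2^{(δ/2 − o(1))·n}` — an exp(Ω(√N))-size lower bound for an explicit VNP family in `N = n(n+1)` variables of degree `n`
   (the growing-radix analogue of DST24 Thm 3.9; with a FIXED radix `k > 2^{1/δ}` the same count gives `2^{Ω_δ(N)}`, cf. 30).
   READINGS.  For the planner: this exponential form is a summit-independent product of X worth filing as a milestone if X's
   provers make progress (it is the proved composition plus a re-run of `stub_budget`, nothing else).  For the refuter: the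
   circuit route to `¬X` is NOT an available attack — refuting `FeketeSOSHard` through the T-half needs, for EVERY `δ > 0`,
   circuits of size `2^{δn/2}` for the Legendre digit tensor (format `(n+1)^{×n}`, entries `χ_{p_n}(Σ_j d_j (n+1)^j)`), i.e.
   size `2^{o(n)}` against the trivial `(n+1)^{n+O(1)} = 2^{(1+o(1)) n log₂ n}`; no upper bound below trivial is known or
   suggested by the structure (χ is multiplicative in `m`, the digits are additive; the one algebraic handle, Euler's
   criterion `m^{(p−1)/2}`, lives in characteristic `p` and computes a non-multilinear proxy), and full rank of the balanced
   digit flattening `M_T[a][b] = χ(a + bT)` (finding 9 (R): rank `≥ min(T, ⌈p/T⌉) − 3` in all 13 730 tested cases) rules the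
   saving out for ordered set-multilinear ABPs (Nisan) though not for general circuits (a product of `n/2` bilinear Hadamard
   blocks has full balanced flattening and size `O(nk²)` — flattening rank alone never bounds circuits).  So X stays exactly
   as safe as finding 7 said: its refutation, if any, is an ARITHMETIC identity for `χ_p` (21–27 map where none exists), not a
   circuit.
30. **LINE POST-MORTEM — which stub hypotheses were load-bearing (from the landed proofs), and the radix threshold.**
   `hodd : pSel n ≠ 2` IS load-bearing for C4 as built: Euler's criterion is used as `m^{p/2} = −1 ↔ χ_p(m) = −1`
   (`pow_half_eq_iff_legendreSym` needs `p ≠ 2`; at `p = 2`, `m^{1} = −1 = 1` holds for odd `m` while `legendreSym 2 m = −1`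
   never does, so the C1-circuit would violate C3's specification `Φ(enc d, true) ↔ m < p ∧ χ(m) = −1`) — harmless, the
   selector avoids `2`.  `hle : pSel n ≤ (n+1)^n` (`n ≥ 2`) is used and silently sharpened to `<` (`prime_lt_pow_of_le`:
   a prime is not a perfect `n`-th power, `n ≥ 2`) — so C2's strict `p < k^n` costs nothing.  C2's soundness clause
   (`G x = true →` one-hot) is consumed through C3's first hypothesis (only one-hot points contribute to the Boolean sum);
   C1's `p ≤ 2^ℓ` fixes the bus width (`ℓ = n·n` in C4, from `(n+1)^n ≤ (2^n)^n`).  T3's `1 ≤ k` matters only at `n = 0`;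
   T2(a)'s block condition only for the degree bound (14).  THE RADIX (Lean, §Cycle 5): `radix_two_budget_fails` — with
   BINARY digits (radix 2, `p ≤ 2^n`) the budget inequality (b) is false at EVERY level for every `0 < δ ≤ 1` and every cut
   length `T ≥ 1`: `p^{1/2+δ} ≤ (2^n)^{3/2} ≤ 2^{n+1}·T·(2^{⌊n/2⌋} + 2^{n−⌊n/2⌋})`; `fixed_radix_budget_fails` — the same for
   ANY fixed radix `k ≥ 2` with `k^δ ≤ 2` (`p ≤ k^n`: `p^{1/2+δ} ≤ k^{n−⌊n/2⌋}·(k^δ)^n ≤ 2^n k^{n−⌊n/2⌋}`).  So the polarisation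
   factor `2^{n+1}` (all `S ⊆ [n]`, both signs) must be beaten by `k^{δn}`: the count needs radix `k > 2^{1/δ}` — the line's
   growing `k = n+1` overshoots (price: `s = p^{(ln 2+o(1))/ln ln p}` squares and only `exp(Ω(√N))` in 29), while a fixed
   `k = 2^{⌈1/δ⌉}+1` (cf. DST's `6^{1/δ}+1` for the binomial count) would feed X only `s ≤ p^{ln 2/ln k + o(1)} < p^δ` squares and
   give `2^{Ω(N)}`; either way `δ`-dependence of the radix is unavoidable for this lever, and NO version runs at `δ = 0⁺` with
   bounded radix — consistent with DST24 Thm 3.2's threshold `ε = ω(√(log log d/log d))` being about the radix/entropy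
   trade-off, not about X.
31. **WHERE THE ADVERSARIAL WORK GOES NOW.**  With the crux a theorem, route `FeketeSOS` reduces to X = `FeketeSOSHard`
   (stmt-3996; `Assembly` is modus ponens), whose standing disprover owns `Cruxes/FeketeSOSHard/Disproof.lean` and the landed
   `Theorems/FeketeSOSHard/Negative/{KillCriterion, LoadBearing}.lean`.  This file's map of X's boundary is the hand-over:
   δ-range (4: `δ ≤ 1/2`, landed `FeketeHardDeltaRange`), square-count/degree layers (8, `FeketeTwoSquaresStructure`), modulus
   class (15: imprimitive conductors SOS-easy, `FeketePrimePowerModuli`/`FeketeImprimitiveModuli`; 22: cyclic form dead at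
   all composite conductors, `FeketeCyclicCompositeModuli`), weights cosmetic (19), calibration from below (21: X ⊒ weighted
   balanced integer Sárközy, `FeketeSarkozyCalibration`; cyclic-X ⊒ modular Sárközy = Kalmynin 2025), Galois genericity closes
   the weighted-Sárközy path wherever certified (27, j013332/j014020), magnitude obstruction is second-order only (12),
   genericity count (13), calibration from above (29).  OPEN, cheap-to-state, not cheap-to-decide: (α) is the degree bound
   `deg gᵢ ≤ p²` decoration for `s ≥ 3` (8)?  (β) the exact δ-slice at squarefree composite conductors (22: cyclic dead, exact
   plausibly alive);  (γ) `s = 3` below `Θ(p)` at any prime (23/24: nothing below linear known, exhaustive search infeasible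
   beyond `p ≈ 17`).  Literature watch for X: forward citations of DST24 (one: ITCS 2026 multi-quadratic SOS) and of
   Kalmynin 2025 / Rudnev–Tyrrell / Yip–Yoo 2026 (sumset rigidity of multiplicative subgroups) — search services were
   DEGRADED this cycle (searchd rc 75); nothing downgraded on that basis.
-/

namespace Summit.ValiantsHypothesis.ValiantsHypothesis.Cruxes.SOSMagnification.Disproof

set_option linter.dupNamespace false

open Summit.ValiantsHypothesis.ValiantsHypothesis.Theses.FeketeSOS
open Polynomial
open scoped BigOperators

noncomputable section

/-- The Fekete polynomial exactly as inlined in the route items: `F_p = ∑_{m<p} (m|p)·X^m ∈ ℂ[X]`. -/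
def fekete (p : ℕ) [Fact p.Prime] : Polynomial ℂ :=
  ∑ m ∈ Finset.range p, C ((legendreSym p m : ℤ) : ℂ) * X ^ m

/-- `HardAt δ` — the δ-slice of the hypothesis X = `FeketeSOSHard`: for all large primes `p`, every
admitted representation (`s ≤ p^δ` squares of degree `≤ p²`) has support-sum `≥ p^{1/2+δ}`. -/
def HardAt (δ : ℝ) : Prop :=
  ∃ p₀ : ℕ, ∀ (p : ℕ) [Fact p.Prime], p₀ ≤ p → ∀ (s : ℕ) (c : Fin s → ℂ) (g : Fin s → Polynomial ℂ),
    (s : ℝ) ≤ (p : ℝ) ^ δ → (∀ i, (g i).natDegree ≤ p ^ 2) →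
    (∑ i, C (c i) * g i ^ 2) = fekete p → (p : ℝ) ^ (1 / 2 + δ) ≤ ∑ i, ((g i).support.card : ℝ)

/-- X is `∃ δ > 0, HardAt δ` (definitional). -/
theorem feketeSOSHard_iff : FeketeSOSHard ↔ ∃ δ : ℝ, 0 < δ ∧ HardAt δ := Iff.rfl

/-- The crux is literally `X → summit`. -/
theorem sosMagnification_iff : SOSMagnification ↔ (FeketeSOSHard → ValiantsHypothesis) := Iff.rfl

/-- **Immunity.** A refutation of the crux is exactly a proof of X together with a DISPROOF of
Valiant's hypothesis. -/
theorem not_sosMagnification_iff :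
    ¬ SOSMagnification ↔ (FeketeSOSHard ∧ ¬ ValiantsHypothesis) := by
  rw [sosMagnification_iff, Classical.not_imp]

/-- In particular any disproof of the crux disproves the summit. -/
theorem not_valiantsHypothesis_of_not_sosMagnification (h : ¬ SOSMagnification) :
    ¬ ValiantsHypothesis :=
  (not_sosMagnification_iff.1 h).2

/-- … and the crux follows from the summit (so it is consistent iff VP ≠ VNP is). -/
theorem sosMagnification_of_valiantsHypothesis (h : ValiantsHypothesis) : SOSMagnification :=
  fun _ => h

/-- … and the crux is vacuously true if X fails (failure mode (b) of the findings). -/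
theorem sosMagnification_of_not_feketeSOSHard (h : ¬ FeketeSOSHard) : SOSMagnification :=
  fun hX => absurd hX h

/-- **Antitonicity in δ.** Smaller δ admits fewer representations and asks for a weaker bound. -/
theorem hardAt_anti {δ δ' : ℝ} (hle : δ' ≤ δ) (h : HardAt δ) : HardAt δ' := by
  obtain ⟨p₀, hp₀⟩ := h
  refine ⟨p₀, fun p _ hp s c g hs hdeg hrep => ?_⟩
  have hp1 : (1 : ℝ) ≤ (p : ℝ) := by
    have := (Fact.out : p.Prime).one_lt
    exact_mod_cast this.le
  have hs' : (s : ℝ) ≤ (p : ℝ) ^ δ := hs.trans (Real.rpow_le_rpow_of_exponent_le hp1 hle)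
  have key := hp₀ p hp s c g hs' hdeg hrep
  exact (Real.rpow_le_rpow_of_exponent_le hp1 (by linarith)).trans key

/-- **Non-vacuity of X's universal**: the two-square representation `F = ¼(F+1)² − ¼(F−1)²`. -/
theorem two_squares_rep (p : ℕ) [Fact p.Prime] :
    (∑ i, C ((![(4 : ℂ)⁻¹, -(4 : ℂ)⁻¹]) i) * (![fekete p + 1, fekete p - 1]) i ^ 2) = fekete p := by
  simp only [Fin.sum_univ_two, Matrix.cons_val_zero, Matrix.cons_val_one]
  have h4 : (C (4 : ℂ)⁻¹ : Polynomial ℂ) * 4 = 1 := by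
    rw [← map_ofNat C 4, ← C_mul, inv_mul_cancel₀ (by norm_num), C_1]
  have : C (4 : ℂ)⁻¹ * (fekete p + 1) ^ 2 + C (-(4 : ℂ)⁻¹) * (fekete p - 1) ^ 2
      = C (4 : ℂ)⁻¹ * 4 * fekete p := by
    rw [map_neg]; ring
  rw [this, h4, one_mul]

/-! ### Tightness in δ: X(δ) fails for every δ > 1 (monomial-by-monomial representation) -/

/-- Splitting one monomial into two weighted squares of 2-sparse polynomials:
`χ·X^{a+b} = ¼χ(X^a+X^b)² − ¼χ(X^a−X^b)²`. -/
theorem split_monomial (χ : ℂ) (a b : ℕ) :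
    C ((1 : ℂ) * (χ / 4)) * (C 1 * X ^ a + C (1 : ℂ) * X ^ b) ^ 2
      + C ((-1 : ℂ) * (χ / 4)) * (C 1 * X ^ a + C (-1 : ℂ) * X ^ b) ^ 2 = C χ * X ^ (a + b) := by
  have h4 : (C (4 : ℂ)⁻¹ : Polynomial ℂ) * 4 = 1 := by
    rw [← map_ofNat C 4, ← C_mul, inv_mul_cancel₀ (by norm_num), C_1]
  rw [one_mul, neg_mul, one_mul, div_eq_mul_inv, map_neg, C_mul, map_neg, C_1, pow_add]
  linear_combination (C χ * X ^ a * X ^ b) * h4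

/-- Signs of the two squares attached to one monomial. -/
def sgn : Fin 2 → ℂ := ![1, -1]

@[simp] theorem sgn_zero : sgn 0 = 1 := rfl
@[simp] theorem sgn_one : sgn 1 = -1 := rfl

/-- Weights of the monomial-by-monomial representation, indexed by `Fin p × Fin 2`. -/
def monoCoef (p : ℕ) [Fact p.Prime] (x : Fin p × Fin 2) : ℂ :=
  sgn x.2 * ((((legendreSym p (x.1 : ℕ)) : ℤ) : ℂ) / 4)

/-- The 2-sparse polynomials `X^⌈m/2⌉ ± X^⌊m/2⌋` of the monomial-by-monomial representation. -/
def monoPoly (p : ℕ) (x : Fin p × Fin 2) : Polynomial ℂ :=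
  C 1 * X ^ (((x.1 : ℕ) + 1) / 2) + C (sgn x.2) * X ^ ((x.1 : ℕ) / 2)

theorem card_support_monoPoly_le (p : ℕ) (x : Fin p × Fin 2) : (monoPoly p x).support.card ≤ 2 :=
  (Finset.card_le_card (support_binomial_subset _ _ _ _)).trans Finset.card_le_two

theorem natDegree_monoPoly_le (p : ℕ) (x : Fin p × Fin 2) : (monoPoly p x).natDegree ≤ p ^ 2 := by
  have hm : (x.1 : ℕ) < p := x.1.is_lt
  have hp2 : p ≤ p ^ 2 := Nat.le_self_pow two_ne_zero p
  unfold monoPoly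
  refine (natDegree_add_le _ _).trans (max_le ?_ ?_)
  · exact (natDegree_C_mul_X_pow_le _ _).trans (by omega)
  · exact (natDegree_C_mul_X_pow_le _ _).trans (by omega)

/-- The monomial-by-monomial representation of `F_p` by `2p` squares. -/
theorem sum_monoRep (p : ℕ) [Fact p.Prime] :
    (∑ x : Fin p × Fin 2, C (monoCoef p x) * monoPoly p x ^ 2) = fekete p := by
  rw [Fintype.sum_prod_type]
  simp only [Fin.sum_univ_two, monoCoef, monoPoly, sgn_zero, sgn_one]
  rw [fekete, ← Fin.sum_univ_eq_sum_range]
  refine Finset.sum_congr rfl fun m _ => ?_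
  rw [split_monomial]
  congr 2
  omega

/-- **Tightness in δ.** `HardAt δ` is false for every `δ > 1`: for every prime `p ≥ 17` with
`p^{δ-1} ≥ 2` the monomial-by-monomial representation has `s = 2p ≤ p^δ` squares of degree `≤ p ≤ p²`
and support-sum `≤ 4p < p^{3/2} ≤ p^{1/2+δ}`.  So the δ of X necessarily lies in `(0, 1]`. -/
theorem not_hardAt_of_one_lt {δ : ℝ} (hδ : 1 < δ) : ¬ HardAt δ := by
  rintro ⟨p₀, H⟩
  set N : ℕ := ⌈(2 : ℝ) ^ (1 / (δ - 1))⌉₊ with hN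
  obtain ⟨p, hp_ge, hp_prime⟩ := Nat.exists_infinite_primes (max p₀ (max 17 N))
  haveI : Fact p.Prime := ⟨hp_prime⟩
  have hp₀ : p₀ ≤ p := le_trans (le_max_left _ _) hp_ge
  have h17 : 17 ≤ p := le_trans (le_trans (le_max_left _ _) (le_max_right _ _)) hp_ge
  have hNp : N ≤ p := le_trans (le_trans (le_max_right _ _) (le_max_right _ _)) hp_ge
  have hp_pos : (0 : ℝ) < p := by exact_mod_cast hp_prime.pos
  have hp1 : (1 : ℝ) ≤ p := by exact_mod_cast hp_prime.one_lt.le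
  have hδ1 : 0 < δ - 1 := by linarith
  -- (1) few squares: 2p ≤ p^δ
  have h2le : (2 : ℝ) ≤ (p : ℝ) ^ (δ - 1) := by
    have hNreal : (2 : ℝ) ^ (1 / (δ - 1)) ≤ (p : ℝ) :=
      (Nat.le_ceil _).trans (by exact_mod_cast hNp)
    calc (2 : ℝ) = ((2 : ℝ) ^ (1 / (δ - 1))) ^ (δ - 1) := by
          rw [← Real.rpow_mul (by norm_num : (0 : ℝ) ≤ 2), one_div, inv_mul_cancel₀ hδ1.ne',
            Real.rpow_one]
      _ ≤ (p : ℝ) ^ (δ - 1) := Real.rpow_le_rpow (by positivity) hNreal hδ1.le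
  have hs : ((p * 2 : ℕ) : ℝ) ≤ (p : ℝ) ^ δ := by
    have : (p : ℝ) ^ δ = (p : ℝ) * (p : ℝ) ^ (δ - 1) := by
      conv_lhs => rw [show δ = 1 + (δ - 1) by ring, Real.rpow_add hp_pos, Real.rpow_one]
    rw [this]
    push_cast
    exact mul_le_mul_of_nonneg_left h2le hp_pos.le
  -- the representation, transported to `Fin (p * 2)`
  set e := (finProdFinEquiv (m := p) (n := 2)).symm with he
  have hdeg : ∀ i : Fin (p * 2), (monoPoly p (e i)).natDegree ≤ p ^ 2 := fun i =>
    natDegree_monoPoly_le p (e i)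
  have hrep : (∑ i : Fin (p * 2), C (monoCoef p (e i)) * monoPoly p (e i) ^ 2) = fekete p := by
    rw [Fintype.sum_equiv e _ (fun x => C (monoCoef p x) * monoPoly p x ^ 2) (fun i => rfl)]
    exact sum_monoRep p
  have key := H p hp₀ (p * 2) (fun i => monoCoef p (e i)) (fun i => monoPoly p (e i)) hs hdeg hrep
  -- (2) support-sum ≤ 4p
  have hcard : (∑ i : Fin (p * 2), ((monoPoly p (e i)).support.card : ℝ)) ≤ 4 * p := by
    calc (∑ i : Fin (p * 2), ((monoPoly p (e i)).support.card : ℝ))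
        ≤ ∑ _i : Fin (p * 2), (2 : ℝ) :=
          Finset.sum_le_sum fun i _ => by exact_mod_cast card_support_monoPoly_le p (e i)
      _ = 4 * p := by
          rw [Finset.sum_const, Finset.card_univ, Fintype.card_fin, nsmul_eq_mul]
          push_cast
          ring
  -- (3) 4p < p^{3/2} ≤ p^{1/2+δ}
  have hlt : (4 : ℝ) * p < (p : ℝ) ^ (1 / 2 + δ) := by
    have h32 : (4 : ℝ) * p < (p : ℝ) ^ ((3 : ℝ) / 2) := by
      have h17r : (17 : ℝ) ≤ p := by exact_mod_cast h17
      have hsq : ((p : ℝ) ^ ((3 : ℝ) / 2)) ^ (2 : ℕ) = (p : ℝ) ^ (3 : ℕ) := by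
        rw [← Real.rpow_mul_natCast hp_pos.le, ← Real.rpow_natCast]
        norm_num
      refine lt_of_pow_lt_pow_left₀ 2 (by positivity) ?_
      rw [hsq]
      nlinarith
    calc (4 : ℝ) * p < (p : ℝ) ^ ((3 : ℝ) / 2) := h32
      _ ≤ (p : ℝ) ^ (1 / 2 + δ) := Real.rpow_le_rpow_of_exponent_le hp1 (by linarith)
  linarith

/-! ### Tightness in δ, sharper: X(δ) fails for every δ > 1/2 (the dense two-square representation) -/

theorem natDegree_fekete_lt (p : ℕ) [Fact p.Prime] : (fekete p).natDegree < p := by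
  have hp : 0 < p := (Fact.out : p.Prime).pos
  unfold fekete
  refine lt_of_le_of_lt (natDegree_sum_le_of_forall_le _ _ (n := p - 1) fun m hm => ?_) (by omega)
  exact (natDegree_C_mul_X_pow_le _ _).trans (by
    have := Finset.mem_range.1 hm
    omega)

theorem natDegree_fekete_add_C_lt (p : ℕ) [Fact p.Prime] (a : ℂ) : (fekete p + C a).natDegree < p := by
  have hp : 0 < p := (Fact.out : p.Prime).pos
  refine lt_of_le_of_lt (natDegree_add_le _ _) (max_lt (natDegree_fekete_lt p) ?_)
  rw [natDegree_C]; exact hp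

theorem card_support_fekete_add_C_le (p : ℕ) [Fact p.Prime] (a : ℂ) :
    (fekete p + C a).support.card ≤ p := by
  calc (fekete p + C a).support.card ≤ (Finset.range p).card :=
        Finset.card_le_card (supp_subset_range (natDegree_fekete_add_C_lt p a))
    _ = p := Finset.card_range p

/-- **Tightness in δ (sharp form).** `HardAt δ` is false for every `δ > 1/2`: the dense two-square
representation `F_p = ¼(F_p+1)² − ¼(F_p−1)²` is admitted (`s = 2 ≤ p^δ`, degrees `< p ≤ p²`) and has
support-sum `≤ 2p < p^{1/2+δ}` once `p^{δ-1/2} > 2`.  Hence the existential δ of X lies in `(0, 1/2]`: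
X asks EXACTLY for a polynomial gain over the trivial bound inside the window `[√(2p), 2p]`. -/
theorem not_hardAt_of_half_lt {δ : ℝ} (hδ : 1 / 2 < δ) : ¬ HardAt δ := by
  rintro ⟨p₀, H⟩
  set N : ℕ := ⌈(2 : ℝ) ^ (1 / (δ - 1 / 2))⌉₊ + 1 with hN
  obtain ⟨p, hp_ge, hp_prime⟩ := Nat.exists_infinite_primes (max p₀ (max 4 N))
  haveI : Fact p.Prime := ⟨hp_prime⟩
  have hp₀ : p₀ ≤ p := le_trans (le_max_left _ _) hp_ge
  have h4 : 4 ≤ p := le_trans (le_trans (le_max_left _ _) (le_max_right _ _)) hp_ge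
  have hNp : N ≤ p := le_trans (le_trans (le_max_right _ _) (le_max_right _ _)) hp_ge
  have hp_pos : (0 : ℝ) < p := by exact_mod_cast hp_prime.pos
  have hp1 : (1 : ℝ) ≤ p := by exact_mod_cast hp_prime.one_lt.le
  have hδ' : 0 < δ - 1 / 2 := by linarith
  -- (1) two squares are admitted: 2 ≤ p^{1/2} ≤ p^δ
  have hsqrt2 : (2 : ℝ) ≤ (p : ℝ) ^ (1 / 2 : ℝ) := by
    have hsq : ((p : ℝ) ^ (1 / 2 : ℝ)) ^ (2 : ℕ) = p := by
      rw [← Real.rpow_mul_natCast hp_pos.le]; norm_num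
    refine le_of_pow_le_pow_left₀ two_ne_zero (by positivity) ?_
    rw [hsq]
    have : (4 : ℝ) ≤ p := by exact_mod_cast h4
    linarith
  have hs : ((2 : ℕ) : ℝ) ≤ (p : ℝ) ^ δ :=
    hsqrt2.trans (Real.rpow_le_rpow_of_exponent_le hp1 hδ.le)
  -- the representation
  have hdeg : ∀ i : Fin 2, ((![fekete p + 1, fekete p - 1]) i).natDegree ≤ p ^ 2 := by
    have hp2 : p ≤ p ^ 2 := Nat.le_self_pow two_ne_zero p
    have hd₁ : (fekete p + 1).natDegree ≤ p ^ 2 := by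
      have h := natDegree_fekete_add_C_lt p 1
      rw [map_one] at h
      exact h.le.trans hp2
    have hd₂ : (fekete p - 1).natDegree ≤ p ^ 2 := by
      have h := natDegree_fekete_add_C_lt p (-1)
      rw [map_neg, map_one, ← sub_eq_add_neg] at h
      exact h.le.trans hp2
    intro i
    fin_cases i
    · exact hd₁
    · exact hd₂
  have key := H p hp₀ 2 (![(4 : ℂ)⁻¹, -(4 : ℂ)⁻¹]) (![fekete p + 1, fekete p - 1]) hs hdeg
    (two_squares_rep p)
  -- (2) support-sum ≤ 2p
  have hcard : (∑ i : Fin 2, (((![fekete p + 1, fekete p - 1]) i).support.card : ℝ)) ≤ 2 * p := by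
    have h₁ : (fekete p + 1).support.card ≤ p := by
      have h := card_support_fekete_add_C_le p 1
      rwa [map_one] at h
    have h₂ : (fekete p - 1).support.card ≤ p := by
      have h := card_support_fekete_add_C_le p (-1)
      rwa [map_neg, map_one, ← sub_eq_add_neg] at h
    simp only [Fin.sum_univ_two, Matrix.cons_val_zero, Matrix.cons_val_one]
    have h₁' : ((fekete p + 1).support.card : ℝ) ≤ p := by exact_mod_cast h₁
    have h₂' : ((fekete p - 1).support.card : ℝ) ≤ p := by exact_mod_cast h₂
    linarith
  -- (3) 2p < p^{1/2+δ} = p · p^{δ-1/2}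
  have hgt : (2 : ℝ) < (p : ℝ) ^ (δ - 1 / 2) := by
    have hNreal : (2 : ℝ) ^ (1 / (δ - 1 / 2)) < (p : ℝ) := by
      have h1 : (2 : ℝ) ^ (1 / (δ - 1 / 2)) ≤ (⌈(2 : ℝ) ^ (1 / (δ - 1 / 2))⌉₊ : ℝ) := Nat.le_ceil _
      have h2 : ((⌈(2 : ℝ) ^ (1 / (δ - 1 / 2))⌉₊ : ℕ) : ℝ) + 1 ≤ (p : ℝ) := by exact_mod_cast hNp
      linarith
    calc (2 : ℝ) = ((2 : ℝ) ^ (1 / (δ - 1 / 2))) ^ (δ - 1 / 2) := by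
          rw [← Real.rpow_mul (by norm_num : (0 : ℝ) ≤ 2), one_div, inv_mul_cancel₀ hδ'.ne',
            Real.rpow_one]
      _ < (p : ℝ) ^ (δ - 1 / 2) := Real.rpow_lt_rpow (by positivity) hNreal hδ'
  have hlt : (2 : ℝ) * p < (p : ℝ) ^ (1 / 2 + δ) := by
    have : (p : ℝ) ^ (1 / 2 + δ) = (p : ℝ) * (p : ℝ) ^ (δ - 1 / 2) := by
      conv_lhs => rw [show 1 / 2 + δ = 1 + (δ - 1 / 2) by ring, Real.rpow_add hp_pos, Real.rpow_one]
    rw [this, mul_comm]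
    exact mul_lt_mul_of_pos_left hgt hp_pos
  linarith

/-- **WLOG δ ≤ 1/2.** Consequently X is equivalent to its restriction to `δ ∈ (0, 1/2]`. -/
theorem feketeSOSHard_iff_small : FeketeSOSHard ↔ ∃ δ : ℝ, 0 < δ ∧ δ ≤ 1 / 2 ∧ HardAt δ := by
  rw [feketeSOSHard_iff]
  constructor
  · rintro ⟨δ, hδ, h⟩
    refine ⟨δ, hδ, ?_, h⟩
    by_contra hlt
    exact not_hardAt_of_half_lt (lt_of_not_ge hlt) h
  · rintro ⟨δ, hδ, -, h⟩
    exact ⟨δ, hδ, h⟩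


/-! ## Cycle 2 (gen 2): small-model structure of X and the degree hypothesis -/

theorem coeff_fekete (p : ℕ) [Fact p.Prime] (n : ℕ) :
    (fekete p).coeff n = if n < p then (((legendreSym p n : ℤ)) : ℂ) else 0 := by
  unfold fekete
  simp only [finsetSum_coeff, coeff_C_mul_X_pow]
  split_ifs with h
  · rw [Finset.sum_eq_single n]
    · simp
    · intro b _ hb; simp [Ne.symm hb]
    · intro hn; exact absurd (Finset.mem_range.2 h) hn
  · refine Finset.sum_eq_zero fun b hb => ?_
    have : b < p := Finset.mem_range.1 hb
    simp [show n ≠ b by omega]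

theorem coeff_fekete_zero (p : ℕ) [Fact p.Prime] : (fekete p).coeff 0 = 0 := by
  rw [coeff_fekete]; simp

theorem coeff_fekete_one (p : ℕ) [Fact p.Prime] : (fekete p).coeff 1 = 1 := by
  rw [coeff_fekete, if_pos (Fact.out : p.Prime).one_lt]
  simp

theorem fekete_ne_zero (p : ℕ) [Fact p.Prime] : fekete p ≠ 0 := by
  intro h
  have := coeff_fekete_one p
  rw [h, coeff_zero] at this
  exact zero_ne_one this

/-- **No single weighted square is `F_p`**: `x = 0` is a simple root (`F_p(0) = 0`, `F_p'(0) = 1`). -/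
theorem C_mul_sq_ne_fekete (p : ℕ) [Fact p.Prime] (c : ℂ) (g : Polynomial ℂ) :
    C c * g ^ 2 ≠ fekete p := by
  intro h
  have h0 := congrArg (fun q => q.coeff 0) h
  have h1 := congrArg (fun q => q.coeff 1) h
  simp only [coeff_C_mul, coeff_fekete_zero, coeff_fekete_one] at h0 h1
  rw [pow_two, mul_coeff_zero] at h0
  rcases mul_eq_zero.1 h0 with hc | hg
  · rw [hc, zero_mul] at h1; exact zero_ne_one h1
  · have hg0 : g.coeff 0 = 0 := by rcases mul_eq_zero.1 hg with h' | h' <;> exact h'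
    obtain ⟨q, rfl⟩ := Polynomial.X_dvd_iff.2 hg0
    have h2 : ((X * q) ^ 2).coeff 1 = 0 := by
      rw [show (X * q) ^ 2 = q ^ 2 * X ^ 2 by ring, coeff_mul_X_pow']
      simp
    rw [h2, mul_zero] at h1
    exact zero_ne_one h1

/-- **Small-model fact: at least two squares.** Every weighted-SOS representation of `F_p` has
`s ≥ 2`; with `two_squares_rep`, the universal of `X(δ)` at a prime `p` is inhabited iff `p ^ δ ≥ 2`. -/
theorem two_le_of_rep (p : ℕ) [Fact p.Prime] {s : ℕ} (c : Fin s → ℂ) (g : Fin s → Polynomial ℂ)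
    (h : (∑ i, C (c i) * g i ^ 2) = fekete p) : 2 ≤ s := by
  rcases Nat.lt_or_ge s 2 with hs | hs
  · interval_cases s
    · simp only [Finset.univ_eq_empty, Finset.sum_empty] at h
      have h1 := congrArg (fun q => q.coeff 1) h
      simp only [coeff_zero, coeff_fekete_one] at h1
      exact absurd h1 zero_ne_one
    · rw [Fin.sum_univ_one] at h
      exact absurd h (C_mul_sq_ne_fekete p _ _)
  · exact hs

/-- **The degree hypothesis of X is decoration for two squares.** In any representation of `F_p` by
two weighted squares both `gᵢ` have degree `< p` (hence `≤ p²` automatically): both weights are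
nonzero (`C_mul_sq_ne_fekete`), so `c₀g₀² + c₁g₁² = (a g₀ + b g₁)(a g₀ − b g₁)` with `a² = c₀`,
`b² = −c₁`, the two factors have degrees summing to `deg F_p < p`, and `g₀ = (A+B)/2a`, `g₁ = (A−B)/2b`.
So the `s ≤ 2` layer of X is `FeketeNoSparseSplit` (up to the factor 2 of `SplitOfTwoSquares`) with NO
side condition at all. -/
theorem natDegree_lt_of_two_squares (p : ℕ) [Fact p.Prime] (c : Fin 2 → ℂ)
    (g : Fin 2 → Polynomial ℂ) (h : (∑ i, C (c i) * g i ^ 2) = fekete p) :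
    ∀ i, (g i).natDegree < p := by
  simp only [Fin.sum_univ_two] at h
  have hc0 : c 0 ≠ 0 := by
    intro h0; rw [h0, map_zero, zero_mul, zero_add] at h; exact C_mul_sq_ne_fekete p _ _ h
  have hc1 : c 1 ≠ 0 := by
    intro h0; rw [h0, map_zero, zero_mul, add_zero] at h; exact C_mul_sq_ne_fekete p _ _ h
  obtain ⟨a, ha⟩ := IsAlgClosed.exists_eq_mul_self (c 0)
  obtain ⟨b, hb⟩ := IsAlgClosed.exists_eq_mul_self (-c 1)
  have ha0 : a ≠ 0 := by rintro rfl; exact hc0 (by rw [ha, mul_zero])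
  have hb0 : b ≠ 0 := by rintro rfl; apply hc1; have := hb; simp at this; exact this
  set A := C a * g 0 + C b * g 1 with hA
  set B := C a * g 0 - C b * g 1 with hB
  have hAB : A * B = fekete p := by
    rw [← h, hA, hB]
    have e0 : C (c 0) = C a * C a := by rw [← C_mul, ← ha]
    have e1 : C (c 1) = -(C b * C b) := by rw [← C_mul, ← hb, map_neg, neg_neg]
    rw [e0, e1]; ring
  have hA0 : A ≠ 0 := by intro h0; rw [h0, zero_mul] at hAB; exact fekete_ne_zero p hAB.symm
  have hB0 : B ≠ 0 := by intro h0; rw [h0, mul_zero] at hAB; exact fekete_ne_zero p hAB.symm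
  have hsum : A.natDegree + B.natDegree < p := by
    rw [← natDegree_mul hA0 hB0, hAB]; exact natDegree_fekete_lt p
  have hg0 : g 0 = C (2 * a)⁻¹ * (A + B) := by
    rw [hA, hB]
    have : C (2 * a)⁻¹ * (C a * g 0 + C b * g 1 + (C a * g 0 - C b * g 1))
        = C ((2 * a)⁻¹ * (2 * a)) * g 0 := by rw [C_mul, C_mul]; simp only [map_ofNat]; ring
    rw [this, inv_mul_cancel₀ (mul_ne_zero two_ne_zero ha0), C_1, one_mul]
  have hg1 : g 1 = C (2 * b)⁻¹ * (A - B) := by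
    rw [hA, hB]
    have : C (2 * b)⁻¹ * (C a * g 0 + C b * g 1 - (C a * g 0 - C b * g 1))
        = C ((2 * b)⁻¹ * (2 * b)) * g 1 := by rw [C_mul, C_mul]; simp only [map_ofNat]; ring
    rw [this, inv_mul_cancel₀ (mul_ne_zero two_ne_zero hb0), C_1, one_mul]
  have hApB : (A + B).natDegree < p :=
    lt_of_le_of_lt (natDegree_add_le _ _) (max_lt (by omega) (by omega))
  have hAmB : (A - B).natDegree < p :=
    lt_of_le_of_lt (natDegree_sub_le _ _) (max_lt (by omega) (by omega))
  intro i
  fin_cases i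
  · show (g 0).natDegree < p
    rw [hg0]; exact lt_of_le_of_lt (natDegree_C_mul_le _ _) hApB
  · show (g 1).natDegree < p
    rw [hg1]; exact lt_of_le_of_lt (natDegree_C_mul_le _ _) hAmB

/-- … whereas **from three squares on the degree hypothesis genuinely restricts**: `F_p` has
three-square representations with a square of arbitrarily large degree (`g₂ = X^{N+1}` arbitrary,
`g₀, g₁ = F_p − g₂² ± 1`, weights `¼, −¼, 1`).  So X excludes strictly fewer representations than its
degree-free strengthening; whether that strengthening holds is open (no refutation found). -/
theorem exists_three_squares_natDegree_gt (p : ℕ) [Fact p.Prime] (N : ℕ) :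
    ∃ (c : Fin 3 → ℂ) (g : Fin 3 → Polynomial ℂ),
      (∑ i, C (c i) * g i ^ 2) = fekete p ∧ N < (g 2).natDegree := by
  refine ⟨![(4 : ℂ)⁻¹, -(4 : ℂ)⁻¹, 1],
    ![fekete p - X ^ (2 * (N + 1)) + 1, fekete p - X ^ (2 * (N + 1)) - 1, X ^ (N + 1)], ?_, ?_⟩
  · simp only [Fin.sum_univ_three, Matrix.cons_val_zero, Matrix.cons_val_one, Matrix.cons_val_two,
      Matrix.head_cons, Matrix.tail_cons]
    have h4 : (C (4 : ℂ)⁻¹ : Polynomial ℂ) * 4 = 1 := by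
      rw [← map_ofNat C 4, ← C_mul, inv_mul_cancel₀ (by norm_num), C_1]
    rw [map_neg, map_one, ← pow_mul, mul_comm (N + 1) 2]
    linear_combination (fekete p - X ^ (2 * (N + 1))) * h4
  · simp only [Matrix.cons_val_two, Matrix.tail_cons, Matrix.head_cons, natDegree_X_pow]
    omega

/-! ## Cycle 2: the crux read contrapositively -/

/-- Unfolding the summit: a disproof of the crux is a proof of X together with `VP_ℂ = VNP_ℂ`. -/
theorem not_sosMagnification_iff_vp_eq :
    ¬ SOSMagnification ↔ (FeketeSOSHard ∧
      Literature.Computability.AlgebraicComplexity.VP ℂ =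
        Literature.Computability.AlgebraicComplexity.VNP ℂ) := by
  show ¬ (FeketeSOSHard → ValiantsHypothesis) ↔ _
  rw [Classical.not_imp]
  simp only [ValiantsHypothesis, Literature.PNP.ValiantHypothesis, ne_eq, not_not]

/-- **The crux is a conditional disproof of X**: `SOSMagnification ↔ (VP_ℂ = VNP_ℂ → ¬ X)`.  What the
provers of this item establish is exactly that DST's mechanism, fed a polynomial-size circuit for the
Legendre digit family, produces representations of `F_p` violating X. -/
theorem sosMagnification_iff_refutes :
    SOSMagnification ↔
      (Literature.Computability.AlgebraicComplexity.VP ℂ =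
          Literature.Computability.AlgebraicComplexity.VNP ℂ → ¬ FeketeSOSHard) := by
  show (FeketeSOSHard → ValiantsHypothesis) ↔ _
  simp only [ValiantsHypothesis, Literature.PNP.ValiantHypothesis, ne_eq]
  tauto


/-! ## Cycle 2: the magnitude obstruction (no private triples) -/

/-- **No private triples.** If one square contributes alone to the three coefficients at `2a`, `2b`,
`a + b` (`c·u² = e₁`, `c·v² = e₂`, `2c·u·v = e₃` with `u = gᵢ(a)`, `v = gᵢ(b)`) and these coefficients
are `±1`, contradiction: `e₃² = 4e₁e₂ = ±4 ≠ 1`.  See finding 12 for the (second-order) counting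
consequence. -/
theorem no_private_triple {c u v e₁ e₂ e₃ : ℂ} (h₁ : c * u ^ 2 = e₁) (h₂ : c * v ^ 2 = e₂)
    (h₃ : 2 * c * u * v = e₃) (n₁ : e₁ ^ 2 = 1) (n₂ : e₂ ^ 2 = 1) (n₃ : e₃ ^ 2 = 1) : False := by
  have key : e₃ ^ 2 = 4 * (e₁ * e₂) := by rw [← h₁, ← h₂, ← h₃]; ring
  have hsq : (e₁ * e₂) ^ 2 = 1 := by rw [mul_pow, n₁, n₂, one_mul]
  have h4 : 4 * (e₁ * e₂) = 1 := by rw [← key, n₃]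
  have h16 : (4 * (e₁ * e₂)) ^ 2 = 16 := by rw [mul_pow, hsq]; norm_num
  rw [h4] at h16
  norm_num at h16

/-! ## Cycle 3 (gen 3): Targets — the registered stubs of the picked line `sml-polarised-transport`

No `_false` theorem: all seven registered stubs (`stub_legendreCircuit`, `stub_oneHotLtCircuit`,
`stub_circuitSumIdentity`, `stub_vnpAssembly`, `stub_digitKronecker`, `stub_polarisedSOS`, `stub_budget`;
skeleton sha `ea74875f…`) are TRUE as typed — corner record in finding 14 of the header.  The union bound
`|supp (A ± B)| ≤ |supp A| + |supp B|` and the digit reindexing `(a, b) ↦ a + q·b` used below are the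
two-block instances of the lever `stub_polarisedSOS` and of `stub_digitKronecker`/`stub_circuitSumIdentity`. -/

/-! ## Cycle 3 (gen 3): the primality of the modulus is load-bearing in X -/

/-- The Jacobi–Fekete polynomial of an arbitrary modulus `n`: `F_n = ∑_{m<n} (m|n)·X^m ∈ ℂ[X]`
(Jacobi symbol); at a prime this is the route's `F_p` (`jacobiFekete_prime`). -/
def jacobiFekete (n : ℕ) : Polynomial ℂ :=
  ∑ m ∈ Finset.range n, C ((jacobiSym m n : ℤ) : ℂ) * X ^ m

theorem jacobiFekete_prime (p : ℕ) [Fact p.Prime] : jacobiFekete p = fekete p := by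
  unfold jacobiFekete fekete
  refine Finset.sum_congr rfl fun m _ => ?_
  rw [← jacobiSym.legendreSym.to_jacobiSym]

/-- `HardWithoutPrimeAt δ`: the δ-slice of X with the hypothesis "`p` prime" weakened to "`p` odd"
(the Legendre symbol read as the Jacobi symbol, which it is at primes). -/
def HardWithoutPrimeAt (δ : ℝ) : Prop :=
  ∃ p₀ : ℕ, ∀ p : ℕ, Odd p → p₀ ≤ p → ∀ (s : ℕ) (c : Fin s → ℂ) (g : Fin s → Polynomial ℂ),
    (s : ℝ) ≤ (p : ℝ) ^ δ → (∀ i, (g i).natDegree ≤ p ^ 2) →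
    (∑ i, C (c i) * g i ^ 2) = jacobiFekete p → (p : ℝ) ^ (1 / 2 + δ) ≤ ∑ i, ((g i).support.card : ℝ)

/-- X without primality: `∃ δ > 0, HardWithoutPrimeAt δ`. -/
def HardWithoutPrime : Prop := ∃ δ : ℝ, 0 < δ ∧ HardWithoutPrimeAt δ

/-- It IS a strengthening of X: restricting the odd moduli to primes `≥ 3` gives back `HardAt δ`. -/
theorem hardAt_of_hardWithoutPrimeAt {δ : ℝ} (h : HardWithoutPrimeAt δ) : HardAt δ := by
  obtain ⟨p₀, H⟩ := h
  refine ⟨max p₀ 3, fun p _ hp s c g hs hdeg hrep => ?_⟩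
  have hprime : p.Prime := Fact.out
  have hp3 : 3 ≤ p := le_trans (le_max_right _ _) hp
  have hodd : Odd p := hprime.odd_of_ne_two (by omega)
  exact H p hodd (le_trans (le_max_left _ _) hp) s c g hs hdeg (hrep.trans (jacobiFekete_prime p).symm)

theorem feketeSOSHard_of_hardWithoutPrime (h : HardWithoutPrime) : FeketeSOSHard := by
  obtain ⟨δ, hδ, h⟩ := h
  exact feketeSOSHard_iff.2 ⟨δ, hδ, hardAt_of_hardWithoutPrimeAt h⟩

/-- the low digits `∑_{1 ≤ a < q} X^a` -/
def lowDigits (q : ℕ) : Polynomial ℂ := ∑ a ∈ Finset.Ico 1 q, X ^ a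

/-- the high digits `∑_{b < q} X^{q b}` -/
def highDigits (q : ℕ) : Polynomial ℂ := ∑ b ∈ Finset.range q, X ^ (q * b)

theorem coeff_lowDigits (q n : ℕ) :
    (lowDigits q).coeff n = if n ∈ Finset.Ico 1 q then (1 : ℂ) else 0 := by
  unfold lowDigits
  simp only [finsetSum_coeff, coeff_X_pow]
  rw [Finset.sum_ite_eq]

theorem support_lowDigits_subset (q : ℕ) : (lowDigits q).support ⊆ Finset.Ico 1 q := by
  intro n hn
  rw [mem_support_iff, coeff_lowDigits] at hn
  by_contra h
  exact hn (if_neg h)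

theorem card_support_lowDigits_le (q : ℕ) : (lowDigits q).support.card ≤ q - 1 :=
  (Finset.card_le_card (support_lowDigits_subset q)).trans (by simp)

theorem coeff_highDigits (q n : ℕ) :
    (highDigits q).coeff n = ∑ b ∈ Finset.range q, if n = q * b then (1 : ℂ) else 0 := by
  unfold highDigits
  simp only [finsetSum_coeff, coeff_X_pow]

theorem support_highDigits_subset (q : ℕ) :
    (highDigits q).support ⊆ (Finset.range q).image (fun b => q * b) := by
  intro n hn
  rw [mem_support_iff, coeff_highDigits] at hn
  by_contra h
  apply hn
  refine Finset.sum_eq_zero fun b hb => ?_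
  rw [if_neg]
  rintro rfl
  exact h (Finset.mem_image.2 ⟨b, hb, rfl⟩)

theorem card_support_highDigits_le (q : ℕ) : (highDigits q).support.card ≤ q :=
  (Finset.card_le_card (support_highDigits_subset q)).trans
    (Finset.card_image_le.trans (by simp))

theorem natDegree_lowDigits_le (q : ℕ) : (lowDigits q).natDegree ≤ q := by
  unfold lowDigits
  refine natDegree_sum_le_of_forall_le _ _ fun a ha => ?_
  rw [natDegree_X_pow]
  exact (Finset.mem_Ico.1 ha).2.le

theorem natDegree_highDigits_le (q : ℕ) : (highDigits q).natDegree ≤ q * q := by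
  unfold highDigits
  refine natDegree_sum_le_of_forall_le _ _ fun b hb => ?_
  rw [natDegree_X_pow]
  exact Nat.mul_le_mul_left q (Finset.mem_range.1 hb).le

/-- The Jacobi symbol modulo a prime square is the principal character: `(m | q²) = [q ∤ m]`. -/
theorem jacobiSym_prime_sq (q : ℕ) [Fact q.Prime] (m : ℕ) :
    jacobiSym m (q ^ 2) = if q ∣ m then 0 else 1 := by
  have hcast : (((m : ℤ) : ZMod q) = 0) ↔ q ∣ m := by
    rw [ZMod.intCast_zmod_eq_zero_iff_dvd, Int.natCast_dvd_natCast]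
  rw [jacobiSym.pow_right, ← jacobiSym.legendreSym.to_jacobiSym]
  split_ifs with h
  · rw [(legendreSym.eq_zero_iff q (m : ℤ)).2 (hcast.2 h), zero_pow two_ne_zero]
  · exact legendreSym.sq_one q (fun h0 => h (hcast.1 h0))

/-- **Digit splitting at a prime square.** `F_{q²} = (∑_{1≤a<q} X^a)·(∑_{b<q} X^{qb})`: the
Jacobi–Fekete polynomial of a prime-square modulus is a product of two `q`-sparse polynomials
(an interval tiling `[1, q²) ∖ qℕ = [1, q) ⊕ q·[0, q)`). -/
theorem lowDigits_mul_highDigits (q : ℕ) [Fact q.Prime] :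
    lowDigits q * highDigits q = jacobiFekete (q ^ 2) := by
  have hq : 0 < q := (Fact.out : q.Prime).pos
  unfold lowDigits highDigits jacobiFekete
  rw [Finset.sum_mul_sum, ← Finset.sum_product']
  have hR : (∑ m ∈ Finset.range (q ^ 2), C ((jacobiSym m (q ^ 2) : ℤ) : ℂ) * X ^ m)
      = ∑ m ∈ (Finset.range (q ^ 2)).filter (fun m => ¬ q ∣ m), (X : Polynomial ℂ) ^ m := by
    rw [Finset.sum_filter]
    refine Finset.sum_congr rfl fun m _ => ?_
    rw [jacobiSym_prime_sq]
    split_ifs with h <;> simp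
  rw [hR]
  refine Finset.sum_nbij' (fun x => x.1 + q * x.2) (fun m => (m % q, m / q)) ?_ ?_ ?_ ?_ ?_
  · rintro ⟨a, b⟩ hab
    simp only [Finset.mem_product, Finset.mem_Ico, Finset.mem_range] at hab
    obtain ⟨⟨ha1, haq⟩, hb⟩ := hab
    simp only [Finset.mem_filter, Finset.mem_range]
    refine ⟨?_, ?_⟩
    · have key : q * b + q ≤ q * q := by rw [← Nat.mul_succ]; exact Nat.mul_le_mul_left q hb
      rw [sq]
      omega
    · intro hdvd
      have hqa : q ∣ a := (Nat.dvd_add_left (dvd_mul_right q b)).1 hdvd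
      exact absurd (Nat.le_of_dvd (by omega) hqa) (by omega)
  · intro m hm
    simp only [Finset.mem_filter, Finset.mem_range] at hm
    obtain ⟨hm, hndvd⟩ := hm
    simp only [Finset.mem_product, Finset.mem_Ico, Finset.mem_range]
    refine ⟨⟨?_, Nat.mod_lt _ hq⟩, ?_⟩
    · rcases Nat.eq_zero_or_pos (m % q) with h0 | hpos
      · exact absurd (Nat.dvd_of_mod_eq_zero h0) hndvd
      · exact hpos
    · exact (Nat.div_lt_iff_lt_mul hq).2 (by rw [sq] at hm; exact hm)
  · rintro ⟨a, b⟩ hab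
    simp only [Finset.mem_product, Finset.mem_Ico, Finset.mem_range] at hab
    obtain ⟨⟨_, haq⟩, _⟩ := hab
    show ((a + q * b) % q, (a + q * b) / q) = (a, b)
    rw [Nat.add_mul_mod_self_left, Nat.mod_eq_of_lt haq, Nat.add_mul_div_left _ _ hq,
      Nat.div_eq_of_lt haq, zero_add]
  · intro m _
    exact Nat.mod_add_div m q
  · rintro ⟨a, b⟩ _
    exact (pow_add _ _ _).symm

/-- **X without primality is false at EVERY δ > 0.** For a large prime `q` the odd modulus `p = q²`
admits the two-square representation `F_{q²} = ¼(A+B)² − ¼(A−B)²` (`A, B` the digit factors):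
`s = 2 ≤ p^δ`, degrees `≤ q² ≤ p²`, support-sum `≤ 4q − 2 < q^{1+2δ} = p^{1/2+δ}`. -/
theorem not_hardWithoutPrimeAt {δ : ℝ} (hδ : 0 < δ) : ¬ HardWithoutPrimeAt δ := by
  rintro ⟨p₀, H⟩
  set N : ℕ := ⌈(4 : ℝ) ^ (1 / (2 * δ))⌉₊ + 1 with hN
  obtain ⟨q, hq_ge, hq_prime⟩ := Nat.exists_infinite_primes (max p₀ (max 3 N))
  haveI : Fact q.Prime := ⟨hq_prime⟩
  have hp₀q : p₀ ≤ q := le_trans (le_max_left _ _) hq_ge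
  have h3 : 3 ≤ q := le_trans (le_trans (le_max_left _ _) (le_max_right _ _)) hq_ge
  have hNq : N ≤ q := le_trans (le_trans (le_max_right _ _) (le_max_right _ _)) hq_ge
  have hq_pos : (0 : ℝ) < q := by exact_mod_cast hq_prime.pos
  have hodd : Odd (q ^ 2) := (hq_prime.odd_of_ne_two (by omega)).pow
  have hp₀' : p₀ ≤ q ^ 2 := hp₀q.trans (Nat.le_self_pow two_ne_zero q)
  have h2δ : 0 < 2 * δ := by linarith
  -- numerics: 4 < q^{2δ}
  have hgt : (4 : ℝ) < (q : ℝ) ^ (2 * δ) := by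
    have hNreal : (4 : ℝ) ^ (1 / (2 * δ)) < (q : ℝ) := by
      have h1 : (4 : ℝ) ^ (1 / (2 * δ)) ≤ (⌈(4 : ℝ) ^ (1 / (2 * δ))⌉₊ : ℝ) := Nat.le_ceil _
      have h2 : ((⌈(4 : ℝ) ^ (1 / (2 * δ))⌉₊ : ℕ) : ℝ) + 1 ≤ (q : ℝ) := by exact_mod_cast hNq
      linarith
    calc (4 : ℝ) = ((4 : ℝ) ^ (1 / (2 * δ))) ^ (2 * δ) := by
          rw [← Real.rpow_mul (by norm_num : (0 : ℝ) ≤ 4), one_div, inv_mul_cancel₀ h2δ.ne',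
            Real.rpow_one]
      _ < (q : ℝ) ^ (2 * δ) := Real.rpow_lt_rpow (by positivity) hNreal h2δ
  have hcast : ((q ^ 2 : ℕ) : ℝ) = (q : ℝ) ^ (2 : ℝ) := by
    rw [Real.rpow_two]; push_cast; ring
  -- (1) two squares are admitted: 2 ≤ (q²)^δ = q^{2δ}
  have hs : ((2 : ℕ) : ℝ) ≤ ((q ^ 2 : ℕ) : ℝ) ^ δ := by
    rw [hcast, ← Real.rpow_mul hq_pos.le]
    push_cast
    linarith
  -- the representation
  set A := lowDigits q with hA
  set B := highDigits q with hB
  have hrep : (∑ i, C ((![(4 : ℂ)⁻¹, -(4 : ℂ)⁻¹]) i) * (![A + B, A - B]) i ^ 2)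
      = jacobiFekete (q ^ 2) := by
    simp only [Fin.sum_univ_two, Matrix.cons_val_zero, Matrix.cons_val_one]
    have h4 : (C (4 : ℂ)⁻¹ : Polynomial ℂ) * 4 = 1 := by
      rw [← map_ofNat C 4, ← C_mul, inv_mul_cancel₀ (by norm_num), C_1]
    rw [← lowDigits_mul_highDigits q]
    have : C (4 : ℂ)⁻¹ * (A + B) ^ 2 + C (-(4 : ℂ)⁻¹) * (A - B) ^ 2 = C (4 : ℂ)⁻¹ * 4 * (A * B) := by
      rw [map_neg]; ring
    rw [this, h4, one_mul]
  have hdeg : ∀ i : Fin 2, ((![A + B, A - B]) i).natDegree ≤ (q ^ 2) ^ 2 := by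
    have hA' : A.natDegree ≤ q := natDegree_lowDigits_le q
    have hB' : B.natDegree ≤ q * q := natDegree_highDigits_le q
    have hqq : q ≤ q * q := Nat.le_mul_self q
    have hbig : q * q ≤ (q ^ 2) ^ 2 := by rw [← sq]; exact Nat.le_self_pow two_ne_zero _
    have h₁ : (A + B).natDegree ≤ (q ^ 2) ^ 2 :=
      (natDegree_add_le _ _).trans (max_le (hA'.trans (hqq.trans hbig)) (hB'.trans hbig))
    have h₂ : (A - B).natDegree ≤ (q ^ 2) ^ 2 :=
      (natDegree_sub_le _ _).trans (max_le (hA'.trans (hqq.trans hbig)) (hB'.trans hbig))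
    intro i
    fin_cases i
    · exact h₁
    · exact h₂
  have key := H (q ^ 2) hodd hp₀' 2 (![(4 : ℂ)⁻¹, -(4 : ℂ)⁻¹]) (![A + B, A - B]) hs hdeg hrep
  -- (2) support-sum ≤ 4q − 2
  have h1q : 1 ≤ q := hq_prime.one_lt.le
  have hcardA : (A.support.card : ℝ) ≤ q - 1 := by
    have h : (A.support.card : ℝ) ≤ ((q - 1 : ℕ) : ℝ) := by exact_mod_cast card_support_lowDigits_le q
    rwa [Nat.cast_sub h1q, Nat.cast_one] at h
  have hcardB : (B.support.card : ℝ) ≤ q := by exact_mod_cast card_support_highDigits_le q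
  have hAB₁ : (((A + B).support.card : ℕ) : ℝ) ≤ A.support.card + B.support.card := by
    exact_mod_cast (Finset.card_le_card support_add).trans (Finset.card_union_le _ _)
  have hAB₂ : (((A - B).support.card : ℕ) : ℝ) ≤ A.support.card + B.support.card := by
    have hsub : (A - B).support ⊆ A.support ∪ B.support := by
      rw [sub_eq_add_neg]
      refine support_add.trans ?_
      rw [support_neg]
    exact_mod_cast (Finset.card_le_card hsub).trans (Finset.card_union_le _ _)
  have hsum : (∑ i : Fin 2, ((((![A + B, A - B]) i).support.card : ℝ))) ≤ 4 * q - 2 := by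
    simp only [Fin.sum_univ_two, Matrix.cons_val_zero, Matrix.cons_val_one]
    linarith
  -- (3) 4q − 2 < (q²)^{1/2+δ} = q · q^{2δ}
  have hlt : (4 : ℝ) * q < ((q ^ 2 : ℕ) : ℝ) ^ (1 / 2 + δ) := by
    rw [hcast, ← Real.rpow_mul hq_pos.le,
      show (2 : ℝ) * (1 / 2 + δ) = 1 + 2 * δ by ring, Real.rpow_add hq_pos, Real.rpow_one]
    calc (4 : ℝ) * q = q * 4 := by ring
      _ < q * (q : ℝ) ^ (2 * δ) := mul_lt_mul_of_pos_left hgt hq_pos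
  linarith

/-- Hence X without primality fails outright. -/
theorem hardWithoutPrime_false : ¬ HardWithoutPrime := fun ⟨_, hδ, h⟩ => not_hardWithoutPrimeAt hδ h

/-! ### … and for a NON-principal character: the prime-cube modulus -/

/-- the cube digits `∑_{j < q²} X^{q j}` -/
def cubeDigits (q : ℕ) : Polynomial ℂ := ∑ j ∈ Finset.range (q ^ 2), X ^ (q * j)

/-- `(m | n³) = (m | n)` for the Jacobi symbol. -/
theorem jacobiSym_cube (m n : ℕ) : jacobiSym m (n ^ 3) = jacobiSym m n := by
  rw [jacobiSym.pow_right]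
  rcases jacobiSym.trichotomy (m : ℤ) n with h | h | h <;> rw [h] <;> norm_num

/-- **Digit splitting at a prime cube (non-principal character).** `F_{q³} = F_q(X) · ∑_{j<q²} X^{qj}`:
the Jacobi–Fekete polynomial of the imprimitive character `(· | q)` to the modulus `q³` is the product
of the `(q−1)`-sparse `F_q` and a `q²`-sparse polynomial — support-sum `O(n^{2/3})` for `n = q³`. -/
theorem fekete_mul_cubeDigits (q : ℕ) [Fact q.Prime] :
    fekete q * cubeDigits q = jacobiFekete (q ^ 3) := by
  have hq : 0 < q := (Fact.out : q.Prime).pos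
  unfold fekete cubeDigits jacobiFekete
  rw [Finset.sum_mul_sum, ← Finset.sum_product']
  refine Finset.sum_nbij' (fun x => x.1 + q * x.2) (fun m => (m % q, m / q)) ?_ ?_ ?_ ?_ ?_
  · rintro ⟨a, j⟩ h
    simp only [Finset.mem_product, Finset.mem_range] at h ⊢
    have key : q * j + q ≤ q * q ^ 2 := by rw [← Nat.mul_succ]; exact Nat.mul_le_mul_left q h.2
    have h3 : q ^ 3 = q * q ^ 2 := by ring
    omega
  · intro m hm
    simp only [Finset.mem_range, Finset.mem_product] at hm ⊢
    refine ⟨Nat.mod_lt _ hq, (Nat.div_lt_iff_lt_mul hq).2 ?_⟩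
    calc m < q ^ 3 := hm
      _ = q ^ 2 * q := by ring
  · rintro ⟨a, j⟩ h
    simp only [Finset.mem_product, Finset.mem_range] at h
    show ((a + q * j) % q, (a + q * j) / q) = (a, j)
    rw [Nat.add_mul_mod_self_left, Nat.mod_eq_of_lt h.1, Nat.add_mul_div_left _ _ hq,
      Nat.div_eq_of_lt h.1, zero_add]
  · intro m _
    exact Nat.mod_add_div m q
  · rintro ⟨a, j⟩ h
    simp only [Finset.mem_product, Finset.mem_range] at h
    have hJ : jacobiSym ((a + q * j : ℕ) : ℤ) (q ^ 3) = legendreSym q a := by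
      rw [jacobiSym_cube, jacobiSym.mod_left, jacobiSym.legendreSym.to_jacobiSym]
      congr 1
      push_cast
      rw [Int.add_mul_emod_self_left]
      exact Int.emod_eq_of_lt (by positivity) (by exact_mod_cast h.1)
    show C ((legendreSym q (a : ℕ) : ℤ) : ℂ) * X ^ a * X ^ (q * j)
      = C ((jacobiSym ((a + q * j : ℕ) : ℤ) (q ^ 3) : ℤ) : ℂ) * X ^ (a + q * j)
    rw [hJ, pow_add, mul_assoc]

theorem card_support_cubeDigits_le (q : ℕ) : (cubeDigits q).support.card ≤ q ^ 2 := by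
  have hsub : (cubeDigits q).support ⊆ (Finset.range (q ^ 2)).image (fun j => q * j) := by
    intro n hn
    rw [mem_support_iff] at hn
    by_contra h
    apply hn
    unfold cubeDigits
    simp only [finsetSum_coeff, coeff_X_pow]
    refine Finset.sum_eq_zero fun j hj => ?_
    rw [if_neg]
    rintro rfl
    exact h (Finset.mem_image.2 ⟨j, hj, rfl⟩)
  exact (Finset.card_le_card hsub).trans (Finset.card_image_le.trans (by simp))

theorem card_support_fekete_le (q : ℕ) [Fact q.Prime] : (fekete q).support.card ≤ q :=
  calc (fekete q).support.card ≤ (Finset.range q).card :=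
        Finset.card_le_card (supp_subset_range (natDegree_fekete_lt q))
    _ = q := Finset.card_range q

/-! ### Non-principal imprimitive characters violate X(δ) at EVERY δ: odd prime powers `q^{2j+1}` -/

/-- `(m | n^{2j+1}) = (m | n)` for the Jacobi symbol. -/
theorem jacobiSym_odd_pow (m n j : ℕ) : jacobiSym m (n ^ (2 * j + 1)) = jacobiSym m n := by
  rw [jacobiSym.pow_right]
  rcases jacobiSym.trichotomy (m : ℤ) n with h | h | h <;> rw [h]
  · exact zero_pow (by omega)
  · exact one_pow _
  · exact Odd.neg_one_pow ⟨j, rfl⟩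

/-- the character digits `∑_{u < q^{e+1}} (u|q) X^u` (`= F_q(X)·Ψ_{q^e}(X^q)` for prime `q`) -/
def charDigits (q e : ℕ) : Polynomial ℂ :=
  ∑ u ∈ Finset.range (q ^ (e + 1)), C ((jacobiSym u q : ℤ) : ℂ) * X ^ u

/-- the top digits `∑_{t < N} X^{q^{e+1} t}` -/
def topDigits (q e N : ℕ) : Polynomial ℂ := ∑ t ∈ Finset.range N, X ^ (q ^ (e + 1) * t)

/-- **Digit splitting of an imprimitive character.** `(∑_{u<q^{e+1}} (u|q) X^u)·(∑_{t<N} X^{q^{e+1}t})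
= ∑_{m < q^{e+1}N} (m|q) X^m`. -/
theorem charDigits_mul_topDigits (q e N : ℕ) (hq : 0 < q) :
    charDigits q e * topDigits q e N =
      ∑ m ∈ Finset.range (q ^ (e + 1) * N), C ((jacobiSym m q : ℤ) : ℂ) * X ^ m := by
  have hQ : 0 < q ^ (e + 1) := pow_pos hq _
  unfold charDigits topDigits
  rw [Finset.sum_mul_sum, ← Finset.sum_product']
  refine Finset.sum_nbij' (fun x => x.1 + q ^ (e + 1) * x.2) (fun m => (m % q ^ (e + 1), m / q ^ (e + 1)))
    ?_ ?_ ?_ ?_ ?_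
  · rintro ⟨u, t⟩ h
    simp only [Finset.mem_product, Finset.mem_range] at h ⊢
    have key : q ^ (e + 1) * t + q ^ (e + 1) ≤ q ^ (e + 1) * N := by
      rw [← Nat.mul_succ]; exact Nat.mul_le_mul_left _ h.2
    omega
  · intro m hm
    simp only [Finset.mem_range, Finset.mem_product] at hm ⊢
    exact ⟨Nat.mod_lt _ hQ, (Nat.div_lt_iff_lt_mul hQ).2 (by rwa [mul_comm] at hm)⟩
  · rintro ⟨u, t⟩ h
    simp only [Finset.mem_product, Finset.mem_range] at h
    show ((u + q ^ (e + 1) * t) % q ^ (e + 1), (u + q ^ (e + 1) * t) / q ^ (e + 1)) = (u, t)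
    rw [Nat.add_mul_mod_self_left, Nat.mod_eq_of_lt h.1, Nat.add_mul_div_left _ _ hQ,
      Nat.div_eq_of_lt h.1, zero_add]
  · intro m _
    exact Nat.mod_add_div m (q ^ (e + 1))
  · rintro ⟨u, t⟩ h
    simp only [Finset.mem_product, Finset.mem_range] at h
    have hJ : jacobiSym ((u + q ^ (e + 1) * t : ℕ) : ℤ) q = jacobiSym (u : ℤ) q := by
      rw [jacobiSym.mod_left, jacobiSym.mod_left (u : ℤ) q]
      congr 1
      push_cast
      rw [show (q : ℤ) ^ (e + 1) * (t : ℤ) = (q : ℤ) * ((q : ℤ) ^ e * t) by ring,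
        Int.add_mul_emod_self_left]
    show C ((jacobiSym (u : ℕ) q : ℤ) : ℂ) * X ^ u * X ^ (q ^ (e + 1) * t)
      = C ((jacobiSym ((u + q ^ (e + 1) * t : ℕ) : ℤ) q : ℤ) : ℂ) * X ^ (u + q ^ (e + 1) * t)
    rw [hJ, mul_assoc, ← pow_add]

/-- `F_{q^{2j+1}} = (∑_{u<q^{j+1}} (u|q) X^u) · (∑_{t<q^j} X^{q^{j+1} t})`. -/
theorem jacobiFekete_odd_pow (q j : ℕ) (hq : 0 < q) :
    jacobiFekete (q ^ (2 * j + 1)) = charDigits q j * topDigits q j (q ^ j) := by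
  rw [charDigits_mul_topDigits q j (q ^ j) hq, ← pow_add, show j + 1 + j = 2 * j + 1 by ring]
  unfold jacobiFekete
  refine Finset.sum_congr rfl fun m _ => ?_
  rw [jacobiSym_odd_pow]

theorem natDegree_charDigits_lt (q e : ℕ) (hq : 0 < q) : (charDigits q e).natDegree < q ^ (e + 1) := by
  have hQ : 0 < q ^ (e + 1) := pow_pos hq _
  unfold charDigits
  refine lt_of_le_of_lt (natDegree_sum_le_of_forall_le _ _ (n := q ^ (e + 1) - 1) fun u hu => ?_) (by omega)
  exact (natDegree_C_mul_X_pow_le _ _).trans (by have := Finset.mem_range.1 hu; omega)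

theorem card_support_charDigits_le (q e : ℕ) (hq : 0 < q) :
    (charDigits q e).support.card ≤ q ^ (e + 1) :=
  calc (charDigits q e).support.card ≤ (Finset.range (q ^ (e + 1))).card :=
        Finset.card_le_card (supp_subset_range (natDegree_charDigits_lt q e hq))
    _ = q ^ (e + 1) := Finset.card_range _

theorem natDegree_topDigits_le (q e N : ℕ) : (topDigits q e N).natDegree ≤ q ^ (e + 1) * N := by
  unfold topDigits
  refine natDegree_sum_le_of_forall_le _ _ fun t ht => ?_
  rw [natDegree_X_pow]
  exact Nat.mul_le_mul_left _ (Finset.mem_range.1 ht).le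

theorem card_support_topDigits_le (q e N : ℕ) : (topDigits q e N).support.card ≤ N := by
  have hsub : (topDigits q e N).support ⊆ (Finset.range N).image (fun t => q ^ (e + 1) * t) := by
    intro n hn
    rw [mem_support_iff] at hn
    by_contra h
    apply hn
    unfold topDigits
    simp only [finsetSum_coeff, coeff_X_pow]
    refine Finset.sum_eq_zero fun t ht => ?_
    rw [if_neg]
    rintro rfl
    exact h (Finset.mem_image.2 ⟨t, ht, rfl⟩)
  exact (Finset.card_le_card hsub).trans (Finset.card_image_le.trans (by simp))

/-- An odd prime has a quadratic non-residue: its character is non-principal. -/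
theorem exists_jacobiSym_eq_neg_one (q : ℕ) [Fact q.Prime] (hq2 : q ≠ 2) :
    ∃ m : ℕ, jacobiSym m q = -1 := by
  have hchar : ringChar (ZMod q) ≠ 2 := by rw [ZMod.ringChar_zmod_n]; exact hq2
  obtain ⟨a, ha⟩ := FiniteField.exists_nonsquare hchar
  refine ⟨a.val, ?_⟩
  rw [← jacobiSym.legendreSym.to_jacobiSym]
  show quadraticChar (ZMod q) (((a.val : ℕ) : ℤ) : ZMod q) = -1
  rw [Int.cast_natCast, ZMod.natCast_zmod_val]
  exact quadraticChar_neg_one_iff_not_isSquare.2 ha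

/-- `HardNonprincipalAt δ`: the δ-slice of X over odd moduli whose Jacobi character is NON-PRINCIPAL
(takes the value `−1`) — between `HardWithoutPrimeAt δ` and `HardAt δ`. -/
def HardNonprincipalAt (δ : ℝ) : Prop :=
  ∃ p₀ : ℕ, ∀ p : ℕ, Odd p → (∃ m : ℕ, jacobiSym m p = -1) → p₀ ≤ p →
    ∀ (s : ℕ) (c : Fin s → ℂ) (g : Fin s → Polynomial ℂ),
    (s : ℝ) ≤ (p : ℝ) ^ δ → (∀ i, (g i).natDegree ≤ p ^ 2) →
    (∑ i, C (c i) * g i ^ 2) = jacobiFekete p → (p : ℝ) ^ (1 / 2 + δ) ≤ ∑ i, ((g i).support.card : ℝ)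

theorem hardNonprincipalAt_of_hardWithoutPrimeAt {δ : ℝ} (h : HardWithoutPrimeAt δ) :
    HardNonprincipalAt δ := by
  obtain ⟨p₀, H⟩ := h
  exact ⟨p₀, fun p hodd _ hp => H p hodd hp⟩

/-- … and it is still a strengthening of X's δ-slice. -/
theorem hardAt_of_hardNonprincipalAt {δ : ℝ} (h : HardNonprincipalAt δ) : HardAt δ := by
  obtain ⟨p₀, H⟩ := h
  refine ⟨max p₀ 3, fun p _ hp s c g hs hdeg hrep => ?_⟩
  have hprime : p.Prime := Fact.out
  have hp3 : 3 ≤ p := le_trans (le_max_right _ _) hp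
  have hodd : Odd p := hprime.odd_of_ne_two (by omega)
  exact H p hodd (exists_jacobiSym_eq_neg_one p (by omega)) (le_trans (le_max_left _ _) hp) s c g hs
    hdeg (hrep.trans (jacobiFekete_prime p).symm)

/-- **Imprimitive non-principal characters are SOS-easy at every δ > 0.** Given `δ`, take `j` with
`2jδ ≥ 1` and a prime `q ≥ 17`; the odd modulus `p = q^{2j+1}` carries the non-principal character `(·|q)`
and `F_p = U·V` with `U = ∑_{u<q^{j+1}} (u|q)X^u`, `V = ∑_{t<q^j} X^{q^{j+1}t}` (`jacobiFekete_odd_pow`), so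
`F_p = ¼(U+V)² − ¼(U−V)²`: `s = 2 ≤ q ≤ p^δ`, degrees `≤ p`, support-sum `≤ 4q^{j+1} < q^{j+1}·q^{1/2}
≤ q^{j+1}·q^{(2j+1)δ−1/2} = p^{1/2+δ}`. -/
theorem not_hardNonprincipalAt {δ : ℝ} (hδ : 0 < δ) : ¬ HardNonprincipalAt δ := by
  rintro ⟨p₀, H⟩
  -- the exponent j with 2jδ ≥ 1
  set j : ℕ := ⌈1 / (2 * δ)⌉₊ with hj
  have h2δ : 0 < 2 * δ := by linarith
  have hjδ : 1 ≤ 2 * (j : ℝ) * δ := by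
    have h1 : 1 / (2 * δ) ≤ (j : ℝ) := Nat.le_ceil _
    calc (1 : ℝ) = (1 / (2 * δ)) * (2 * δ) := by field_simp
      _ ≤ (j : ℝ) * (2 * δ) := mul_le_mul_of_nonneg_right h1 h2δ.le
      _ = 2 * (j : ℝ) * δ := by ring
  -- a prime q ≥ 17
  obtain ⟨q, hq_ge, hq_prime⟩ := Nat.exists_infinite_primes (max p₀ 17)
  haveI : Fact q.Prime := ⟨hq_prime⟩
  have hp₀q : p₀ ≤ q := le_trans (le_max_left _ _) hq_ge
  have h17 : 17 ≤ q := le_trans (le_max_right _ _) hq_ge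
  have hq_pos : (0 : ℝ) < q := by exact_mod_cast hq_prime.pos
  have hq1 : (1 : ℝ) ≤ q := by exact_mod_cast hq_prime.one_lt.le
  have hqpos : 0 < q := hq_prime.pos
  -- the modulus p = q^{2j+1}
  set p : ℕ := q ^ (2 * j + 1) with hp
  have hodd : Odd p := by rw [hp]; exact (hq_prime.odd_of_ne_two (by omega)).pow
  have hnp : ∃ m : ℕ, jacobiSym m p = -1 := by
    obtain ⟨m, hm⟩ := exists_jacobiSym_eq_neg_one q (by omega)
    exact ⟨m, by rw [hp, jacobiSym_odd_pow, hm]⟩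
  have hqp : q ≤ p := by rw [hp]; exact Nat.le_self_pow (by omega) q
  have hp₀' : p₀ ≤ p := hp₀q.trans hqp
  have hcast : (p : ℝ) = (q : ℝ) ^ ((2 * j + 1 : ℕ) : ℝ) := by
    rw [Real.rpow_natCast, hp]; push_cast; ring
  -- the exponent gap B = (2j+1)δ − 1/2 ≥ 1/2
  set B : ℝ := ((2 * j + 1 : ℕ) : ℝ) * δ - 1 / 2 with hBdef
  have hB : (1 : ℝ) / 2 ≤ B := by
    rw [hBdef]; push_cast; nlinarith
  have hsqrt : (4 : ℝ) < (q : ℝ) ^ (1 / 2 : ℝ) := by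
    have hsq : ((q : ℝ) ^ (1 / 2 : ℝ)) ^ (2 : ℕ) = q := by
      rw [← Real.rpow_mul_natCast hq_pos.le]; norm_num
    refine lt_of_pow_lt_pow_left₀ 2 (by positivity) ?_
    rw [hsq]
    have : (17 : ℝ) ≤ q := by exact_mod_cast h17
    linarith
  have hqB : (4 : ℝ) < (q : ℝ) ^ B := hsqrt.trans_le (Real.rpow_le_rpow_of_exponent_le hq1 hB)
  -- (1) two squares are admitted: 2 ≤ q ≤ p^δ
  have hs : ((2 : ℕ) : ℝ) ≤ (p : ℝ) ^ δ := by
    rw [hcast, ← Real.rpow_mul hq_pos.le]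
    have hexp : (1 : ℝ) ≤ ((2 * j + 1 : ℕ) : ℝ) * δ := by push_cast; nlinarith
    calc ((2 : ℕ) : ℝ) ≤ (q : ℝ) := by exact_mod_cast (show 2 ≤ q by omega)
      _ = (q : ℝ) ^ (1 : ℝ) := (Real.rpow_one _).symm
      _ ≤ (q : ℝ) ^ (((2 * j + 1 : ℕ) : ℝ) * δ) := Real.rpow_le_rpow_of_exponent_le hq1 hexp
  -- the representation
  set U := charDigits q j with hU
  set V := topDigits q j (q ^ j) with hV
  have hprod : U * V = jacobiFekete p := by rw [hp, jacobiFekete_odd_pow q j hqpos]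
  have hrep : (∑ i, C ((![(4 : ℂ)⁻¹, -(4 : ℂ)⁻¹]) i) * (![U + V, U - V]) i ^ 2) = jacobiFekete p := by
    simp only [Fin.sum_univ_two, Matrix.cons_val_zero, Matrix.cons_val_one]
    have h4 : (C (4 : ℂ)⁻¹ : Polynomial ℂ) * 4 = 1 := by
      rw [← map_ofNat C 4, ← C_mul, inv_mul_cancel₀ (by norm_num), C_1]
    rw [← hprod]
    have : C (4 : ℂ)⁻¹ * (U + V) ^ 2 + C (-(4 : ℂ)⁻¹) * (U - V) ^ 2 = C (4 : ℂ)⁻¹ * 4 * (U * V) := by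
      rw [map_neg]; ring
    rw [this, h4, one_mul]
  have hdeg : ∀ i : Fin 2, ((![U + V, U - V]) i).natDegree ≤ p ^ 2 := by
    have hU' : U.natDegree ≤ p := by
      have h1 : U.natDegree < q ^ (j + 1) := natDegree_charDigits_lt q j hqpos
      have h2 : q ^ (j + 1) ≤ p := by rw [hp]; exact Nat.pow_le_pow_right hqpos (by omega)
      omega
    have hV' : V.natDegree ≤ p := by
      have h1 : V.natDegree ≤ q ^ (j + 1) * q ^ j := natDegree_topDigits_le q j (q ^ j)
      have h2 : q ^ (j + 1) * q ^ j = p := by rw [hp, ← pow_add]; congr 1; ring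
      omega
    have hpp : p ≤ p ^ 2 := Nat.le_self_pow two_ne_zero p
    have h₁ : (U + V).natDegree ≤ p ^ 2 :=
      (natDegree_add_le _ _).trans (max_le (hU'.trans hpp) (hV'.trans hpp))
    have h₂ : (U - V).natDegree ≤ p ^ 2 :=
      (natDegree_sub_le _ _).trans (max_le (hU'.trans hpp) (hV'.trans hpp))
    intro i
    fin_cases i
    · exact h₁
    · exact h₂
  have key := H p hodd hnp hp₀' 2 (![(4 : ℂ)⁻¹, -(4 : ℂ)⁻¹]) (![U + V, U - V]) hs hdeg hrep
  -- (2) support-sum ≤ 2(q^{j+1} + q^j) ≤ 4 q^{j+1}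
  have hcardU : (U.support.card : ℝ) ≤ (q : ℝ) ^ (j + 1) := by
    exact_mod_cast card_support_charDigits_le q j hqpos
  have hcardV : (V.support.card : ℝ) ≤ (q : ℝ) ^ (j + 1) := by
    have h1 : (V.support.card : ℝ) ≤ (q : ℝ) ^ j := by
      exact_mod_cast card_support_topDigits_le q j (q ^ j)
    have h2 : (q : ℝ) ^ j ≤ (q : ℝ) ^ (j + 1) := pow_le_pow_right₀ hq1 (by omega)
    linarith
  have hUV₁ : (((U + V).support.card : ℕ) : ℝ) ≤ U.support.card + V.support.card := by
    exact_mod_cast (Finset.card_le_card support_add).trans (Finset.card_union_le _ _)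
  have hUV₂ : (((U - V).support.card : ℕ) : ℝ) ≤ U.support.card + V.support.card := by
    have hsub : (U - V).support ⊆ U.support ∪ V.support := by
      rw [sub_eq_add_neg]
      refine support_add.trans ?_
      rw [support_neg]
    exact_mod_cast (Finset.card_le_card hsub).trans (Finset.card_union_le _ _)
  have hsum : (∑ i : Fin 2, ((((![U + V, U - V]) i).support.card : ℝ))) ≤ 4 * (q : ℝ) ^ (j + 1) := by
    simp only [Fin.sum_univ_two, Matrix.cons_val_zero, Matrix.cons_val_one]
    linarith
  -- (3) 4 q^{j+1} < p^{1/2+δ} = q^{j+1} · q^B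
  have hlt : (4 : ℝ) * (q : ℝ) ^ (j + 1) < (p : ℝ) ^ (1 / 2 + δ) := by
    rw [hcast, ← Real.rpow_mul hq_pos.le,
      show ((2 * j + 1 : ℕ) : ℝ) * (1 / 2 + δ) = ((j + 1 : ℕ) : ℝ) + B by rw [hBdef]; push_cast; ring,
      Real.rpow_add hq_pos, Real.rpow_natCast]
    calc (4 : ℝ) * (q : ℝ) ^ (j + 1) = (q : ℝ) ^ (j + 1) * 4 := by ring
      _ < (q : ℝ) ^ (j + 1) * (q : ℝ) ^ B := mul_lt_mul_of_pos_left hqB (by positivity)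
  linarith

/-- Consequently (a second proof of `not_hardWithoutPrimeAt`, through non-principal moduli only). -/
theorem not_hardWithoutPrimeAt' {δ : ℝ} (hδ : 0 < δ) : ¬ HardWithoutPrimeAt δ :=
  fun h => not_hardNonprincipalAt hδ (hardNonprincipalAt_of_hardWithoutPrimeAt h)

/-! ### WLOG unweighted: over `ℂ` the weights `cᵢ` can be absorbed into the squares -/

/-- `HardUnweightedAt δ`: the δ-slice of X for GENUINE sums of squares `F_p = ∑ gᵢ²` (all weights `1`). -/
def HardUnweightedAt (δ : ℝ) : Prop :=
  ∃ p₀ : ℕ, ∀ (p : ℕ) [Fact p.Prime], p₀ ≤ p → ∀ (s : ℕ) (g : Fin s → Polynomial ℂ),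
    (s : ℝ) ≤ (p : ℝ) ^ δ → (∀ i, (g i).natDegree ≤ p ^ 2) →
    (∑ i, g i ^ 2) = fekete p → (p : ℝ) ^ (1 / 2 + δ) ≤ ∑ i, ((g i).support.card : ℝ)

theorem support_C_mul_subset (a : ℂ) (g : Polynomial ℂ) : (C a * g).support ⊆ g.support := by
  intro n hn
  rw [mem_support_iff, coeff_C_mul] at hn
  exact mem_support_iff.2 (right_ne_zero_of_mul hn)

/-- **WLOG unweighted.** `HardAt δ ↔ HardUnweightedAt δ`: `cᵢgᵢ² = (aᵢgᵢ)²` with `aᵢ² = cᵢ` neither enlarges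
supports nor degrees, and conversely weights `1` are weights.  (Service lemma for X's provers.) -/
theorem hardAt_iff_unweighted (δ : ℝ) : HardAt δ ↔ HardUnweightedAt δ := by
  constructor
  · rintro ⟨p₀, H⟩
    refine ⟨p₀, fun p _ hp s g hs hdeg hrep => ?_⟩
    have h := H p hp s (fun _ => 1) g hs hdeg (by simpa using hrep)
    exact h
  · rintro ⟨p₀, H⟩
    refine ⟨p₀, fun p _ hp s c g hs hdeg hrep => ?_⟩
    choose a ha using fun i => IsAlgClosed.exists_eq_mul_self (c i)
    have hrep' : (∑ i, (C (a i) * g i) ^ 2) = fekete p := by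
      rw [← hrep]
      refine Finset.sum_congr rfl fun i _ => ?_
      rw [ha i, C_mul]; ring
    have key := H p hp s (fun i => C (a i) * g i) hs
      (fun i => (natDegree_C_mul_le _ _).trans (hdeg i)) hrep'
    refine key.trans (Finset.sum_le_sum fun i _ => ?_)
    exact_mod_cast Finset.card_le_card (support_C_mul_subset (a i) (g i))

/-! ## Cycle 4 (gen 4): Targets — skeleton `b38bc7f1…` (the lead's re-lined V-half)

Five of the line's stubs are LANDED (`Theorems/FeketeSOSSOSMagnificationStub{Budget,CircuitSumIdentity,
DigitKronecker,OneHotLtCircuit,PolarisedSOS}.lean`); open at this cycle: `stub_legendreCircuit` (C1),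
`stub_vnpAssembly` (C4, now with C1/C2 as explicit hypotheses) and the lead's helper `isVNPFamily_of_levelwise`.
All three are TRUE as typed (finding 20); the helper is proved here verbatim (the lead may copy it). -/

section Targets4

open Literature.Computability.AlgebraicComplexity MvPolynomial

universe u v

/-- **Target `isVNPFamily_of_levelwise` (registered helper stub of the lead, skeleton `b38bc7f1…`): TRUE,
definitional.**  A p-family with, at every level `n`, SOME Boolean-sum witness `gₙ ∈ k[σ n ⊕ Fin rₙ]` whose arity,
complexity and degree are bounded by one p-bounded `B` is p-definable (`IsVNPFamily` = Bürgisser Def. 2.5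
literally): choose the witnesses level-wise, `u := r`; the variable count `#σ n + rₙ`, the degrees and the
complexities of `g` are p-bounded by `IsPBounded.add_holds` / `IsPBounded.mono`.  Same binder shape as the stub. -/
theorem isVNPFamily_of_levelwise {k : Type u} [CommSemiring k] {σ : ℕ → Type v} [∀ n, Fintype (σ n)]
    {f : ∀ n, MvPolynomial (σ n) k} {B : ℕ → ℕ} (hf : IsPFamily f) (hB : IsPBounded B)
    (h : ∀ n, ∃ (r : ℕ) (g : MvPolynomial (σ n ⊕ Fin r) k),
      boolSum g = f n ∧ r ≤ B n ∧ complexity g ≤ B n ∧ g.totalDegree ≤ B n) :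
    IsVNPFamily f := by
  choose r g hg using h
  refine ⟨hf, r, g, ⟨⟨?_, hB.mono fun n => (hg n).2.2.2⟩, hB.mono fun n => (hg n).2.2.1⟩,
    fun n => (hg n).1.symm⟩
  refine (IsPBounded.add_holds hf.1 hB).mono fun n => ?_
  rw [Fintype.card_sum, Fintype.card_fin]
  exact Nat.add_le_add_left (hg n).2.1 _

end Targets4

/-! ## Cycle 4 (gen 4): calibration of X against SÁRKÖZY'S CONJECTURE

`Q_p := ∑_{m<p, (m|p)=1} x^m` (quadratic-residue polynomial).  `F_p = 2Q_p − (x + ⋯ + x^{p−1})` and the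
all-ones polynomial is two digit products, so a sparse splitting `Q_p = A·B` in `ℂ[x]` is a cheap 3-product
(6-square) representation of `F_p`: `feketeSOSHard_false_of_sparseQRSplits` (def-free copy LANDED as
`Theorems/SOSMagnification/Negative/FeketeSarkozyCalibration.lean`, p81779).  Integer Sárközy pairs
`QR_p ∩ [1,p−1] = 𝒜 ⊕ ℬ` are exactly the splittings by indicator polynomials; so X ⇒ balanced integer Sárközy,
weight-robustly (finding 21).  The digit pieces are the SIBLING's `Theorems.FeketeSOSHard.Negative.lowDigits /
highDigits` (`x+⋯+x^a`, `∑_{j<b} x^{aj}`), not this file's cycle-3 `lowDigits`/`highDigits`. -/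

section Sarkozy

open Summit.ValiantsHypothesis.ValiantsHypothesis.Theorems.FeketeSOSHard.Negative
  (ones_digit_identity card_support_lowDigits card_support_highDigits natDegree_lowDigits
   natDegree_highDigits card_support_sum_X_pow_le card_support_X_pow_le feketeSOSHard_false_of_cheapProducts)

/-- The quadratic-residue polynomial `Q_p = ∑_{m<p, (m|p)=1} X^m`. -/
def qrPoly (p : ℕ) [Fact p.Prime] : Polynomial ℂ :=
  ∑ m ∈ (Finset.range p).filter (fun m : ℕ => legendreSym p m = 1), (X : Polynomial ℂ) ^ m

/-- `x + x² + ⋯ + x^{p−1}`. -/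
def onesPoly (p : ℕ) : Polynomial ℂ := ∑ m ∈ Finset.range (p - 1), (X : Polynomial ℂ) ^ (m + 1)

/-- `F_p = 2·Q_p − (x + ⋯ + x^{p-1})`: for `0 < m < p` the Legendre symbol is `±1 = 2·[(m|p)=1] − 1`, `(0|p) = 0`. -/
theorem fekete_eq_two_mul_qrPoly_sub_onesPoly (p : ℕ) [Fact p.Prime] :
    fekete p = 2 * qrPoly p - onesPoly p := by
  have hp : p = (p - 1) + 1 := (Nat.succ_pred_eq_of_pos (Fact.out : p.Prime).pos).symm
  have hones : onesPoly p = ∑ m ∈ Finset.range p, if m = 0 then (0 : Polynomial ℂ) else X ^ m := by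
    unfold onesPoly
    conv_rhs => rw [hp, Finset.sum_range_succ']
    simp
  rw [hones, qrPoly, Finset.sum_filter, Finset.mul_sum, ← Finset.sum_sub_distrib, fekete]
  refine Finset.sum_congr rfl fun m hm => ?_
  rcases Nat.eq_zero_or_pos m with rfl | hm0
  · simp
  · have hmp : m < p := Finset.mem_range.mp hm
    have h0 : ((m : ℤ) : ZMod p) ≠ 0 := by
      rw [Int.cast_natCast, Ne, ZMod.natCast_eq_zero_iff]
      exact Nat.not_dvd_of_pos_of_lt hm0 hmp
    rw [if_neg hm0.ne']
    rcases legendreSym.eq_one_or_neg_one p h0 with h1 | h1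
    · rw [h1, if_pos rfl]; simp; ring
    · rw [h1, if_neg (by decide)]; simp

/-- `Q_p ≠ 0` (it has the term `x`: `(1|p) = 1`). -/
theorem qrPoly_ne_zero (p : ℕ) [Fact p.Prime] : qrPoly p ≠ 0 := by
  intro h
  have h1 : 1 ∈ (Finset.range p).filter (fun m : ℕ => legendreSym p m = 1) := by
    rw [Finset.mem_filter, Finset.mem_range]
    exact ⟨(Fact.out : p.Prime).one_lt, by exact_mod_cast legendreSym.at_one p⟩
  have hc := congrArg (fun q : Polynomial ℂ => q.coeff 1) h
  simp only [qrPoly, finsetSum_coeff, coeff_X_pow, coeff_zero, Finset.sum_ite_eq] at hc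
  rw [if_pos h1] at hc
  exact one_ne_zero hc

/-- `deg Q_p < p`. -/
theorem natDegree_qrPoly_lt (p : ℕ) [Fact p.Prime] : (qrPoly p).natDegree < p := by
  have hp : 0 < p := (Fact.out : p.Prime).pos
  refine lt_of_le_of_lt (natDegree_sum_le_of_forall_le _ _ fun m hm => natDegree_X_pow_le _ |>.trans ?_)
    (Nat.sub_lt hp Nat.one_pos)
  have := Finset.mem_range.mp (Finset.mem_filter.mp hm).1
  omega

/-- **Sárközy calibration (kill criterion via residue splittings).**  If for every `δ > 0` and every `p₀` some
prime `p ≥ p₀` admits a splitting `Q_p = A·B` in `ℂ[x]` with `16(|supp A| + |supp B|) ≤ p^{1/2+δ}`, then X fails: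
`F_p = 2AB − (x+⋯+x^a)(∑_{j<b}x^{aj}) − x^{ab+1}(1+⋯+x^{r−1})` (`p−1 = ab+r`, `a = ⌊√(p−1)⌋`) is three cheap
products, i.e. six weighted squares (`feketeSOSHard_false_of_cheapProducts`, sibling crux).  Instances would be
balanced integer Sárközy pairs; none exist (Kalmynin 2025, Thm 3: `QR_p ≠ 𝒜 + ℬ` with `|𝒜|,|ℬ| > 1` for ALL
primes) — a CALIBRATION of X (X ⊒ balanced integer Sárközy, weight-robustly), and an untested kill path only
through genuinely complex-weighted splittings of `Q_p` — closed at every prime tested (j014020, exhaustive `p ≤ 31`)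
or Galois-certified (j013332, `p ≡ 3 (mod 4)`, `p ≤ 199`): findings 25, 27. -/
theorem feketeSOSHard_false_of_sparseQRSplits
    (h : ∀ δ : ℝ, 0 < δ → ∀ p₀ : ℕ, ∃ (p : ℕ) (_ : Fact p.Prime), p₀ ≤ p ∧ ∃ A B : Polynomial ℂ,
      A * B = qrPoly p ∧ 16 * ((A.support.card : ℝ) + B.support.card) ≤ (p : ℝ) ^ (1 / 2 + δ)) :
    ¬ FeketeSOSHard := by
  apply feketeSOSHard_false_of_cheapProducts
  intro δ hδ p₀
  obtain ⟨p, hp, hp₀, A, B, hAB, hsmall⟩ := h δ hδ (max p₀ (⌈(16 : ℝ) ^ (1 / δ)⌉₊ + 2))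
  have hpprime : p.Prime := hp.out
  refine ⟨p, hp, le_trans (le_max_left _ _) hp₀, ?_⟩
  obtain ⟨N, rfl⟩ : ∃ N, p = N + 1 := ⟨p - 1, (Nat.succ_pred_eq_of_pos hpprime.pos).symm⟩
  set a := Nat.sqrt N with ha
  set b := N / a with hb
  set r := N % a with hr
  have hN1 : 1 ≤ N := by have := hpprime.two_le; omega
  have ha1 : 1 ≤ a := by rw [ha]; exact Nat.le_sqrt.mpr (by simpa using hN1)
  have hNabr : N = a * b + r := by rw [hb, hr]; exact (Nat.div_add_mod N a).symm
  have hra : r < a := by rw [hr]; exact Nat.mod_lt _ ha1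
  have haa : a * a ≤ N := by rw [ha]; exact Nat.sqrt_le N
  have hNlt : N < (a + 1) * (a + 1) := by rw [ha]; exact Nat.lt_succ_sqrt N
  have hb_le : b ≤ a + 2 := by
    rw [hb]
    have : N ≤ a * (a + 2) := by nlinarith
    calc N / a ≤ (a * (a + 2)) / a := Nat.div_le_div_right this
      _ = a + 2 := Nat.mul_div_cancel_left _ ha1
  have hab : a * b ≤ N := hNabr ▸ Nat.le_add_right _ _
  have hrN : r ≤ N := hNabr ▸ Nat.le_add_left _ _
  have haN : a ≤ N := (Nat.le_mul_self a).trans haa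
  have hsq : N + 1 ≤ (N + 1) ^ 2 := Nat.le_self_pow two_ne_zero _
  set T : Polynomial ℂ := ∑ k ∈ Finset.range r, X ^ k with hT
  set M : Polynomial ℂ := X ^ (a * b + 1) with hM
  have hQ0 : qrPoly (N + 1) ≠ 0 := qrPoly_ne_zero (N + 1)
  have hdegQ := natDegree_qrPoly_lt (N + 1)
  have hdegA : A.natDegree ≤ (N + 1) ^ 2 :=
    ((natDegree_le_of_dvd (Dvd.intro _ hAB) hQ0).trans hdegQ.le).trans hsq
  have hdegB : B.natDegree ≤ (N + 1) ^ 2 :=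
    ((natDegree_le_of_dvd (Dvd.intro_left _ hAB) hQ0).trans hdegQ.le).trans hsq
  have hp1 : (1 : ℝ) ≤ ((N + 1 : ℕ) : ℝ) := by exact_mod_cast Nat.succ_le_succ (Nat.zero_le N)
  have hp0 : (0 : ℝ) < ((N + 1 : ℕ) : ℝ) := lt_of_lt_of_le zero_lt_one hp1
  have hceil : (16 : ℝ) ^ (1 / δ) ≤ ((N + 1 : ℕ) : ℝ) := by
    have h1 : (⌈(16 : ℝ) ^ (1 / δ)⌉₊ : ℝ) ≤ ((N + 1 : ℕ) : ℝ) := by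
      have : ⌈(16 : ℝ) ^ (1 / δ)⌉₊ ≤ N + 1 := le_trans (by omega) (le_of_max_le_right hp₀)
      exact_mod_cast this
    exact le_trans (Nat.le_ceil _) h1
  have hpδ : (16 : ℝ) ≤ ((N + 1 : ℕ) : ℝ) ^ δ := by
    have : ((16 : ℝ) ^ (1 / δ)) ^ δ ≤ ((N + 1 : ℕ) : ℝ) ^ δ :=
      Real.rpow_le_rpow (by positivity) hceil hδ.le
    rwa [← Real.rpow_mul (by norm_num), one_div_mul_cancel hδ.ne', Real.rpow_one] at this
  refine ⟨3, ![C 2 * A, -Theorems.FeketeSOSHard.Negative.lowDigits a, -M],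
    ![B, Theorems.FeketeSOSHard.Negative.highDigits a b, T], ?_, ?_, ?_, ?_, ?_⟩
  · calc ((3 + 3 : ℕ) : ℝ) = 6 := by norm_num
      _ ≤ 16 := by norm_num
      _ ≤ _ := hpδ
  · intro l
    fin_cases l
    · exact (natDegree_C_mul_le _ _).trans hdegA
    · show (-Theorems.FeketeSOSHard.Negative.lowDigits a).natDegree ≤ (N + 1) ^ 2
      rw [natDegree_neg]; exact (natDegree_lowDigits a).trans (by omega)
    · show (-M).natDegree ≤ (N + 1) ^ 2
      rw [natDegree_neg, hM]; exact (natDegree_X_pow_le _).trans (by nlinarith)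
  · intro l
    fin_cases l
    · exact hdegB
    · show (Theorems.FeketeSOSHard.Negative.highDigits a b).natDegree ≤ (N + 1) ^ 2
      exact (natDegree_highDigits a b).trans (by nlinarith)
    · show T.natDegree ≤ (N + 1) ^ 2
      rw [hT]
      exact natDegree_sum_le_of_forall_le _ _ fun k hk => (natDegree_X_pow_le _).trans (by
        have := Finset.mem_range.mp hk; omega)
  · rw [Fin.sum_univ_three]
    simp only [Matrix.cons_val_zero, Matrix.cons_val_one, Matrix.cons_val_two, Matrix.head_cons,
      Matrix.tail_cons]
    rw [← fekete, fekete_eq_two_mul_qrPoly_sub_onesPoly, ← hAB, onesPoly, show N + 1 - 1 = N from rfl]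
    conv_rhs => rw [hNabr, ones_digit_identity, ← hM, ← hT]
    rw [map_ofNat]
    ring
  · have hsplit : ((N + 1 : ℕ) : ℝ) ^ (1 / 2 + δ) = Real.sqrt ((N + 1 : ℕ) : ℝ) * ((N + 1 : ℕ) : ℝ) ^ δ := by
      rw [Real.rpow_add hp0, ← Real.sqrt_eq_rpow]
    have hCA : ((C (2 : ℂ) * A).support.card : ℝ) ≤ A.support.card := by
      exact_mod_cast Finset.card_le_card (support_C_mul_subset (2 : ℂ) A)
    have hl : ((-Theorems.FeketeSOSHard.Negative.lowDigits a).support.card : ℝ) ≤ a := by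
      rw [support_neg]; exact_mod_cast card_support_lowDigits a
    have hh : ((Theorems.FeketeSOSHard.Negative.highDigits a b).support.card : ℝ) ≤ b := by
      exact_mod_cast card_support_highDigits a b
    have hMc : ((-M).support.card : ℝ) ≤ 1 := by
      rw [support_neg, hM]; exact_mod_cast card_support_X_pow_le _
    have hTc : (T.support.card : ℝ) ≤ r := by
      have : T.support.card ≤ r := by
        rw [hT]; exact (card_support_sum_X_pow_le (Finset.range r) id).trans (by simp)
      exact_mod_cast this
    have hb' : (b : ℝ) ≤ a + 2 := by exact_mod_cast hb_le
    have hr' : (r : ℝ) + 1 ≤ a := by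
      have : r + 1 ≤ a := hra
      exact_mod_cast this
    have hsqrt : (a : ℝ) ≤ Real.sqrt ((N + 1 : ℕ) : ℝ) := by
      rw [← Real.sqrt_sq (Nat.cast_nonneg a)]
      apply Real.sqrt_le_sqrt
      have : ((a * a : ℕ) : ℝ) ≤ ((N + 1 : ℕ) : ℝ) := by exact_mod_cast haa.trans (Nat.le_succ N)
      push_cast at this ⊢; nlinarith
    have hsqrt1 : (1 : ℝ) ≤ Real.sqrt ((N + 1 : ℕ) : ℝ) := by
      rw [← Real.sqrt_one]; exact Real.sqrt_le_sqrt hp1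
    rw [Fin.sum_univ_three]
    simp only [Matrix.cons_val_zero, Matrix.cons_val_one, Matrix.cons_val_two, Matrix.head_cons,
      Matrix.tail_cons]
    rw [hsplit] at hsmall ⊢
    set sq := Real.sqrt ((N + 1 : ℕ) : ℝ) with hsqdef
    set pδ := ((N + 1 : ℕ) : ℝ) ^ δ with hpδdef
    have h1 : 2 * ((((-Theorems.FeketeSOSHard.Negative.lowDigits a).support.card : ℝ) +
        (Theorems.FeketeSOSHard.Negative.highDigits a b).support.card) +
        (((-M).support.card : ℝ) + T.support.card)) ≤ 10 * sq := by linarith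
    have h2 : 16 * sq ≤ sq * pδ := by nlinarith
    nlinarith

/-- … in particular sparse INDICATOR splittings (integer Sárközy pairs `𝒜 ⊕ ℬ = QR_p ∩ [1,p−1]` for infinitely
many `p` with `|𝒜| + |ℬ| ≤ p^{1/2+δ}/16`) would kill X; contrapositively X proves their non-existence for all
large `p` — the balanced integer case of Sárközy's conjecture. -/
theorem feketeSOSHard_false_of_sarkozyPairs
    (h : ∀ δ : ℝ, 0 < δ → ∀ p₀ : ℕ, ∃ (p : ℕ) (_ : Fact p.Prime), p₀ ≤ p ∧ ∃ 𝒜 ℬ : Finset ℕ,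
      (∑ a ∈ 𝒜, (X : Polynomial ℂ) ^ a) * (∑ b ∈ ℬ, (X : Polynomial ℂ) ^ b) = qrPoly p ∧
      16 * ((𝒜.card : ℝ) + ℬ.card) ≤ (p : ℝ) ^ (1 / 2 + δ)) :
    ¬ FeketeSOSHard := by
  refine feketeSOSHard_false_of_sparseQRSplits fun δ hδ p₀ => ?_
  obtain ⟨p, hp, hp₀, 𝒜, ℬ, hAB, hsmall⟩ := h δ hδ p₀
  refine ⟨p, hp, hp₀, _, _, hAB, le_trans ?_ hsmall⟩
  have hA : ((∑ a ∈ 𝒜, (X : Polynomial ℂ) ^ a).support.card : ℝ) ≤ 𝒜.card := by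
    exact_mod_cast card_support_sum_X_pow_le 𝒜 id
  have hB : ((∑ b ∈ ℬ, (X : Polynomial ℂ) ^ b).support.card : ℝ) ≤ ℬ.card := by
    exact_mod_cast card_support_sum_X_pow_le ℬ id
  linarith

end Sarkozy

/-! ## Cycle 4 (gen 4): the homogeneity lemma — Galois genericity forbids sparse splittings (finding 27)

If field automorphisms act on a finite set `T` of "roots" transitively on `k`-subsets for every `k` (as a
Galois group `⊇ A_d` does), then no proper sub-product `∏_{α∈S}(X − α)` has a vanishing coefficient: every
complex splitting of such a polynomial is maximally dense.  Sparse splittings (cycle 3's prime powers, the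
`(x∓1)`-peelings of `F_p`) are Galois DEGENERACIES. -/

section Homogeneity

open Finset

variable {L : Type*} [Field L] [DecidableEq L]

omit [DecidableEq L] in
/-- `e_{j+1}(a ∷ s) = e_{j+1}(s) + a·e_j(s)`. -/
theorem esymm_cons_succ' (a : L) (s : Multiset L) (j : ℕ) :
    (a ::ₘ s).esymm (j + 1) = s.esymm (j + 1) + a * s.esymm j := by
  simp only [Multiset.esymm, Multiset.powersetCard_cons, Multiset.map_add, Multiset.sum_add,
    Multiset.map_map, Function.comp_def, Multiset.prod_cons]
  congr 1
  rw [Multiset.sum_map_mul_left]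

omit [DecidableEq L] in
/-- `e_0(s) = 1`. -/
theorem esymm_zero' (s : Multiset L) : s.esymm 0 = 1 := by
  simp [Multiset.esymm, Multiset.powersetCard_zero_left]

/-- `VanishOn T j k`: the `j`-th elementary symmetric function vanishes on EVERY `k`-subset of `T`. -/
def VanishOn (T : Finset L) (j k : ℕ) : Prop := ∀ S ⊆ T, S.card = k → S.val.esymm j = 0

/-- The difference trick: `e_{j+1}` vanishing on all `(k+1)`-subsets forces `e_j` to vanish on all
`k`-subsets, as long as two fresh elements are available (`k + 1 < |T|`). -/
theorem vanishOn_step {T : Finset L} {j k : ℕ} (hk : k + 1 < T.card) (h : VanishOn T (j + 1) (k + 1)) :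
    VanishOn T j k := by
  intro R hR hRk
  have hcard : 1 < (T \ R).card := by rw [card_sdiff_of_subset hR]; omega
  obtain ⟨a, ha, b, hb, hab⟩ := Finset.one_lt_card.mp hcard
  rw [mem_sdiff] at ha hb
  have key : ∀ c ∈ T, c ∉ R → R.val.esymm (j + 1) + c * R.val.esymm j = 0 := by
    intro c hcT hcR
    have h1 := h (insert c R) (insert_subset hcT hR) (by rw [card_insert_of_notMem hcR, hRk])
    rwa [insert_val_of_notMem hcR, esymm_cons_succ'] at h1
  have e1 := key a ha.1 ha.2
  have e2 := key b hb.1 hb.2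
  have : (a - b) * R.val.esymm j = 0 := by linear_combination e1 - e2
  rcases mul_eq_zero.mp this with h0 | h0
  · exact absurd (sub_eq_zero.mp h0) hab
  · exact h0

/-- Descending `j` times. -/
theorem vanishOn_descend {T : Finset L} :
    ∀ (j k : ℕ), j ≤ k → k < T.card → VanishOn T j k → VanishOn T 0 (k - j)
  | 0, k, _, _, h => by simpa using h
  | j + 1, k, hjk, hk, h => by
    obtain ⟨k', rfl⟩ : ∃ k', k = k' + 1 := ⟨k - 1, by omega⟩
    have h' := vanishOn_descend j k' (by omega) (by omega) (vanishOn_step hk h)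
    simpa [Nat.succ_sub_succ] using h'

/-- **No elementary symmetric function can vanish on ALL `k`-subsets** (`1 ≤ j ≤ k < |T|`). -/
theorem not_vanishOn {T : Finset L} {j k : ℕ} (hj : 1 ≤ j) (hjk : j ≤ k) (hk : k < T.card) :
    ¬ VanishOn T j k := by
  intro h
  have h0 := vanishOn_descend j k hjk hk h
  obtain ⟨S, hS, hSc⟩ := Finset.exists_subset_card_eq (show k - j ≤ T.card by omega)
  have := h0 S hS hSc
  rw [esymm_zero'] at this
  exact one_ne_zero this

omit [DecidableEq L] in
/-- Ring automorphisms transport elementary symmetric functions. -/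
theorem esymm_map_ringEquiv (σ : L ≃+* L) (s : Multiset L) (j : ℕ) :
    (s.map σ).esymm j = σ (s.esymm j) := by
  simp only [Multiset.esymm, Multiset.powersetCard_map, Multiset.map_map, Function.comp_def,
    map_multiset_sum, map_multiset_prod]

/-- **Homogeneity lemma (finding 27).**  If a set of field automorphisms acts on the finite set `T ⊂ L`
homogeneously on `k`-subsets for every `k` (as `Gal(P) ⊇ A_d` does on the roots of `P`), then for every
proper nonempty subset `S ⊂ T` ALL elementary symmetric functions `e_1(S), …, e_{|S|}(S)` are nonzero. -/
theorem esymm_ne_zero_of_homogeneous {T : Finset L}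
    (hhom : ∀ S S' : Finset L, S ⊆ T → S' ⊆ T → S.card = S'.card → ∃ σ : L ≃+* L, S.image σ = S')
    {S : Finset L} (hS : S ⊆ T) (hSlt : S.card < T.card) {j : ℕ} (hj : 1 ≤ j) (hjS : j ≤ S.card) :
    S.val.esymm j ≠ 0 := by
  intro h0
  refine not_vanishOn hj hjS hSlt fun S' hS' hc => ?_
  obtain ⟨σ, hσ⟩ := hhom S S' hS hS' hc.symm
  have hval : S'.val = S.val.map σ := by
    rw [← hσ, Finset.image_val_of_injOn (σ.injective.injOn)]
  rw [hval, esymm_map_ringEquiv, h0, map_zero]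

/-- … hence the monic polynomial `∏_{α ∈ S} (X − α)` with roots a proper nonempty homogeneous subset has
NO vanishing coefficient: all `|S| + 1` coefficients are nonzero (Vieta), i.e. it is as dense as possible. -/
theorem coeff_prod_X_sub_C_ne_zero_of_homogeneous {T : Finset L}
    (hhom : ∀ S S' : Finset L, S ⊆ T → S' ⊆ T → S.card = S'.card → ∃ σ : L ≃+* L, S.image σ = S')
    {S : Finset L} (hS : S ⊆ T) (hSlt : S.card < T.card) {m : ℕ} (hm : m ≤ S.card) :
    ((S.val.map fun r => X - C r).prod).coeff m ≠ 0 := by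
  have hcard : Multiset.card S.val = S.card := rfl
  rw [Multiset.prod_X_sub_C_coeff S.val (by rw [hcard]; exact hm), hcard]
  refine mul_ne_zero (pow_ne_zero _ (neg_ne_zero.mpr one_ne_zero)) ?_
  rcases Nat.eq_or_lt_of_le hm with rfl | hlt
  · rw [Nat.sub_self, esymm_zero']; exact one_ne_zero
  · exact esymm_ne_zero_of_homogeneous hhom hS hSlt (by omega) (Nat.sub_le _ _)

/-- … so such a factor has exactly `|S| + 1` terms. -/
theorem card_support_prod_X_sub_C_of_homogeneous {T : Finset L}
    (hhom : ∀ S S' : Finset L, S ⊆ T → S' ⊆ T → S.card = S'.card → ∃ σ : L ≃+* L, S.image σ = S')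
    {S : Finset L} (hS : S ⊆ T) (hSlt : S.card < T.card) :
    ((S.val.map fun r => X - C r).prod).support.card = S.card + 1 := by
  set P := (S.val.map fun r => X - C r).prod with hP
  have hdeg : P.natDegree = S.card := by
    rw [hP, natDegree_multiset_prod_X_sub_C_eq_card]; rfl
  apply le_antisymm
  · calc P.support.card ≤ P.natDegree + 1 := card_supp_le_succ_natDegree P
      _ = S.card + 1 := by rw [hdeg]
  · have hsub : range (S.card + 1) ⊆ P.support := by
      intro m hm
      rw [mem_support_iff]
      exact coeff_prod_X_sub_C_ne_zero_of_homogeneous hhom hS hSlt (Nat.lt_succ_iff.mp (mem_range.mp hm))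
    simpa using card_le_card hsub

end Homogeneity

/-! ## Cycle 4 (gen 4): the cyclic form of X dies at every squarefree composite conductor (finding 22)

CRT: for coprime `q, r`, `A·B ≡ F_{qr} (mod X^{qr} − 1)` with `A = ∑_{k<q} (rk|q)X^{rk}` (`≤ q` terms) and
`B = ∑_{l<r} (ql|r)X^{ql}` (`≤ r` terms) — def-bearing copy LANDED as
`Theorems/SOSMagnification/Negative/FeketeCyclicCompositeModuli.lean` (p81831). -/

section CRT

open Finset

/-- CRT factor living on the subgroup `rℤ/qr`: `A = ∑_{k<q} (rk | q) X^{rk}`. -/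
def crtA (q r : ℕ) : Polynomial ℂ := ∑ k ∈ range q, C ((jacobiSym (r * k : ℕ) q : ℤ) : ℂ) * X ^ (r * k)

/-- CRT factor living on the subgroup `qℤ/qr`: `B = ∑_{l<r} (ql | r) X^{ql}`. -/
def crtB (q r : ℕ) : Polynomial ℂ := ∑ l ∈ range r, C ((jacobiSym (q * l : ℕ) r : ℤ) : ℂ) * X ^ (q * l)

/-- The CRT exponent map `(k, l) ↦ (rk + ql) mod qr`. -/
def crtρ (q r : ℕ) (x : ℕ × ℕ) : ℕ := (r * x.1 + q * x.2) % (q * r)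

/-- coefficient attached to the pair `(k, l)` -/
def crtCoef (q r : ℕ) (x : ℕ × ℕ) : ℂ :=
  ((jacobiSym (r * x.1 : ℕ) q : ℤ) : ℂ) * ((jacobiSym (q * x.2 : ℕ) r : ℤ) : ℂ)

/-- The wrap-around correction `W = ∑_{rk+ql ≥ qr} (rk|q)(ql|r) X^{rk+ql−qr}`. -/
def crtW (q r : ℕ) : Polynomial ℂ :=
  ∑ x ∈ range q ×ˢ range r, if q * r ≤ r * x.1 + q * x.2 then C (crtCoef q r x) * X ^ crtρ q r x else 0

/-- one monomial: `X^{rk+ql} = X^{ρ} + (X^{qr} − 1)·[wrap]·X^{ρ}` (the exponent wraps at most once). -/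
theorem crt_monomial {q r : ℕ} (hq : 0 < q) (hr : 0 < r) (x : ℕ × ℕ) (hx : x ∈ range q ×ˢ range r) :
    (X : Polynomial ℂ) ^ (r * x.1 + q * x.2) =
      X ^ crtρ q r x + (X ^ (q * r) - 1) * (if q * r ≤ r * x.1 + q * x.2 then X ^ crtρ q r x else 0) := by
  rw [mem_product, mem_range, mem_range] at hx
  have h1 : r * x.1 ≤ r * (q - 1) := Nat.mul_le_mul_left r (by omega)
  have h2 : q * x.2 ≤ q * (r - 1) := Nat.mul_le_mul_left q (by omega)
  have hlt : r * x.1 + q * x.2 < 2 * (q * r) := by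
    have e1 : r * (q - 1) + r = r * q := by
      rw [← Nat.mul_succ, Nat.succ_eq_add_one, Nat.sub_add_cancel hq]
    have e2 : q * (r - 1) + q = q * r := by
      rw [← Nat.mul_succ, Nat.succ_eq_add_one, Nat.sub_add_cancel hr]
    nlinarith
  unfold crtρ
  by_cases hw : q * r ≤ r * x.1 + q * x.2
  · rw [if_pos hw]
    have hmod : (r * x.1 + q * x.2) % (q * r) = r * x.1 + q * x.2 - q * r := by
      rw [Nat.mod_eq_sub_mod hw, Nat.mod_eq_of_lt (by omega)]
    rw [hmod]
    have : r * x.1 + q * x.2 = (r * x.1 + q * x.2 - q * r) + q * r := by omega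
    conv_lhs => rw [this, pow_add]
    ring
  · rw [if_neg hw, Nat.mod_eq_of_lt (by omega)]
    ring

/-- `A·B = ∑_{(k,l)} coef · X^{rk+ql}` -/
theorem crtA_mul_crtB_expand (q r : ℕ) :
    crtA q r * crtB q r = ∑ x ∈ range q ×ˢ range r, C (crtCoef q r x) * X ^ (r * x.1 + q * x.2) := by
  unfold crtA crtB crtCoef
  rw [sum_mul_sum, sum_product]
  refine sum_congr rfl fun k _ => sum_congr rfl fun l _ => ?_
  rw [C_mul, pow_add]; ring

/-- The CRT map is injective on `[0,q) × [0,r)` for coprime `q, r`. -/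
theorem crtρ_injOn {q r : ℕ} (hcop : Nat.Coprime q r) :
    Set.InjOn (crtρ q r) (range q ×ˢ range r : Finset (ℕ × ℕ)) := by
  intro x hx y hy hxy
  simp only [coe_product, coe_range, Set.mem_prod, Set.mem_Iio] at hx hy
  unfold crtρ at hxy
  have hmod : r * x.1 + q * x.2 ≡ r * y.1 + q * y.2 [MOD q * r] := hxy
  -- reduce mod q : r x.1 ≡ r y.1
  have hq' : r * x.1 ≡ r * y.1 [MOD q] := by
    have h := (Nat.ModEq.of_mul_right r hmod)
    -- h : r*x.1 + q*x.2 ≡ r*y.1 + q*y.2 [MOD q]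
    have e1 : r * x.1 + q * x.2 ≡ r * x.1 [MOD q] := Nat.add_mul_mod_self_left _ _ _
    have e2 : r * y.1 + q * y.2 ≡ r * y.1 [MOD q] := Nat.add_mul_mod_self_left _ _ _
    exact (e1.symm.trans h).trans e2
  have hk : x.1 ≡ y.1 [MOD q] := Nat.ModEq.cancel_left_of_coprime (by simpa [Nat.coprime_comm] using hcop) hq'
  have hk' : x.1 = y.1 := Nat.ModEq.eq_of_lt_of_lt hk hx.1 hy.1
  -- reduce mod r : q x.2 ≡ q y.2
  have hr' : q * x.2 ≡ q * y.2 [MOD r] := by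
    have h := (Nat.ModEq.of_mul_left q hmod)
    have e1 : r * x.1 + q * x.2 ≡ q * x.2 [MOD r] := by
      show (r * x.1 + q * x.2) % r = (q * x.2) % r
      rw [add_comm]; exact Nat.add_mul_mod_self_left _ _ _
    have e2 : r * y.1 + q * y.2 ≡ q * y.2 [MOD r] := by
      show (r * y.1 + q * y.2) % r = (q * y.2) % r
      rw [add_comm]; exact Nat.add_mul_mod_self_left _ _ _
    exact (e1.symm.trans h).trans e2
  have hl : x.2 ≡ y.2 [MOD r] := Nat.ModEq.cancel_left_of_coprime (by simpa using hcop.symm) hr'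
  have hl' : x.2 = y.2 := Nat.ModEq.eq_of_lt_of_lt hl hx.2 hy.2
  exact Prod.ext hk' hl'

/-- The coefficient at `(k,l)` is the Jacobi symbol of the CRT image: `(rk|q)(ql|r) = (ρ(k,l) | qr)`. -/
theorem crtCoef_eq {q r : ℕ} [NeZero q] [NeZero r] (x : ℕ × ℕ) :
    crtCoef q r x = ((jacobiSym (crtρ q r x : ℕ) (q * r) : ℤ) : ℂ) := by
  unfold crtCoef crtρ
  rw [← Int.cast_mul]
  congr 1
  rw [jacobiSym.mul_right]
  congr 1
  · rw [jacobiSym.mod_left ((((r * x.1 + q * x.2) % (q * r) : ℕ) : ℤ)) q,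
      jacobiSym.mod_left (((r * x.1 : ℕ)) : ℤ) q]
    congr 1
    push_cast
    rw [Int.emod_emod_of_dvd _ (dvd_mul_right (q : ℤ) r), Int.add_mul_emod_self_left]
  · rw [jacobiSym.mod_left ((((r * x.1 + q * x.2) % (q * r) : ℕ) : ℤ)) r,
      jacobiSym.mod_left (((q * x.2 : ℕ)) : ℤ) r]
    congr 1
    push_cast
    rw [Int.emod_emod_of_dvd _ (dvd_mul_left (r : ℤ) q), add_comm, Int.add_mul_emod_self_left]

/-- **CRT identity.**  For coprime `q, r ≥ 1`:  `A·B = F_{qr} + (X^{qr} − 1)·W` — cyclically, the Jacobi–Fekete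
polynomial of a squarefree composite modulus SPLITS into two polynomials with `≤ q` and `≤ r` terms. -/
theorem crtA_mul_crtB {q r : ℕ} (hq : 0 < q) (hr : 0 < r) (hcop : Nat.Coprime q r) :
    crtA q r * crtB q r = jacobiFekete (q * r) + (X ^ (q * r) - 1) * crtW q r := by
  haveI : NeZero q := ⟨hq.ne'⟩
  haveI : NeZero r := ⟨hr.ne'⟩
  rw [crtA_mul_crtB_expand]
  have step1 : (∑ x ∈ range q ×ˢ range r, C (crtCoef q r x) * (X : Polynomial ℂ) ^ (r * x.1 + q * x.2)) =
      (∑ x ∈ range q ×ˢ range r, C (crtCoef q r x) * X ^ crtρ q r x) + (X ^ (q * r) - 1) * crtW q r := by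
    unfold crtW
    rw [mul_sum, ← sum_add_distrib]
    refine sum_congr rfl fun x hx => ?_
    rw [crt_monomial hq hr x hx]
    split_ifs <;> ring
  rw [step1]
  congr 1
  -- reindex along the CRT bijection
  unfold jacobiFekete
  have hsurj : Set.SurjOn (crtρ q r) (range q ×ˢ range r : Finset (ℕ × ℕ)) (range (q * r) : Finset ℕ) := by
    have hmem : ∀ a ∈ range q ×ˢ range r, crtρ q r a ∈ range (q * r) := fun a _ =>
      mem_range.mpr (Nat.mod_lt _ (Nat.mul_pos hq hr))
    intro m hm
    have := surj_on_of_inj_on_of_card_le (s := range q ×ˢ range r) (t := range (q * r))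
      (fun a _ => crtρ q r a) hmem
      (fun a₁ a₂ h₁ h₂ h => crtρ_injOn hcop (mem_coe.mpr h₁) (mem_coe.mpr h₂) h)
      (by rw [card_product, card_range, card_range, card_range]) m hm
    obtain ⟨a, ha, rfl⟩ := this
    exact ⟨a, ha, rfl⟩
  refine sum_nbij (crtρ q r) (fun a _ => mem_range.mpr (Nat.mod_lt _ (Nat.mul_pos hq hr)))
    (crtρ_injOn hcop) hsurj fun x _ => ?_
  rw [crtCoef_eq]

/-- a sum of `|s|` weighted monomials has at most `|s|` terms -/
theorem card_support_sum_C_mul_X_pow_le' {ι : Type*} (s : Finset ι) (a : ι → ℂ) (e : ι → ℕ) :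
    (∑ i ∈ s, C (a i) * X ^ (e i)).support.card ≤ s.card := by
  classical
  induction s using Finset.induction_on with
  | empty => simp
  | @insert i s hi ih =>
    rw [sum_insert hi, card_insert_of_notMem hi]
    have h1 := card_le_card (support_add (p := C (a i) * X ^ e i) (q := ∑ j ∈ s, C (a j) * X ^ e j))
    have h2 := card_union_le (C (a i) * X ^ e i).support (∑ j ∈ s, C (a j) * X ^ e j).support
    have h3 : (C (a i) * X ^ e i).support.card ≤ 1 := card_support_C_mul_X_pow_le_one
    omega

/-- `A` has at most `q` terms. -/
theorem card_support_crtA_le (q r : ℕ) : (crtA q r).support.card ≤ q := by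
  have h := card_support_sum_C_mul_X_pow_le' (range q) (fun k => ((jacobiSym (r * k : ℕ) q : ℤ) : ℂ))
    (fun k => r * k)
  rw [card_range] at h
  exact h

/-- `B` has at most `r` terms. -/
theorem card_support_crtB_le (q r : ℕ) : (crtB q r).support.card ≤ r := by
  have h := card_support_sum_C_mul_X_pow_le' (range r) (fun l => ((jacobiSym (q * l : ℕ) r : ℤ) : ℂ))
    (fun l => q * l)
  rw [card_range] at h
  exact h

/-- `deg A < qr`. -/
theorem natDegree_crtA_lt {q r : ℕ} (hq : 0 < q) (hr : 0 < r) : (crtA q r).natDegree < q * r := by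
  unfold crtA
  refine lt_of_le_of_lt (natDegree_sum_le_of_forall_le _ _ (n := r * (q - 1)) fun k hk => ?_) ?_
  · exact (natDegree_C_mul_X_pow_le _ _).trans (Nat.mul_le_mul_left r (by have := mem_range.mp hk; omega))
  · have : r * (q - 1) + r = q * r := by
      rw [← Nat.mul_succ, Nat.succ_eq_add_one, Nat.sub_add_cancel hq, mul_comm]
    omega

/-- `deg B < qr`. -/
theorem natDegree_crtB_lt {q r : ℕ} (hq : 0 < q) (hr : 0 < r) : (crtB q r).natDegree < q * r := by
  unfold crtB
  refine lt_of_le_of_lt (natDegree_sum_le_of_forall_le _ _ (n := q * (r - 1)) fun l hl => ?_) ?_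
  · exact (natDegree_C_mul_X_pow_le _ _).trans (Nat.mul_le_mul_left q (by have := mem_range.mp hl; omega))
  · have : q * (r - 1) + q = q * r := by
      rw [← Nat.mul_succ, Nat.succ_eq_add_one, Nat.sub_add_cancel hr]
    omega

/-- support of a sum / difference -/
theorem card_support_add_le' (P Q : Polynomial ℂ) :
    (P + Q).support.card ≤ P.support.card + Q.support.card :=
  (card_le_card support_add).trans (card_union_le _ _)

/-- support of a difference -/
theorem card_support_sub_le' (P Q : Polynomial ℂ) :
    (P - Q).support.card ≤ P.support.card + Q.support.card := by
  rw [sub_eq_add_neg, ← support_neg (p := Q)]; exact card_support_add_le' P (-Q)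

/-- `CyclicSliceSquarefreeAt δ` — the CYCLIC form of X's δ-slice over odd squarefree moduli `n` (Jacobi symbol;
these are exactly the moduli whose quadratic character is PRIMITIVE of conductor `n`; at primes it is the
planner's "cleaner cyclic form `Σ cᵢ ĝᵢ² = G·χ` on `ℤ/p`" of item 3996): every representation
`Σ cᵢ gᵢ² = F_n + (X^n − 1)·R` with `s ≤ n^δ` squares of degree `< n` has support-sum `≥ n^{1/2+δ}`. -/
def CyclicSliceSquarefreeAt (δ : ℝ) : Prop :=
  ∃ n₀ : ℕ, ∀ n : ℕ, n₀ ≤ n → Odd n → Squarefree n →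
    ∀ (s : ℕ) (c : Fin s → ℂ) (g : Fin s → Polynomial ℂ) (R : Polynomial ℂ), (s : ℝ) ≤ (n : ℝ) ^ δ →
      (∀ i, (g i).natDegree < n) →
      (∑ i, C (c i) * g i ^ 2) = jacobiFekete n + (X ^ n - 1) * R →
      (n : ℝ) ^ (1 / 2 + δ) ≤ ∑ i, ((g i).support.card : ℝ)

/-- **The cyclic form of X fails at every scale on squarefree composite (primitive!) conductors.**
Witness: `n = q·r` with `q` a large prime and `r` its Bertrand prime (`q < r < 2q`): by `crtA_mul_crtB`,
`¼(A+B)² − ¼(A−B)² = A·B ≡ F_n (mod X^n − 1)` with support-sum `≤ 2(q + r) < 6q ≤ 6√n ≤ n^{1/2+δ}`. -/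
theorem not_cyclicSliceSquarefreeAt {δ : ℝ} (hδ : 0 < δ) : ¬ CyclicSliceSquarefreeAt δ := by
  rintro ⟨n₀, H⟩
  obtain ⟨q, hq_ge, hqprime⟩ := Nat.exists_infinite_primes (max (max n₀ 3) (⌈(6 : ℝ) ^ (1 / δ)⌉₊ + 1))
  obtain ⟨r, hrprime, hqr, hr2q⟩ := Nat.exists_prime_lt_and_le_two_mul q hqprime.ne_zero
  have hq3 : 3 ≤ q := le_trans (le_max_right _ _) (le_trans (le_max_left _ _) hq_ge)
  have hq0 : 0 < q := by omega
  have hr0 : 0 < r := by omega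
  have hqodd : Odd q := hqprime.odd_of_ne_two (by omega)
  have hrodd : Odd r := hrprime.odd_of_ne_two (by omega)
  have hrlt : r < 2 * q := by
    rcases Nat.lt_or_ge r (2 * q) with h | h
    · exact h
    · exfalso
      have : r = 2 * q := le_antisymm hr2q h
      exact (Nat.not_even_iff_odd.mpr hrodd) ⟨q, by omega⟩
  have hcop : Nat.Coprime q r := (Nat.coprime_primes hqprime hrprime).mpr (by omega)
  set n := q * r with hn
  have hn0 : 0 < n := Nat.mul_pos hq0 hr0
  have hnodd : Odd n := Nat.odd_mul.mpr ⟨hqodd, hrodd⟩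
  have hnsq : Squarefree n :=
    (Nat.squarefree_mul hcop).mpr ⟨hqprime.prime.squarefree, hrprime.prime.squarefree⟩
  have hn₀ : n₀ ≤ n := by
    have : n₀ ≤ q := le_trans (le_max_left _ _) (le_trans (le_max_left _ _) hq_ge)
    exact this.trans (Nat.le_mul_of_pos_right q hr0)
  -- the two squares
  set A := crtA q r with hA
  set B := crtB q r with hB
  have h4 : (C (4 : ℂ)⁻¹ : Polynomial ℂ) * 4 = 1 := by
    rw [← map_ofNat C 4, ← C_mul, inv_mul_cancel₀ (by norm_num), C_1]
  have hrep : (∑ i, C ((![(4 : ℂ)⁻¹, -(4 : ℂ)⁻¹]) i) * (![A + B, A - B]) i ^ 2) =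
      jacobiFekete n + (X ^ n - 1) * crtW q r := by
    simp only [Fin.sum_univ_two, Matrix.cons_val_zero, Matrix.cons_val_one]
    rw [hn, ← crtA_mul_crtB hq0 hr0 hcop, ← hA, ← hB, map_neg]
    linear_combination (A * B) * h4
  have hdegA : A.natDegree < n := natDegree_crtA_lt hq0 hr0
  have hdegB : B.natDegree < n := natDegree_crtB_lt hq0 hr0
  have hdeg : ∀ i, ((![A + B, A - B]) i).natDegree < n := by
    intro i
    fin_cases i
    · exact lt_of_le_of_lt (natDegree_add_le _ _) (max_lt hdegA hdegB)
    · exact lt_of_le_of_lt (natDegree_sub_le _ _) (max_lt hdegA hdegB)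
  -- reals
  have hq1 : (1 : ℝ) ≤ (q : ℝ) := by exact_mod_cast hq0
  have hn1 : (1 : ℝ) ≤ (n : ℝ) := by exact_mod_cast hn0
  have hnpos : (0 : ℝ) < (n : ℝ) := by linarith
  have hceil : (6 : ℝ) ^ (1 / δ) ≤ (q : ℝ) := by
    have h1 : (⌈(6 : ℝ) ^ (1 / δ)⌉₊ : ℝ) ≤ (q : ℝ) := by
      have : ⌈(6 : ℝ) ^ (1 / δ)⌉₊ ≤ q := le_trans (by omega) (le_trans (le_max_right _ _) hq_ge)
      exact_mod_cast this
    exact le_trans (Nat.le_ceil _) h1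
  have hqn : (q : ℝ) ≤ (n : ℝ) := by exact_mod_cast Nat.le_mul_of_pos_right q hr0
  have hnδ : (6 : ℝ) ≤ (n : ℝ) ^ δ := by
    have : ((6 : ℝ) ^ (1 / δ)) ^ δ ≤ (n : ℝ) ^ δ :=
      Real.rpow_le_rpow (by positivity) (hceil.trans hqn) hδ.le
    rwa [← Real.rpow_mul (by norm_num), one_div_mul_cancel hδ.ne', Real.rpow_one] at this
  have hs : ((2 : ℕ) : ℝ) ≤ (n : ℝ) ^ δ := le_trans (by norm_num) hnδ
  have key := H n hn₀ hnodd hnsq 2 (![(4 : ℂ)⁻¹, -(4 : ℂ)⁻¹]) (![A + B, A - B]) (crtW q r) hs hdeg hrep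
  -- support-sum ≤ 2(q + r) < 6 q ≤ 6 √n ≤ n^{1/2+δ}
  have hsuppA : (A.support.card : ℝ) ≤ q := by exact_mod_cast card_support_crtA_le q r
  have hsuppB : (B.support.card : ℝ) ≤ r := by exact_mod_cast card_support_crtB_le q r
  have hsum : (∑ i, (((![A + B, A - B]) i).support.card : ℝ)) ≤ 2 * ((q : ℝ) + r) := by
    simp only [Fin.sum_univ_two, Matrix.cons_val_zero, Matrix.cons_val_one]
    have h1 : (((A + B).support.card : ℕ) : ℝ) ≤ A.support.card + B.support.card := by
      exact_mod_cast card_support_add_le' A B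
    have h2 : (((A - B).support.card : ℕ) : ℝ) ≤ A.support.card + B.support.card := by
      exact_mod_cast card_support_sub_le' A B
    linarith
  have hr' : (r : ℝ) < 2 * q := by exact_mod_cast hrlt
  have hsqrt : (q : ℝ) ≤ Real.sqrt n := by
    rw [← Real.sqrt_sq (Nat.cast_nonneg q)]
    apply Real.sqrt_le_sqrt
    have : ((q * q : ℕ) : ℝ) ≤ (n : ℝ) := by rw [hn]; exact_mod_cast Nat.mul_le_mul_left q hqr.le
    push_cast at this; nlinarith
  have hsplit : (n : ℝ) ^ (1 / 2 + δ) = Real.sqrt n * (n : ℝ) ^ δ := by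
    rw [Real.rpow_add hnpos, ← Real.sqrt_eq_rpow]
  rw [hsplit] at key
  have hsq0 : (0 : ℝ) ≤ Real.sqrt n := Real.sqrt_nonneg _
  nlinarith

end CRT

/-! ## Cycle 5 (gen 5): line post-mortem — the radix threshold of the polarised count (finding 30)

Natural strengthening refuted: "the polarised transport runs with binary (or any bounded) digits".  The budget
inequality (b) of `stub_budget` compares `2^{n+1}·T·(k^{⌊n/2⌋} + k^{n−⌊n/2⌋})` (squares × monomials per square) with
`p^{1/2+δ}`, `p ≤ k^n`; it is FALSE at every level whenever `k^δ ≤ 2`.  (The landed `stub_budget` has `k = n + 1`.) -/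
section Cycle5

/-- radix 2 never runs the polarised line: the budget inequality (b) of `stub_budget` with binary digits
(`n+1 ↦ 2` as radix, `p ≤ 2^n`) is FALSE at every level, for every `0 < δ ≤ 1` and every cut length `T ≥ 1`. -/
theorem radix_two_budget_fails {δ : ℝ} (hδ₀ : 0 < δ) (hδ₁ : δ ≤ 1) (n T p : ℕ) (hT : 1 ≤ T)
    (hp : p ≤ 2 ^ n) :
    (p : ℝ) ^ (1 / 2 + δ) ≤ ((2 ^ (n + 1) * T * (2 ^ (n / 2) + 2 ^ (n - n / 2)) : ℕ) : ℝ) := by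
  have h1 : (p : ℝ) ^ (1 / 2 + δ) ≤ ((2 : ℝ) ^ n) ^ (1 / 2 + δ) :=
    Real.rpow_le_rpow (by positivity) (by exact_mod_cast hp) (by linarith)
  have h2 : ((2 : ℝ) ^ n) ^ (1 / 2 + δ) ≤ ((2 : ℝ) ^ n) ^ ((3 : ℝ) / 2) :=
    Real.rpow_le_rpow_of_exponent_le (one_le_pow₀ (by norm_num)) (by linarith)
  have h3 : ((2 : ℝ) ^ n) ^ ((3 : ℝ) / 2) ≤ (2 : ℝ) ^ (n + 1 + (n - n / 2)) := by
    rw [← Real.rpow_natCast (2 : ℝ) n, ← Real.rpow_mul (by norm_num),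
      ← Real.rpow_natCast (2 : ℝ) (n + 1 + (n - n / 2))]
    apply Real.rpow_le_rpow_of_exponent_le (by norm_num)
    have hdiv : (n / 2) * 2 ≤ n := Nat.div_mul_le_self n 2
    have hsub : ((n - n / 2 : ℕ) : ℝ) = (n : ℝ) - ((n / 2 : ℕ) : ℝ) := by
      rw [Nat.cast_sub (Nat.div_le_self n 2)]
    have hcast : (((n / 2 : ℕ) : ℝ)) * 2 ≤ (n : ℝ) := by exact_mod_cast hdiv
    rw [Nat.cast_add, Nat.cast_add, hsub]
    push_cast
    linarith
  have h4 : (2 : ℝ) ^ (n + 1 + (n - n / 2)) ≤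
      ((2 ^ (n + 1) * T * (2 ^ (n / 2) + 2 ^ (n - n / 2)) : ℕ) : ℝ) := by
    have h : 2 ^ (n + 1 + (n - n / 2)) ≤ 2 ^ (n + 1) * T * (2 ^ (n / 2) + 2 ^ (n - n / 2)) :=
      calc 2 ^ (n + 1 + (n - n / 2)) = 2 ^ (n + 1) * 1 * 2 ^ (n - n / 2) := by rw [pow_add, mul_one]
        _ ≤ 2 ^ (n + 1) * T * (2 ^ (n / 2) + 2 ^ (n - n / 2)) :=
          Nat.mul_le_mul (Nat.mul_le_mul le_rfl hT) (Nat.le_add_left _ _)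
    exact_mod_cast h
  linarith

/-- … while ANY fixed radix `k ≥ 2` with `k^δ ≤ 2` fails the same way (so the count needs `k > 2^{1/δ}`):
with `p ≤ k^n`, `p^{1/2+δ} ≤ k^{n/2}·(k^δ)^n ≤ k^{n/2}·2^n ≤ 2^{n+1}·T·(k^{⌊n/2⌋} + k^{n-⌊n/2⌋})`. -/
theorem fixed_radix_budget_fails {δ : ℝ} (hδ₀ : 0 < δ) (k n T p : ℕ) (hk : 2 ≤ k)
    (hkδ : (k : ℝ) ^ δ ≤ 2) (hT : 1 ≤ T) (hp : p ≤ k ^ n) :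
    (p : ℝ) ^ (1 / 2 + δ) ≤ ((2 ^ (n + 1) * T * (k ^ (n / 2) + k ^ (n - n / 2)) : ℕ) : ℝ) := by
  have hk0 : (0 : ℝ) < k := by exact_mod_cast (lt_of_lt_of_le (by norm_num) hk)
  have hk1 : (1 : ℝ) ≤ k := by exact_mod_cast (le_trans (by norm_num) hk)
  -- p^{1/2+δ} ≤ (k^n)^{1/2+δ} = (k^n)^{1/2} (k^δ)^n ≤ (k^n)^{1/2} 2^n
  have h1 : (p : ℝ) ^ (1 / 2 + δ) ≤ ((k : ℝ) ^ n) ^ (1 / 2 + δ) :=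
    Real.rpow_le_rpow (by positivity) (by exact_mod_cast hp) (by linarith)
  have h2 : ((k : ℝ) ^ n) ^ (1 / 2 + δ) = ((k : ℝ) ^ n) ^ (1 / 2 : ℝ) * ((k : ℝ) ^ δ) ^ n := by
    rw [Real.rpow_add (by positivity)]
    congr 1
    rw [← Real.rpow_natCast_mul hk0.le, mul_comm, Real.rpow_mul_natCast hk0.le]
  have h3 : ((k : ℝ) ^ δ) ^ n ≤ (2 : ℝ) ^ n :=
    pow_le_pow_left₀ (by positivity) hkδ n
  -- (k^n)^{1/2} ≤ k^{n - n/2}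
  have h4 : ((k : ℝ) ^ n) ^ (1 / 2 : ℝ) ≤ (k : ℝ) ^ (n - n / 2) := by
    rw [← Real.rpow_natCast_mul hk0.le, ← Real.rpow_natCast (k : ℝ) (n - n / 2)]
    apply Real.rpow_le_rpow_of_exponent_le hk1
    have hdiv : (n / 2) * 2 ≤ n := Nat.div_mul_le_self n 2
    have hcast : (((n / 2 : ℕ) : ℝ)) * 2 ≤ (n : ℝ) := by exact_mod_cast hdiv
    rw [Nat.cast_sub (Nat.div_le_self n 2)]
    linarith
  have h5 : ((k : ℝ) ^ n) ^ (1 / 2 : ℝ) * ((k : ℝ) ^ δ) ^ n ≤ (k : ℝ) ^ (n - n / 2) * (2 : ℝ) ^ n :=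
    mul_le_mul h4 h3 (by positivity) (by positivity)
  have h6 : (k : ℝ) ^ (n - n / 2) * (2 : ℝ) ^ n ≤
      ((2 ^ (n + 1) * T * (k ^ (n / 2) + k ^ (n - n / 2)) : ℕ) : ℝ) := by
    have h : k ^ (n - n / 2) * 2 ^ n ≤ 2 ^ (n + 1) * T * (k ^ (n / 2) + k ^ (n - n / 2)) :=
      calc k ^ (n - n / 2) * 2 ^ n = 2 ^ n * 1 * k ^ (n - n / 2) := by ring
        _ ≤ 2 ^ (n + 1) * T * (k ^ (n / 2) + k ^ (n - n / 2)) :=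
          Nat.mul_le_mul (Nat.mul_le_mul (Nat.pow_le_pow_right (by norm_num) (Nat.le_succ n)) hT)
            (Nat.le_add_left _ _)
    exact_mod_cast h
  calc (p : ℝ) ^ (1 / 2 + δ) ≤ ((k : ℝ) ^ n) ^ (1 / 2 + δ) := h1
    _ = ((k : ℝ) ^ n) ^ (1 / 2 : ℝ) * ((k : ℝ) ^ δ) ^ n := h2
    _ ≤ (k : ℝ) ^ (n - n / 2) * (2 : ℝ) ^ n := h5
    _ ≤ _ := h6

/-- (finding 30: `hodd : pSel n ≠ 2` is load-bearing for the landed C4.)  At `p = 2` the Legendre specification of C3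
can never ask for the value `−1` … -/
theorem legendreSym_two_ne_neg_one (m : ℤ) : legendreSym 2 m ≠ -1 := by
  by_cases h : (m : ZMod 2) = 0
  · rw [(legendreSym.eq_zero_iff 2 m).2 h]; decide
  · unfold legendreSym
    rw [quadraticChar_eq_one_of_char_two (ZMod.ringChar_zmod_n 2) h]; decide

/-- … while Euler's test `m ^ (p / 2) = −1`, which is what the C1-circuit decides, FIRES at `p = 2` for odd `m`
(`−1 = 1` in `ZMod 2`): the circuit `G ∧ F` of C4 would accept `(enc 1, true)` although `(1|2) = 1`. -/
theorem euler_test_fires_at_two : ((1 : ℕ) : ZMod 2) ^ (2 / 2) = -1 := by decide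

end Cycle5

end

end Summit.ValiantsHypothesis.ValiantsHypothesis.Cruxes.SOSMagnification.Disproof
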